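import Literature.InformationTheory.Entanglement.GraphStatePauliExpectation
import HarnessLib

/-!
# Composition rules for the LHV bound of graph-state Bell inequalities:
# `𝒟` is invariant under permuting the observables of one qubit (Lemma 2),
# `𝒟(G₁ — G₂) ≤ 𝒟(G₁)·𝒟(G₂)` for a single connecting edge (Lemma 3),
# `𝒟` is invariant under local complementation (Lemma 4),
# the exponentially growing violation of long linear cluster states (Theorem 2),
# `𝒟(G) ≥ |⟨a,b,…,n|G⟩|²` for every product state (the geometric-measure bound),
# `𝒟(ST_n) = 𝒟(FC_n) ≥ 1/2` for the GHZ ∕ star-graph state,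
# the invariance of `𝒞(G)` under relabelling the qubits (graph isomorphism), and the reduction of
# stochastic to deterministic local models for an arbitrary family of signed Pauli words, and the
# two-vertex case of Theorem 1 (`|G_{K₂}⟩` reaches the CHSH value `2√2 > 2`)
# (Gühne–Tóth–Hyllus–Briegel 2005)

Topic `Literature/InformationTheory/Entanglement`, continuation of `GraphStatePauliExpectation.lean` (the terms
`s_ξ = c(ξ)·⊗_jσ^{(j)}` of the Bell operator `𝓑(G) = Σ_ξ s_ξ` as `stabSign G ξ`, `stabWord G ξ`; the deterministic
LHV value `lhvBell G m = Σ_ξ c(ξ)·Π_j m_j(σ_ξ^{(j)})` of a `±1` table `m`; Lemma 1 `exists_table_Z_one`; Table I for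
`n = 4`: `abs_lhvBell_lc4_le`, `|⟨𝓑(LC_4)⟩_{LHV}| ≤ 12`). Source (held text, `lit read arxiv:quant-ph/0410059`):

* O. Gühne, G. Tóth, P. Hyllus, H. J. Briegel, *Bell inequalities for graph states*, Phys. Rev. Lett. **95**,
  120405 (2005) = arXiv:quant-ph/0410059 [GuhneTothHyllusBriegel2005]. arXiv p. 3: eq. (7) “`𝒞(G) = max_{LHV}|⟨𝓑⟩|`
  … it suffices to look at deterministic LHV models”, “the normalized parameter `𝒟(G) := 𝒞(G)/2^n`”;
  “**Lemma 2.** Let `𝓑` be a Bell operator for an arbitrary graph and let `𝓑'` be the Bell operator which is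
  obtained from `𝓑` by making a permutation `P : {𝟙^{(i)}, X^{(i)}, Y^{(i)}, Z^{(i)}} → {𝟙^{(i)}, X^{(i)}, Y^{(i)}, Z^{(i)}}`
  of the observables on one qubit. Then `𝒟(𝓑) = 𝒟(𝓑')`. *Proof.* It suffices to show the Lemma for a
  transposition … Some transpositions are a renaming of variables, and the interesting transpositions are of the
  type `A^{(i)} ↔ 𝟙^{(i)}` … If the LHV model assigns `−1` to `X^{(i)}` we can construct a new LHV model `LHV_2` from
  `LHV_1` by flipping the signs from `Y^{(i)}, Z^{(i)}`. This fulfills `⟨𝓑'⟩_{LHV_1} = −⟨𝓑⟩_{LHV_2}`. This proves the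
  claim, since `𝒞` is defined via the absolute value.”; “**Lemma 3.** Let `G_1, G_2` be two graphs and let `G` be
  the graph which comprises `G_1` and `G_2` and one single connection between one vertex of `G_1` and one of `G_2`,
  i.e., `G = G_1 — G_2`. Then `𝒟(G) ≤ 𝒟(G_1)𝒟(G_2)`. *Proof.* The proof is given in the Appendix.”; arXiv p. 4:
  “**Theorem 2.** Let `G_1, G_2, G_3, …` be a family of tree graphs … such that each `G_i` contains as a subgraph a
  linear chain of a size which increases linearly with `i`. Then violation of a Bell inequality for `|G_i⟩` increases
  exponentially with `i`. *Proof.* From Lemma 3 and Table I it follows that for linear cluster graphs `LC_i` the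
  value `1/𝒟(LC_i)` increases exponentially. For tree graphs Lemma 3 can be applied again …”; “all graphs which are
  built by connecting an increasing number of subgraphs via single edges exhibit an exponentially increasing
  violation of local realism, due to Lemma 3.” Appendix (arXiv pp. 4–5): “assume that the connection is between the
  vertices `i_0 ∈ G_1` and `j_0 ∈ G_2`. We can write any stabilizing operator of `G` as `s_{ij}(G) = a_i b_j` … six
  disjoint subsets … `𝔄_1, 𝔄_2` contain the `a_i` where `g_{i_0}` is absent, `𝔄_3, 𝔄_4` have an `X^{(i_0)}` at the
  vertex `i_0` and `𝔄_5, 𝔄_6` have a `Y^{(i_0)}` … `γ_a := p_a − q_a`, `δ_a := r_a − s_a`, `ε_a := t_a − u_a`. Then we have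
  `|⟨𝓑(G_1)⟩| = |γ_a + δ_a + ε_a| ≤ 𝒞(G_1)` … By flipping the sign which is assigned to `X^{(i_0)}` … `|γ ± δ ± ε| ≤ 𝒞`
  … In the blocks with `i ≤ 2` or `j ≤ 2` the extra connection only introduces transformations of the type
  `Z ↔ 𝟙` at `i_0` or `j_0`, which can be neglected due to Lemma 1 … here the extra connection induces the
  transformation `{X^{(i_0)}X^{(j_0)}, X^{(i_0)}Y^{(j_0)}, Y^{(i_0)}X^{(j_0)}, Y^{(i_0)}Y^{(j_0)}} ↦
  {Y^{(i_0)}Y^{(j_0)}, −Y^{(i_0)}X^{(j_0)}, −X^{(i_0)}Y^{(j_0)}, X^{(i_0)}X^{(j_0)}}` … depending on the LHV model, this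
  results in this block matrix in two possible changes of signs … `|Σ_{ij}⟨s_{ij}⟩| = |γ_a(γ_b + δ_b + ε_b) +
  δ_a(γ_b + δ_b − ε_b) + ε_a(γ_b − δ_b + ε_b)| ≤ 𝒞(G_1)𝒞(G_2)`. This can be derived from Eq. (toll3), distinguishing 64
  cases …”; Table I (`𝒟(LC_4) = 3/4`, computed in the tree: `abs_lhvBell_lc4_le`); arXiv p. 3: “The local
  complementation of a graph acts on the graph state as a local unitary transformation of the (local) Clifford group
  [graphs1,graphs2]. This means that it transforms on each qubit Pauli matrices into Pauli matrices. So we have: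
  **Lemma 4.** Let `G_1` be a graph and `G_2` be a graph which arises from `G_1` by local complementation. Then
  `𝒟(G_1) = 𝒟(G_2)`. *Proof.* Since the local complementation maps Pauli matrices to Pauli matrices on each qubit,
  `𝒟` is not changed due to Lemma 2.”; “the graph `ST_n` can be transformed by a local complementation on the
  central qubit into the graph `FC_n`”; arXiv p. 4: “Due to Lemma 4, the values `𝒟(ST_n)` and `𝒟(FC_n)` always
  coincide.”; arXiv p. 4: “A Bell inequality `|⟨𝓑⟩| ≤ 𝒞(G)` is equivalent to a witness of the type
  `𝒲 = 𝒞(G) − |G⟩⟨G|` … First, since all fully separable states `|ψ⟩ = |a⟩|b⟩…|n⟩` admit a LHV description, here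
  `𝒟(G) ≥ max_{|a⟩|b⟩…|n⟩} |⟨a,b,…,n|G⟩|²` has to hold. The quantity `1 − max_{|a⟩|b⟩…|n⟩}|⟨a,b,…,n|G⟩|²` has been
  shown to be an entanglement monotone for multipartite systems, the so-called geometric measure of entanglement
  [wei]. So our bounds on `𝒞` also deliver lower bounds for this measure of entanglement for graph states. In turn,
  the fact that the geometric measure equals `1/2` for all GHZ states implies that always `𝒟(ST_n) ≥ 1/2`.” The
  LC-rule itself (`|τ_a(G)⟩ = U_a^τ(G)|G⟩`, `U_a^τ(G) = e^{−iπ/4σ_x^{(a)}} e^{iπ/4σ_z^{N_a}}`) is the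
  tree's `lcUnitary_mulVec_graphStateVec` ∕ `graphStateVec_localComplement_eq` [HeinEtAl2006GraphStates,
  Proposition 2; HeinEisertBriegel2004, Proposition 8] in `GraphStateLocalComplementation.lean`.

HONEST FRAMING (pub-qadeq lane — Bell-type correlation data reported for prepared graph and cluster states):
instance-level adjudication of specific advantage claims; no claim about BQP vs BPP or the summit. Nothing here
concerns devices or statistics; these are bounds on deterministic local-hidden-variable values of `𝓑(G)`.

## Contents (all proved, 0 named facts)

* **The trivial bound** `abs_lhvBell_le_two_pow` (`|⟨𝓑(G)⟩_{LHV}| ≤ 2^N`, i.e. `𝒟 ≤ 1`) and the **phase-product form of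
  a term**: `yphase`, `siteVal`, **`stabSign_cast`** (`c(ξ) = (−1)^{q_G(ξ)}·Π_j (−i)^{[σ^{(j)}_ξ = Y]}` in `ℂ`) and
  **`term_cast`** (`c(ξ)·Π_j m_j(σ^{(j)}_ξ) = (−1)^{q_G(ξ)}·Π_j (−i)^{[σ^{(j)} = Y]} m_j(σ^{(j)})`): every term of
  `⟨𝓑(G)⟩_{LHV}` is a product of per-site quantities times the edge-parity sign — the bookkeeping device used for
  Lemma 3 below (the source's sets `𝔄_1,…,𝔄_6` are read off site by site).
* **Lemma 2** for an arbitrary family of signed Pauli words (`lhvSum c w m = Σ_i c_i Π_j m_j(w_i^{(j)})`,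
  `lhvBell_eq_lhvSum`): **`permuteSite P i w`** (the permutation `P` of `{𝟙, X, Y, Z}` applied at qubit `i`),
  **`permuteTable P i m`** (the source's `LHV_2`: `m'_i(Q) = m_i(PQ)·m_i(P𝟙)` — the “renaming of variables”
  together with the sign flip `m_i(P𝟙)` of the case `A^{(i)} ↔ 𝟙^{(i)}`), **`lhvSum_permuteTable`**
  (`⟨𝓑⟩_{LHV_2} = m_i(P𝟙)·⟨𝓑'⟩_{LHV_1}`), **`abs_lhvSum_permuteSite`** and **`forall_abs_lhvSum_permuteSite_le_iff`**:
  `𝒞(𝓑) ≤ C ↔ 𝒞(𝓑') ≤ C` for every `C`, i.e. `𝒟(𝓑) = 𝒟(𝓑')`.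
* **Lemma 3.** **`IsSingleEdgeJoin G G₁ G₂ i₀ j₀`** (the graph `G = G₁ — G₂` on `Fin (N₁ + N₂)`: `G₁` on the first
  block `Fin.castAdd`, `G₂` on the second block `Fin.natAdd`, and the single connection `{i₀, j₀}`), the explicit
  **`singleEdgeJoin G₁ G₂ i₀ j₀`** with `isSingleEdgeJoin_singleEdgeJoin`; the structure of the stabilizer of `G`:
  **`nbrParity_join_inl ∕ _inr`**, **`edgeParity_join`** (`q_G(ξ) = q_{G₁}(ξ₁) + q_{G₂}(ξ₂) + ξ_{i₀}ξ_{j₀}`),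
  **`stabWord_join_inl_of_ne ∕ _inr_of_ne`** (`s_{ij}(G) = a_i b_j` away from `i₀, j₀`), the letters at `i₀, j₀`
  (`stabWord_join_i₀ ∕ _j₀`: `Z ↔ 𝟙` when the partner generator is present, and the printed
  `{XX, XY, YX, YY} ↦ {YY, −YX, −XY, XX}`), **`joinSign`** (the “two possible changes of signs” `±p`,
  `p = m_{i₀}(X)m_{i₀}(Y)m_{j₀}(X)m_{j₀}(Y)`), **`term_join`** (`⟨s_{ij}(G)⟩ = J·⟨a_i⟩⟨b_j⟩` for a `Z`-normalised table),
  the classes `𝔄_{1,2} ∕ 𝔄_{3,4} ∕ 𝔄_{5,6}` as **`cls`** `∈ {none, some false, some true}` with **`classSum`**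
  (`γ, δ, ε`), **`lhvBell_eq_sum_classSum`** (`⟨𝓑(G₁)⟩ = γ + δ + ε`), **`lhvBell_join_eq`**
  (`⟨𝓑(G)⟩ = Σ_{κλ} J_{κλ} A_κ B_λ`), **`scaleXY`** ∕ **`lhvBell_scaleXY`** (flipping `X^{(i₀)}` ∕ `Y^{(i₀)}` gives
  `γ ± δ ± ε`), **`sum_abs_classSum_le`** (`|γ| + |δ| + |ε| ≤ 𝒞(G₁)`), and the theorem
  **`abs_lhvBell_le_mul_of_isSingleEdgeJoin`**: if `|⟨𝓑(G₁)⟩_{LHV}| ≤ C₁` and `|⟨𝓑(G₂)⟩_{LHV}| ≤ C₂` for all `±1`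
  tables then `|⟨𝓑(G)⟩_{LHV}| ≤ C₁C₂` for all `±1` tables — `𝒞(G) ≤ 𝒞(G₁)𝒞(G₂)`, equivalently (dividing by
  `2^{N₁+N₂}`, `dd_le_mul_of_isSingleEdgeJoin`) `𝒟(G) ≤ 𝒟(G₁)𝒟(G₂)`; **`abs_lhvBell_singleEdgeJoin_le`** for the
  explicit join and **`abs_lhvBell_le_mul_two_pow_of_isSingleEdgeJoin`** (attaching any graph by one edge does not
  increase `𝒟` — the step used “again” for tree graphs).
* **Theorem 2 for linear clusters**: **`isSingleEdgeJoin_linearCluster`** (`LC_{n+k} = LC_n — LC_k`),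
  **`abs_lhvBell_linearCluster_mul_four_le`** (`|⟨𝓑(LC_{4k})⟩_{LHV}| ≤ 12^k`, from Lemma 3 and `𝒞(LC_4) = 12`),
  **`abs_lhvBell_linearCluster_le`** (`LC_{4k+r}`, `r < 4`: `≤ 12^k·2^r`) and **`dd_linearCluster_le`**
  (`𝒟(LC_{4k}) ≤ (3/4)^k`: “for linear cluster graphs `LC_i` the value `1/𝒟(LC_i)` increases exponentially”).
* **Lemma 4.** The letter tables of the LC-unitary: **`xConjPerm`** ∕ **`xConjSgn`** (`e^{−iπ/4σ_x}`: `X ↦ X`,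
  `Y ↦ Z`, `Z ↦ −Y`; **`xRoot_conj`**), **`zConjPerm`** ∕ **`zConjSgn`** (`e^{iπ/4σ_z}`: `X ↦ −Y`, `Y ↦ X`, `Z ↦ Z`;
  **`zRoot_conj`**), **`lcPerm G a j`** ∕ **`lcSgn G a j`** (site `a`: the `x`-table, `N_a`: the `z`-table, else
  identity), **`lcLetter_conj`**, **`lcUnitary_conj_pauliWord`** (`U(⊗_jσ_j)U† = (Π_j lcSgn_j(σ_j))·⊗_j lcPerm_j(σ_j)`
  — “it transforms on each qubit Pauli matrices into Pauli matrices”); the term map **`lcPat G a ξ`**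
  (`ξ'_a = ξ_a ⊕ (Γξ)_a`, an involution: `lcPat_lcPat`), **`xPart_lcPermWord`**, **`conj_bellTerm_eq`**,
  **`conj_bellTerm_mulVec`** (`U s_ξ U†` stabilises `|τ_a G⟩`), **`stabWord_stabSign_localComplement`** (the
  conjugated term IS the term `ξ'` of `𝓑(τ_a G)`: equal word, and `c_{τ_aG}(ξ') = c_G(ξ)·Π_j lcSgn_j` — from
  `expect_pauliWord` and uniqueness of the stabilizing sign); the tables **`lcTable`** ∕ **`lcTableInv`**
  (`m'_j(σ) = lcSgn_j(σ)·m_j(lcPerm_jσ)`, Lemma 2's renaming-with-signs at every site), **`lhvValue_lcTable`**,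
  **`lhvBell_localComplement`** (`⟨𝓑(τ_a G)⟩_m = ⟨𝓑(G)⟩_{m'}` for every table), and
  **`forall_abs_lhvBell_localComplement_le_iff`**: `𝒞(G) ≤ C ↔ 𝒞(τ_a G) ≤ C` for every `C` — `𝒟(G) = 𝒟(τ_a G)`;
  corollary **`forall_abs_lhvBell_starGraph_le_iff_top`** (`𝒟(ST_n) = 𝒟(FC_n)`, via the tree's
  `localComplement_starGraph`; the decidability instances are transported along the graph equality).
* **Product states ∕ geometric measure**: **`lhvBellR G r`** (the value of `𝓑(G)` under a real table
  `r_j(σ) ∈ [−1,1]`; `lhvBellR_intCast`), **`coeffAt`** ∕ **`lhvBellR_eq_sum_coeffAt`** (affine in the values at one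
  site), **`exists_vertex_ge`** (an affine function on `[−1,1]³` is maximised in absolute value at a vertex),
  **`exists_update_signs`**, **`exists_pm_table_ge`** (every `[−1,1]`-table is dominated by a `±1` table — “it
  suffices to look at deterministic LHV models”), **`abs_bloch_le_one`** ∕ **`bloch_I`**, **`expect_bellTerm_productVec`**
  ∕ **`expect_bellOperator_productVec`** (`⟨⊗φ|𝓑(G)|⊗φ⟩ = ⟨𝓑⟩_r` with `r_j(σ) = ⟨φ_j|σ|φ_j⟩`, the Bloch components),
  **`two_pow_mul_normSq_productVec_le`** (`𝒞(G) ≤ C ⇒ 2^N|⟨G|⊗φ⟩|² ≤ C` for every product of unit qubits: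
  “`𝒟(G) ≥ max |⟨a,b,…,n|G⟩|²`”), **`normSq_productVec_le_dd`** and **`normSq_productVec_linearCluster_le`**
  (`|⟨⊗φ|LC_{4k}⟩|² ≤ (3/4)^k`: the geometric measure of the `4k`-qubit linear cluster state is `≥ 1 − (3/4)^k`).
* **Stochastic models ∕ the GHZ (star-graph) state**: **`abs_lhvBellR_le`** (`𝒞(G) ≤ C ⇒ |⟨𝓑(G)⟩_r| ≤ C` for every
  `[−1,1]`-valued table with `r(𝟙) = 1` — the bound holds for nondeterministic models), **`star_starBranch_dotProduct_self`**,
  **`star_graphStateVec_starGraph_dotProduct_productState`** (`⟨ST_a | 0⟩_a|+⟩^{⊗(V∖a)} = 1/√2`, from the tree's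
  `graphStateVec_starGraph_eq_sum_productState`), **`two_pow_le_two_mul_of_forall_abs_lhvBell_starGraph_le`** ∕
  **`half_le_dd_starGraph`** (“always `𝒟(ST_n) ≥ 1/2`”: every LHV bound `C` of `𝓑(ST_n)` has `2^N ≤ 2C`) and
  **`two_pow_le_two_mul_of_forall_abs_lhvBell_top_le`** (the same for `FC_n`, by Lemma 4).
* **Relabelling the qubits**: for `H ≅ G` along `e : Fin N ≃ Fin M` (`H.Adj i j ↔ G.Adj (e i) (e j)`):
  **`nbrParity_relabel`**, **`stabZ_relabel`**, **`stabWord_relabel`** (`σ^{(i)}_ξ(H) = σ^{(e i)}_{ξ∘e⁻¹}(G)`),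
  **`countY_comp_equiv`**, **`litEdgeCount_relabel`** ∕ **`edgeParity_relabel`** (an isomorphism of the lit-edge
  graphs), **`stabSign_relabel`**, **`lhvValue_relabel`**, **`lhvBell_relabel`** (`⟨𝓑(H)⟩_m = ⟨𝓑(G)⟩_{m∘e⁻¹}`),
  **`forall_abs_lhvBell_relabel_le_iff`** (`𝒞(H) ≤ C ↔ 𝒞(G) ≤ C`: `𝒞` is a graph invariant), and the user-facing
  forms of Lemma 3 and Theorem 2 for arbitrarily labelled graphs, **`abs_lhvBell_le_mul_of_relabel_isSingleEdgeJoin`**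
  (`H ≅ G₁ — G₂ ⇒ 𝒞(H) ≤ 𝒞(G₁)𝒞(G₂)`) and **`abs_lhvBell_le_of_relabel_linearCluster`** (`H ≅ LC_{4k+r} ⇒
  |⟨𝓑(H)⟩| ≤ 12^k·2^r`).
* **Stochastic models for any family of signed words** `(c_i, w_i)` (the `lhvSum` of Lemma 2): **`lhvSumR`** (value under a
  `[−1,1]`-valued table), **`coeffAtF`** ∕ **`lhvSumR_eq_sum_coeffAtF`** ∕ **`coeffAtF_update`**, **`exists_update_signsF`**,
  **`exists_pm_table_geF`** (every `[−1,1]` table with `r(𝟙) = 1` is dominated by a `±1` table), **`abs_lhvSumR_le`**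
  (a bound valid for all deterministic tables holds for all stochastic ones) — used by the Bell expressions of
  `ClusterStateBellInequality.lean`.
* **Theorem 1, two vertices** (“If the graph consists only of two connected vertices, the graph state is equivalent to a
  two qubit singlet state, which violates the original Bell inequality”): **`lc2`**, **`stabWord_lc2`** (`XZ`, `ZX`, `YY`,
  kernel), **`expect_XZ_lc2`** ∕ **`expect_YY_lc2`** (`= 1`), **`bobSetting`** (`(Z ± Y)/√2`, dichotomic and Hermitian:
  `bobSetting_mul_self`, `bobSetting_conjTranspose`), **`chshGraphOp`** (`X⊗B + X⊗B′ + Y⊗B − Y⊗B′`), **`chshGraphOp_eq`**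
  (`= √2(X⊗Z + Y⊗Y)`), **`expect_chshGraphOp`** (`⟨G_{K₂}|𝒪|G_{K₂}⟩ = 2√2`), **`two_lt_chsh_value`**, **`chsh_lhv`** (`|ab + ab′ +
  a′b − a′b′| ≤ 2`); the `≥ 3`-vertex case is `GraphStatePauliExpectation.lhvBell_le_of_triple`.

Design ∕ deviations. (1) The proof of Lemma 3 follows the Appendix up to its last step: the decomposition
`s_{ij} = a_ib_j`, the six classes by the letter at `i₀` (`g_{i₀}` absent ∕ `X^{(i₀)}` ∕ `Y^{(i₀)}`), Lemma 1 for the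
`Z ↔ 𝟙` changes, the transformation at `(i₀, j₀)` with its two sign patterns, and the flipped tables giving
`|γ ± δ ± ε| ≤ 𝒞(G₁)`. For the final inequality the source distinguishes 64 sign cases; here the shorter road is taken:
`⟨𝓑(G)⟩ = Σ_{κλ} J_{κλ}A_κB_λ` with `J_{κλ} ∈ {±1}`, so `|⟨𝓑(G)⟩| ≤ (|γ_a|+|δ_a|+|ε_a|)(|γ_b|+|δ_b|+|ε_b|)`, and
`|γ|+|δ|+|ε| = |γ ± δ ± ε|` for a suitable choice of the two signs, which is `≤ 𝒞` by the flipped table. (2) The sign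
`c(ξ) = (−1)^{#Y/2}(−1)^{q_G(ξ)}` is handled through the tree's identity `c(ξ) = ⟨G|⊗_jσ^{(j)}|G⟩ = (−i)^{#Y}(−1)^{q_G(ξ)}`
(`expect_stabWord`, `expect_stabWord_eq_stabSign`), which makes it a product over sites in `ℂ`. (3) `G = G₁ — G₂` is an
interface (`IsSingleEdgeJoin`, three adjacency conditions), so that a concrete graph such as `linearCluster (n + 4)`
with its own decidability instance can be fed in; the explicit join is also constructed, and the relabelling
invariance (`lhvBell_relabel`, by reindexing the `2^N` terms along `ξ ↦ ξ∘e⁻¹`) transports both Lemma 3 and Theorem 2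
to arbitrarily numbered qubits. (4) Theorem 2 is formalised
for the linear clusters themselves (the quantitative core: `𝒟(LC_{4k}) ≤ (3/4)^k`) together with the one-edge
attachment step; the induction over arbitrary tree graphs (“the longest linear cluster in `G_i`”) and the other
families “built by connecting an increasing number of subgraphs via single edges” are NOT spelled out. (5) Lemma 4
is proved through the operator route the source indicates (“acts on the graph state as a local unitary … transforms
on each qubit Pauli matrices into Pauli matrices … due to Lemma 2”): the conjugated term `U s_ξ U†` is identified
with the term `ξ'` of `𝓑(τ_a G)` by the stabilizer property rather than by recomputing `Γ_{τ_aG}`, and the LHV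
transfer is the sitewise signed renaming of Lemma 2 (applied at all sites at once). (6) “Fully separable states
admit a LHV description” is made quantitative: a product state evaluates `𝓑(G)` as the `[−1,1]`-valued table of its
Bloch components, and a multi-affine function on the cube is dominated by a vertex, i.e. a deterministic table
(the source's remark that nondeterministic models reduce to deterministic ones); the statement is for pure product
vectors (mixed fully separable states follow by convexity, not spelled out). NOT here: Theorem 3 (PPT), the witness
`𝒲 = 𝒞(G) − |G⟩⟨G|` as an operator inequality, the Table I entries for `n ≥ 5`, and the converse half of Hein et
al.'s Proposition 2 (LC-equivalence ⇒ sequence of local complementations).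

Depends on: `GraphStatePauliExpectation.lean` (`stabWord`, `stabZ`, `stabSign`, `lhvValue`, `lhvBell`, `countY`,
`expect_stabWord`, `expect_stabWord_eq_stabSign`, `exists_table_Z_one`, `abs_lhvBell_lc4_le`, `nbrParity`, `bxor`),
`GraphStateLocalComplementation.lean` (`linearCluster`, `linearCluster_adj`, `localComplement`, `lcUnitary`, `lcLetter`,
`xRoot`, `zRoot`, `omega`, `graphStateVec_localComplement_eq`, `lcUnitary_conjTranspose_mul`, `localComplement_starGraph`,
`starBranch`, `xKet_eq`, `graphStateVec_starGraph_eq_sum_productState`, `star_productState_starBranch_dotProduct_self`),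
`PauliParseval.lean` (`tensorAll_mul`, `conjTranspose_tensorAll`), `SpinSqueezingCriterion.lean` (`productVec`, `bloch`,
`bloch_sq_sum`, `star_dotProduct_pauli_mulVec`), `ProductStateExpectation.lean` (`expect_tensorAll_productState`,
`productState`, `star_productState_dotProduct_productState`),
`GraphStatePauliExpectation.lean` (`expect_bellOperator_vec`), `GraphStateStabilizerWitness.lean`
(`edgeParity`, `bitZ`, `edgeParity_eq_litEdgeCount`), `GraphStateCutRank.lean` (`chi`, `litEdges`, `litEdgeCount`), `PauliExpansion.lean` (`Pauli`); Mathlib: `Fin.sum_univ_add`,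
`Fin.prod_univ_add`, `Fin.append_left ∕ _right`, `Finset.sum_fiberwise`, `Fintype.sum_option ∕ sum_bool`,
`Finset.mul_prod_erase`, `Finset.abs_sum_le_sum_abs`, `finSumFinEquiv`, `Fintype.sum_equiv ∕ prod_equiv`,
`Equiv.arrowCongr`, `Finset.mem_map_equiv`, `SimpleGraph.Iso.card_edgeFinset_eq`. No instances, no notation, no `def … : Prop`.
-/

namespace Literature.InformationTheory.Entanglement

namespace GraphStateLC

open Matrix Complex Finset
open Literature.Computability.QuantumComplexity
open Literature.Computability.QuantumComplexity.GraphStateCutRank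
open GHZWitness GraphStateWitness MerminKlyshkoGHZ

section BellComposition

variable {N : ℕ} (G : SimpleGraph (Fin N)) [DecidableRel G.Adj]

/-! ### The trivial bound `𝒟 ≤ 1` and the phase-product form of a term -/

omit G [DecidableRel G.Adj] in
/-- A `±1` value squares to `1`. [folklore] -/
private theorem mul_self_of_pm {t : ℤ} (h : t = 1 ∨ t = -1) : t * t = 1 := by
  rcases h with rfl | rfl <;> norm_num

omit G [DecidableRel G.Adj] in
/-- An LHV prediction is `±1`: `lhv(w)² = 1`. [folklore] -/
private theorem lhvValue_mul_self' (m : Fin N → Pauli → ℤ) (hm : ∀ j P, m j P = 1 ∨ m j P = -1)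
    (w : Fin N → Pauli) : lhvValue m w * lhvValue m w = 1 := by
  unfold lhvValue
  rw [← Finset.prod_mul_distrib]
  exact Finset.prod_eq_one fun j _ => mul_self_of_pm (hm j (w j))

omit G [DecidableRel G.Adj] in
/-- `t² = 1 ⇒ |t| = 1` in `ℤ`. [folklore] -/
private theorem abs_eq_one_of_mul_self {t : ℤ} (h : t * t = 1) : |t| = 1 := by
  rcases Int.mul_eq_one_iff_eq_one_or_neg_one.mp h with ⟨h1, -⟩ | ⟨h1, -⟩ <;> simp [h1]

/-- Every term `c(ξ)·lhv(s_ξ)` of `⟨𝓑(G)⟩_{LHV}` has absolute value `1`. [cite: GuhneTothHyllusBriegel2005, eq. (7)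
(deterministic models “assign definite values `{+1,−1}` to the observables”)] -/
theorem abs_term_eq_one (m : Fin N → Pauli → ℤ) (hm : ∀ j P, m j P = 1 ∨ m j P = -1) (ξ : Fin N → Bool) :
    |stabSign G ξ * lhvValue m (stabWord G ξ)| = 1 :=
  abs_eq_one_of_mul_self (by
    calc stabSign G ξ * lhvValue m (stabWord G ξ) * (stabSign G ξ * lhvValue m (stabWord G ξ))
        = (stabSign G ξ * stabSign G ξ) * (lhvValue m (stabWord G ξ) * lhvValue m (stabWord G ξ)) := by ring
      _ = 1 := by rw [stabSign_mul_self, lhvValue_mul_self' m hm, mul_one])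

/-- **The trivial bound `|⟨𝓑(G)⟩_{LHV}| ≤ 2^N`** (`2^N` terms of absolute value `1`): `𝒟(G) ≤ 1` always, “we have a
valid Bell inequality whenever `𝒟 < 1`”. [cite: GuhneTothHyllusBriegel2005, p. 3 (definition of `𝒟(G) := 𝒞(G)/2^n`)] -/
theorem abs_lhvBell_le_two_pow (m : Fin N → Pauli → ℤ) (hm : ∀ j P, m j P = 1 ∨ m j P = -1) :
    |lhvBell G m| ≤ 2 ^ N := by
  unfold lhvBell
  refine (Finset.abs_sum_le_sum_abs _ _).trans ?_
  simp only [abs_term_eq_one G m hm]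
  rw [Finset.sum_const, Finset.card_univ, Fintype.card_fun, Fintype.card_bool, Fintype.card_fin]
  simp

omit G [DecidableRel G.Adj] in
/-- The phase `(−i)^{[σ = Y]}` of one letter (so that `(−i)^{#Y} = Π_j (−i)^{[σ^{(j)} = Y]}`).
[cite: GuhneTothHyllusBriegel2005, eq. (5) (`s_i(G) = ⊗_k O_i^{(k)}`, `O_i^{(k)} ∈ {𝟙, ±X, ±Y, ±Z}` — the sign of the
term is collected letter by letter)] -/
def yphase (P : Pauli) : ℂ := if P = Pauli.Y then -Complex.I else 1

omit G [DecidableRel G.Adj] in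
/-- `(−i)^{#Y(w)} = Π_j (−i)^{[w_j = Y]}`. [cite: GuhneTothHyllusBriegel2005, eq. (5)] -/
theorem negI_pow_countY (w : Fin N → Pauli) : (-Complex.I) ^ countY w = ∏ j, yphase (w j) := by
  unfold countY yphase
  rw [Finset.prod_ite, Finset.prod_const_one, mul_one, Finset.prod_const]

/-- **The sign of a term as a product over sites**: `c(ξ) = (−1)^{q_G(ξ)} · Π_j (−i)^{[σ^{(j)}_ξ = Y]}` in `ℂ` (from
`c(ξ) = ⟨G|⊗_jσ^{(j)}|G⟩ = (−i)^{#Y}(−1)^{q_G(ξ)}`). [cite: GuhneTothHyllusBriegel2005, eqs. (3)–(5);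
HeinEisertBriegel2004, §2 (`Π_{a∈ξ}K_a = ±σ_x^ξσ_z^{Γξ}`)] -/
theorem stabSign_cast (ξ : Fin N → Bool) :
    (stabSign G ξ : ℂ) = chi (edgeParity G ξ) * ∏ j, yphase (stabWord G ξ j) := by
  rw [← expect_stabWord_eq_stabSign, expect_stabWord, negI_pow_countY, mul_comm]

omit G [DecidableRel G.Adj] in
/-- The per-site value `(−i)^{[σ = Y]}·m_j(σ)` of a letter under a table. [cite: GuhneTothHyllusBriegel2005, Appendix
(“For `a_i ∈ 𝔄_1, 𝔄_3, 𝔄_5` the LHV model gives `⟨a_i⟩ = +1` while for the `a_i ∈ 𝔄_2, 𝔄_4` or `𝔄_6` we have `⟨a_i⟩ = −1`”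
— the value of a term is read off letter by letter)] -/
def siteVal (m : Fin N → Pauli → ℤ) (j : Fin N) (P : Pauli) : ℂ := yphase P * (m j P : ℂ)

/-- **Phase-product form of a term**: `c(ξ)·Π_j m_j(σ^{(j)}_ξ) = (−1)^{q_G(ξ)}·Π_j (−i)^{[σ^{(j)}_ξ = Y]}m_j(σ^{(j)}_ξ)`.
[cite: GuhneTothHyllusBriegel2005, eqs. (5)–(7) and Appendix (`⟨s_{ij}⟩ = ⟨a_i⟩⟨b_j⟩`)] -/
theorem term_cast (m : Fin N → Pauli → ℤ) (ξ : Fin N → Bool) :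
    ((stabSign G ξ * lhvValue m (stabWord G ξ) : ℤ) : ℂ) =
      chi (edgeParity G ξ) * ∏ j, siteVal m j (stabWord G ξ j) := by
  unfold siteVal lhvValue
  push_cast
  rw [stabSign_cast, Finset.prod_mul_distrib, mul_assoc]

/-! ### Lemma 2: permuting `{𝟙, X, Y, Z}` on one qubit does not change `𝒟` -/

section LemmaTwo

variable {ι : Type*}

omit G [DecidableRel G.Adj] in
/-- **`𝓑'`: the permutation `P` of `{𝟙, X, Y, Z}` applied to the observables at qubit `i`** of every term.
[cite: GuhneTothHyllusBriegel2005, Lemma 2] -/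
def permuteSite (P : Equiv.Perm Pauli) (i : Fin N) (w : ι → Fin N → Pauli) : ι → Fin N → Pauli :=
  fun k j => if j = i then P (w k j) else w k j

omit G [DecidableRel G.Adj] in
/-- Undoing the permutation: `(𝓑')'` with `P⁻¹` is `𝓑`. [cite: GuhneTothHyllusBriegel2005, Lemma 2] -/
theorem permuteSite_symm (P : Equiv.Perm Pauli) (i : Fin N) (w : ι → Fin N → Pauli) :
    permuteSite P.symm i (permuteSite P i w) = w := by
  funext k j
  unfold permuteSite
  split_ifs with h
  · exact P.symm_apply_apply _
  · rfl

variable [Fintype ι]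

omit G [DecidableRel G.Adj] in
/-- **The LHV value of a general Bell operator `Σ_i c_i ⊗_j O_i^{(j)}`** given as a family of signed Pauli words
(`c_i ∈ ℤ`, words `w_i`): `Σ_i c_i Π_j m_j(w_i^{(j)})`. For `𝓑(G)` the family is `(c(ξ), ⊗_jσ^{(j)}_ξ)_ξ`
(`lhvBell_eq_lhvSum`). [cite: GuhneTothHyllusBriegel2005, Lemma 2 (“Let `𝓑` be a Bell operator for an arbitrary graph
and let `𝓑'` be the Bell operator which is obtained from `𝓑` by making a permutation … of the observables on one
qubit”) and eq. (7)] -/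
def lhvSum (c : ι → ℤ) (w : ι → Fin N → Pauli) (m : Fin N → Pauli → ℤ) : ℤ := ∑ i, c i * lhvValue m (w i)

/-- `⟨𝓑(G)⟩_{LHV}` is the `lhvSum` of the family `(c(ξ), σ_ξ)_ξ`. [cite: GuhneTothHyllusBriegel2005, eqs. (6)–(7)] -/
theorem lhvBell_eq_lhvSum (m : Fin N → Pauli → ℤ) : lhvBell G m = lhvSum (stabSign G) (stabWord G) m := rfl

omit G [DecidableRel G.Adj] in
/-- **The table `LHV_2` of the proof of Lemma 2**: at qubit `i`, `m'_i(Q) := m_i(PQ)·m_i(P𝟙)` (a renaming of the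
variables composed with the sign flip `m_i(P𝟙)`, which is `−1` exactly in the case “the LHV model assigns `−1` to
`A^{(i)}`” of a transposition `A^{(i)} ↔ 𝟙^{(i)}`); elsewhere `m' = m`. [cite: GuhneTothHyllusBriegel2005, Lemma 2 (proof)] -/
def permuteTable (P : Equiv.Perm Pauli) (i : Fin N) (m : Fin N → Pauli → ℤ) : Fin N → Pauli → ℤ :=
  fun j Q => if j = i then m i (P Q) * m i (P Pauli.I) else m j Q

omit G [DecidableRel G.Adj] in
/-- `LHV_2` is `±1`-valued. [cite: GuhneTothHyllusBriegel2005, Lemma 2 (proof)] -/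
theorem permuteTable_pm (P : Equiv.Perm Pauli) (i : Fin N) (m : Fin N → Pauli → ℤ)
    (hm : ∀ j Q, m j Q = 1 ∨ m j Q = -1) (j : Fin N) (Q : Pauli) :
    permuteTable P i m j Q = 1 ∨ permuteTable P i m j Q = -1 := by
  unfold permuteTable
  split_ifs
  · rcases hm i (P Q) with h | h <;> rcases hm i (P Pauli.I) with h' | h' <;> simp [h, h']
  · exact hm j Q

omit G [DecidableRel G.Adj] in
/-- `LHV_2` assigns `1` to `𝟙` (this is what the factor `m_i(P𝟙)` is for). [cite: GuhneTothHyllusBriegel2005,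
Lemma 2 (proof)] -/
theorem permuteTable_I (P : Equiv.Perm Pauli) (i : Fin N) (m : Fin N → Pauli → ℤ)
    (hm : ∀ j Q, m j Q = 1 ∨ m j Q = -1) (hmI : ∀ j, m j Pauli.I = 1) (j : Fin N) :
    permuteTable P i m j Pauli.I = 1 := by
  unfold permuteTable
  split_ifs
  · exact mul_self_of_pm (hm i (P Pauli.I))
  · exact hmI j

omit G [DecidableRel G.Adj] in
/-- Term by term: `lhv_{LHV_2}(w) = m_i(P𝟙)·lhv_{LHV_1}(w')` with `w'` the permuted word.
[cite: GuhneTothHyllusBriegel2005, Lemma 2 (proof: “`⟨𝓑'⟩_{LHV_1} = −⟨𝓑⟩_{LHV_2}`” in the flipped case, equality in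
the renaming case)] -/
theorem lhvValue_permuteTable (P : Equiv.Perm Pauli) (i : Fin N) (m : Fin N → Pauli → ℤ) (w : Fin N → Pauli) :
    lhvValue (permuteTable P i m) w =
      m i (P Pauli.I) * lhvValue m (fun j => if j = i then P (w j) else w j) := by
  unfold lhvValue
  rw [← Finset.mul_prod_erase Finset.univ _ (Finset.mem_univ i),
    ← Finset.mul_prod_erase Finset.univ (fun j => m j (if j = i then P (w j) else w j)) (Finset.mem_univ i)]
  have hrest : ∏ j ∈ Finset.univ.erase i, permuteTable P i m j (w j) =
      ∏ j ∈ Finset.univ.erase i, m j (if j = i then P (w j) else w j) := by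
    refine Finset.prod_congr rfl fun j hj => ?_
    have hji : j ≠ i := Finset.ne_of_mem_erase hj
    simp [permuteTable, hji]
  rw [hrest]
  simp only [permuteTable, if_true]
  ring

omit G [DecidableRel G.Adj] in
/-- **`⟨𝓑⟩_{LHV_2} = m_i(P𝟙)·⟨𝓑'⟩_{LHV_1}`.** [cite: GuhneTothHyllusBriegel2005, Lemma 2 (proof)] -/
theorem lhvSum_permuteTable (c : ι → ℤ) (w : ι → Fin N → Pauli) (P : Equiv.Perm Pauli) (i : Fin N)
    (m : Fin N → Pauli → ℤ) :
    lhvSum c w (permuteTable P i m) = m i (P Pauli.I) * lhvSum c (permuteSite P i w) m := by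
  unfold lhvSum
  rw [Finset.mul_sum]
  refine Finset.sum_congr rfl fun k _ => ?_
  rw [lhvValue_permuteTable]
  unfold permuteSite
  ring

omit G [DecidableRel G.Adj] in
/-- **`|⟨𝓑'⟩_{LHV_1}| = |⟨𝓑⟩_{LHV_2}|`** (“This proves the claim, since `𝒞` is defined via the absolute value”).
[cite: GuhneTothHyllusBriegel2005, Lemma 2 (proof)] -/
theorem abs_lhvSum_permuteSite (c : ι → ℤ) (w : ι → Fin N → Pauli) (P : Equiv.Perm Pauli) (i : Fin N)
    (m : Fin N → Pauli → ℤ) (hm : ∀ j Q, m j Q = 1 ∨ m j Q = -1) :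
    |lhvSum c (permuteSite P i w) m| = |lhvSum c w (permuteTable P i m)| := by
  rw [lhvSum_permuteTable, abs_mul, abs_eq_one_of_mul_self (mul_self_of_pm (hm i (P Pauli.I))), one_mul]

omit G [DecidableRel G.Adj] in
/-- **Lemma 2 of Gühne–Tóth–Hyllus–Briegel: `𝒟(𝓑) = 𝒟(𝓑')`.** For every bound `C`: `|⟨𝓑⟩| ≤ C` for all `±1` tables
iff `|⟨𝓑'⟩| ≤ C` for all `±1` tables, where `𝓑'` is obtained from `𝓑` by the permutation `P` of `{𝟙, X, Y, Z}` at
qubit `i` (so the maxima `𝒞(𝓑) = 𝒞(𝓑')` coincide). [cite: GuhneTothHyllusBriegel2005, Lemma 2] -/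
theorem forall_abs_lhvSum_permuteSite_le_iff (c : ι → ℤ) (w : ι → Fin N → Pauli) (P : Equiv.Perm Pauli)
    (i : Fin N) (C : ℤ) :
    (∀ m : Fin N → Pauli → ℤ, (∀ j Q, m j Q = 1 ∨ m j Q = -1) → (∀ j, m j Pauli.I = 1) →
        |lhvSum c w m| ≤ C) ↔
      (∀ m : Fin N → Pauli → ℤ, (∀ j Q, m j Q = 1 ∨ m j Q = -1) → (∀ j, m j Pauli.I = 1) →
        |lhvSum c (permuteSite P i w) m| ≤ C) := by
  constructor
  · intro h m hm hmI
    rw [abs_lhvSum_permuteSite c w P i m hm]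
    exact h _ (permuteTable_pm P i m hm) (permuteTable_I P i m hm hmI)
  · intro h m hm hmI
    have key := abs_lhvSum_permuteSite c (permuteSite P i w) P.symm i m hm
    rw [permuteSite_symm] at key
    rw [key]
    exact h _ (permuteTable_pm P.symm i m hm) (permuteTable_I P.symm i m hm hmI)

end LemmaTwo

/-! ### The classes `𝔄_{1,2}`, `𝔄_{3,4}`, `𝔄_{5,6}` of terms by the letter at a vertex, and the flipped tables -/

section Classes

variable (v : Fin N)

omit G [DecidableRel G.Adj] in
/-- The class label of a term at a vertex from its two bits (`x` = generator present, `z` = neighbourhood parity):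
`none` = letter `𝟙`∕`Z` (“`g_{i_0}` is absent”), `some false` = letter `X`, `some true` = letter `Y`.
[cite: GuhneTothHyllusBriegel2005, Appendix (“`𝔄_1, 𝔄_2` contain the `a_i` where `g_{i_0}` is absent, `𝔄_3, 𝔄_4` have an
`X^{(i_0)}` at the vertex `i_0` and `𝔄_5, 𝔄_6` have a `Y^{(i_0)}`”)] -/
def clsOf (x z : Bool) : Option Bool := if x = true then some z else none

omit G [DecidableRel G.Adj] in
/-- The letter of a stabilizer word from its two bits: `Y ∕ X` on the support, `Z ∕ 𝟙` off it.
[cite: HeinEisertBriegel2004, §2 (`Π_{a∈ξ}K_a = ±σ_x^ξσ_z^{Γξ}`)] -/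
def letter (x z : Bool) : Pauli :=
  if x = true then (if z = true then Pauli.Y else Pauli.X) else (if z = true then Pauli.Z else Pauli.I)

/-- `σ^{(j)}_ξ = letter(ξ_j, (Γξ)_j)`. [cite: HeinEisertBriegel2004, §2] -/
theorem stabWord_eq_letter (ξ : Fin N → Bool) (j : Fin N) : stabWord G ξ j = letter (ξ j) (stabZ G ξ j) := rfl

/-- **The class of the term `s_ξ` at vertex `v`**: `none` if `g_v` is absent from `s_ξ` (`ξ_v = 0`, letter `𝟙` or
`Z` at `v`), `some false` if the letter at `v` is `X`, `some true` if it is `Y`. [cite: GuhneTothHyllusBriegel2005,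
Appendix (the six sets `𝔄_1,…,𝔄_6`, paired by the LHV sign)] -/
def cls (ξ : Fin N → Bool) : Option Bool := clsOf (ξ v) (stabZ G ξ v)

/-- **The signed class sums `γ = p − q`, `δ = r − s`, `ε = t − u`**: the LHV value of the terms of `𝓑(G)` in one
class (`classSum … none = γ`, `some false = δ`, `some true = ε`). [cite: GuhneTothHyllusBriegel2005, Appendix
(“`γ_a := p_a − q_a`, `δ_a := r_a − s_a` and `ε_a = t_a − u_a`”)] -/
def classSum (m : Fin N → Pauli → ℤ) (κ : Option Bool) : ℤ :=
  ∑ ξ ∈ Finset.univ.filter (fun ξ => cls G v ξ = κ), stabSign G ξ * lhvValue m (stabWord G ξ)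

/-- **`⟨𝓑(G)⟩_{LHV} = γ + δ + ε`** (the classes partition the `2^N` terms). [cite: GuhneTothHyllusBriegel2005, Appendix
(“`|⟨𝓑(G_1)⟩| = |γ_a + δ_a + ε_a|`”)] -/
theorem lhvBell_eq_sum_classSum (m : Fin N → Pauli → ℤ) : lhvBell G m = ∑ κ, classSum G v m κ := by
  unfold lhvBell classSum
  exact (Finset.sum_fiberwise Finset.univ (cls G v) _).symm

omit G [DecidableRel G.Adj] in
/-- **Flipping the signs assigned to `X^{(v)}` and∕or `Y^{(v)}`**: the table `m` with `m_v(X) ↦ s·m_v(X)`,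
`m_v(Y) ↦ t·m_v(Y)` (`s, t ∈ {±1}`). [cite: GuhneTothHyllusBriegel2005, Appendix (“By flipping the sign which is
assigned to `X^{(i_0)}` by the given LHV model we can construct a new LHV model … We can also flip the signs of
`Y^{(i_0)}, X^{(j_0)}` or `Y^{(j_0)}`”)] -/
def scaleXY (m : Fin N → Pauli → ℤ) (s t : ℤ) : Fin N → Pauli → ℤ := fun j P =>
  if j = v then (if P = Pauli.X then s * m j P else if P = Pauli.Y then t * m j P else m j P) else m j P

omit G [DecidableRel G.Adj] in
/-- The flipped table is `±1`-valued. [cite: GuhneTothHyllusBriegel2005, Appendix] -/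
theorem scaleXY_pm (m : Fin N → Pauli → ℤ) (hm : ∀ j P, m j P = 1 ∨ m j P = -1) {s t : ℤ}
    (hs : s = 1 ∨ s = -1) (ht : t = 1 ∨ t = -1) (j : Fin N) (P : Pauli) :
    scaleXY v m s t j P = 1 ∨ scaleXY v m s t j P = -1 := by
  unfold scaleXY
  rcases hm j P with h | h <;> rcases hs with rfl | rfl <;> rcases ht with rfl | rfl <;>
    simp only [h] <;> split_ifs <;> norm_num

omit G [DecidableRel G.Adj] in
/-- The flipped table still assigns `1` to `𝟙`. [cite: GuhneTothHyllusBriegel2005, Appendix] -/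
theorem scaleXY_I (m : Fin N → Pauli → ℤ) (hmI : ∀ j, m j Pauli.I = 1) (s t : ℤ) (j : Fin N) :
    scaleXY v m s t j Pauli.I = 1 := by
  unfold scaleXY
  by_cases h : j = v <;> simp [h, hmI]

omit G [DecidableRel G.Adj] in
/-- The factor a word picks up under the flip: `s` if its letter at `v` is `X`, `t` if `Y`, else `1`.
[cite: GuhneTothHyllusBriegel2005, Appendix] -/
theorem lhvValue_scaleXY (m : Fin N → Pauli → ℤ) (s t : ℤ) (w : Fin N → Pauli) :
    lhvValue (scaleXY v m s t) w =
      (if w v = Pauli.X then s else if w v = Pauli.Y then t else 1) * lhvValue m w := by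
  unfold lhvValue
  rw [← Finset.mul_prod_erase Finset.univ _ (Finset.mem_univ v),
    ← Finset.mul_prod_erase Finset.univ (fun j => m j (w j)) (Finset.mem_univ v)]
  have hrest : ∏ j ∈ Finset.univ.erase v, scaleXY v m s t j (w j) = ∏ j ∈ Finset.univ.erase v, m j (w j) := by
    refine Finset.prod_congr rfl fun j hj => ?_
    have hjv : j ≠ v := Finset.ne_of_mem_erase hj
    simp [scaleXY, hjv]
  rw [hrest]
  simp only [scaleXY, if_true]
  split_ifs <;> ring

omit G [DecidableRel G.Adj] in
/-- The factor by class: `1` on `𝔄_{1,2}`, `s` on `𝔄_{3,4}`, `t` on `𝔄_{5,6}`. [cite: GuhneTothHyllusBriegel2005,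
Appendix] -/
def clsFactor (s t : ℤ) : Option Bool → ℤ
  | none => 1
  | some false => s
  | some true => t

/-- The letter at `v` determines the factor through the class. [cite: GuhneTothHyllusBriegel2005, Appendix] -/
theorem factor_eq_clsFactor (s t : ℤ) (ξ : Fin N → Bool) :
    (if stabWord G ξ v = Pauli.X then s else if stabWord G ξ v = Pauli.Y then t else 1) =
      clsFactor s t (cls G v ξ) := by
  rw [stabWord_eq_letter, cls, clsOf, letter]
  cases ξ v <;> cases stabZ G ξ v <;> simp [clsFactor]

/-- **Class sums of the flipped table**: `γ ↦ γ`, `δ ↦ s·δ`, `ε ↦ t·ε`. [cite: GuhneTothHyllusBriegel2005, Appendix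
(“a new LHV model with `|⟨𝓑(G_1)⟩| = |γ_a − δ_a + ε_a|` … new bounds of the type `|γ ± δ ± ε| ≤ 𝒞`”)] -/
theorem classSum_scaleXY (m : Fin N → Pauli → ℤ) (s t : ℤ) (κ : Option Bool) :
    classSum G v (scaleXY v m s t) κ = clsFactor s t κ * classSum G v m κ := by
  unfold classSum
  rw [Finset.mul_sum]
  refine Finset.sum_congr rfl fun ξ hξ => ?_
  rw [lhvValue_scaleXY, factor_eq_clsFactor, (Finset.mem_filter.mp hξ).2]
  ring

/-- **`⟨𝓑(G)⟩` of the flipped table is `γ + s·δ + t·ε`.** [cite: GuhneTothHyllusBriegel2005, Appendix (“for all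
sixteen combinations of signs … `|γ ± δ ± ε| ≤ 𝒞`”)] -/
theorem lhvBell_scaleXY (m : Fin N → Pauli → ℤ) (s t : ℤ) :
    lhvBell G (scaleXY v m s t) =
      classSum G v m none + s * classSum G v m (some false) + t * classSum G v m (some true) := by
  rw [lhvBell_eq_sum_classSum G v, Fintype.sum_option, Fintype.sum_bool]
  simp only [classSum_scaleXY, clsFactor]
  ring

omit G [DecidableRel G.Adj] in
/-- A choice of two signs realising `|x| + |y| + |z| = |x ± y ± z|`. [folklore] -/
private theorem exists_signs_abs_add (x y z : ℤ) :
    ∃ s t : ℤ, (s = 1 ∨ s = -1) ∧ (t = 1 ∨ t = -1) ∧ |x| + |y| + |z| ≤ |x + s * y + t * z| := by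
  rcases le_or_gt 0 x with hx | hx <;> rcases le_or_gt 0 y with hy | hy <;> rcases le_or_gt 0 z with hz | hz
  · exact ⟨1, 1, Or.inl rfl, Or.inl rfl, by
      rw [abs_of_nonneg hx, abs_of_nonneg hy, abs_of_nonneg hz, abs_of_nonneg (by omega)]; omega⟩
  · exact ⟨1, -1, Or.inl rfl, Or.inr rfl, by
      rw [abs_of_nonneg hx, abs_of_nonneg hy, abs_of_neg hz, abs_of_nonneg (by omega)]; omega⟩
  · exact ⟨-1, 1, Or.inr rfl, Or.inl rfl, by
      rw [abs_of_nonneg hx, abs_of_neg hy, abs_of_nonneg hz, abs_of_nonneg (by omega)]; omega⟩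
  · exact ⟨-1, -1, Or.inr rfl, Or.inr rfl, by
      rw [abs_of_nonneg hx, abs_of_neg hy, abs_of_neg hz, abs_of_nonneg (by omega)]; omega⟩
  · exact ⟨-1, -1, Or.inr rfl, Or.inr rfl, by
      rw [abs_of_neg hx, abs_of_nonneg hy, abs_of_nonneg hz, abs_of_nonpos (by omega)]; omega⟩
  · exact ⟨-1, 1, Or.inr rfl, Or.inl rfl, by
      rw [abs_of_neg hx, abs_of_nonneg hy, abs_of_neg hz, abs_of_nonpos (by omega)]; omega⟩
  · exact ⟨1, -1, Or.inl rfl, Or.inr rfl, by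
      rw [abs_of_neg hx, abs_of_neg hy, abs_of_nonneg hz, abs_of_nonpos (by omega)]; omega⟩
  · exact ⟨1, 1, Or.inl rfl, Or.inl rfl, by
      rw [abs_of_neg hx, abs_of_neg hy, abs_of_neg hz, abs_of_nonpos (by omega)]; omega⟩

/-- **`|γ| + |δ| + |ε| ≤ 𝒞(G)`**: if `|⟨𝓑(G)⟩_{LHV}| ≤ C` for every `±1` table then the class sums of every `±1`
table have `|γ| + |δ| + |ε| ≤ C` — the flipped tables give `|γ ± δ ± ε| ≤ C` for all four sign choices, and one
of them equals `|γ| + |δ| + |ε|`. [cite: GuhneTothHyllusBriegel2005, Appendix (eq. (toll3): “for all sixteen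
combinations of signs `|(γ_a ± δ_a ± ε_a)(γ_b ± δ_b ± ε_b)| ≤ 𝒞(G_1)𝒞(G_2)` holds”)] -/
theorem sum_abs_classSum_le (C : ℤ)
    (hC : ∀ m' : Fin N → Pauli → ℤ, (∀ j P, m' j P = 1 ∨ m' j P = -1) → (∀ j, m' j Pauli.I = 1) →
      |lhvBell G m'| ≤ C)
    (m : Fin N → Pauli → ℤ) (hm : ∀ j P, m j P = 1 ∨ m j P = -1) (hmI : ∀ j, m j Pauli.I = 1) :
    ∑ κ, |classSum G v m κ| ≤ C := by
  rw [Fintype.sum_option, Fintype.sum_bool]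
  obtain ⟨s, t, hs, ht, hle⟩ :=
    exists_signs_abs_add (classSum G v m none) (classSum G v m (some false)) (classSum G v m (some true))
  have hb := hC (scaleXY v m s t) (scaleXY_pm v m hm hs ht) (scaleXY_I v m hmI s t)
  rw [lhvBell_scaleXY] at hb
  linarith

omit G [DecidableRel G.Adj] in
/-- **Bilinear decomposition by classes**: `Σ_a Σ_b J(c(a), c'(b))·f(a)g(b) = Σ_{κλ} J_{κλ}·(Σ_{c(a)=κ} f)(Σ_{c'(b)=λ} g)`
— grouping the `s_{ij}` “into 36 groups according to `𝔄_i𝔅_j`”, where each block “bears the sign of the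
corresponding `⟨s_{ij}⟩`”. [cite: GuhneTothHyllusBriegel2005, Appendix] -/
theorem sum_sum_eq_sum_fiber {α β K L : Type*} [Fintype α] [Fintype β] [Fintype K] [Fintype L] [DecidableEq K]
    [DecidableEq L] (cA : α → K) (cB : β → L) (J : K → L → ℤ) (f : α → ℤ) (g : β → ℤ) :
    ∑ a, ∑ b, J (cA a) (cB b) * (f a * g b) =
      ∑ k, ∑ l, J k l * ((∑ a ∈ Finset.univ.filter (fun a => cA a = k), f a) *
        (∑ b ∈ Finset.univ.filter (fun b => cB b = l), g b)) := by
  have inner : ∀ (a : α) (k : K), ∑ l, ∑ b ∈ Finset.univ.filter (fun b => cB b = l), J k l * (f a * g b) =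
      ∑ b, J k (cB b) * (f a * g b) := by
    intro a k
    rw [← Finset.sum_fiberwise Finset.univ cB (fun b => J k (cB b) * (f a * g b))]
    refine Finset.sum_congr rfl fun l _ => Finset.sum_congr rfl fun b hb => ?_
    rw [(Finset.mem_filter.mp hb).2]
  symm
  calc ∑ k, ∑ l, J k l * ((∑ a ∈ Finset.univ.filter (fun a => cA a = k), f a) *
          (∑ b ∈ Finset.univ.filter (fun b => cB b = l), g b))
      = ∑ k, ∑ l, ∑ a ∈ Finset.univ.filter (fun a => cA a = k),
          ∑ b ∈ Finset.univ.filter (fun b => cB b = l), J k l * (f a * g b) := by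
        refine Finset.sum_congr rfl fun k _ => Finset.sum_congr rfl fun l _ => ?_
        rw [Finset.sum_mul_sum, Finset.mul_sum]
        refine Finset.sum_congr rfl fun a _ => ?_
        rw [Finset.mul_sum]
    _ = ∑ k, ∑ a ∈ Finset.univ.filter (fun a => cA a = k), ∑ l,
          ∑ b ∈ Finset.univ.filter (fun b => cB b = l), J k l * (f a * g b) := by
        refine Finset.sum_congr rfl fun k _ => ?_
        rw [Finset.sum_comm]
    _ = ∑ k, ∑ a ∈ Finset.univ.filter (fun a => cA a = k), ∑ b, J k (cB b) * (f a * g b) := by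
        refine Finset.sum_congr rfl fun k _ => Finset.sum_congr rfl fun a _ => inner a k
    _ = ∑ k, ∑ a ∈ Finset.univ.filter (fun a => cA a = k), ∑ b, J (cA a) (cB b) * (f a * g b) := by
        refine Finset.sum_congr rfl fun k _ => Finset.sum_congr rfl fun a ha => ?_
        rw [(Finset.mem_filter.mp ha).2]
    _ = ∑ a, ∑ b, J (cA a) (cB b) * (f a * g b) :=
        Finset.sum_fiberwise Finset.univ cA (fun a => ∑ b, J (cA a) (cB b) * (f a * g b))

end Classes

end BellComposition
/-! ### Lemma 3: `𝒟(G₁ — G₂) ≤ 𝒟(G₁)·𝒟(G₂)` for a single connecting edge -/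

section LemmaThree

variable {N₁ N₂ : ℕ}

/-- The `G₁`-part `ξ₁` of a pattern `ξ` on `G = G₁ — G₂` (first block of `Fin (N₁ + N₂)`).
[cite: GuhneTothHyllusBriegel2005, Appendix (“`s_{ij}(G) = a_i b_j` where `a_i` contains only `g_k` with `k ∈ G_1`”)] -/
def leftPat (ξ : Fin (N₁ + N₂) → Bool) : Fin N₁ → Bool := fun a => ξ (Fin.castAdd N₂ a)

/-- The `G₂`-part `ξ₂` of a pattern (second block). [cite: GuhneTothHyllusBriegel2005, Appendix (“`b_j` contains only
`g_k` belonging to `G_2`”)] -/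
def rightPat (ξ : Fin (N₁ + N₂) → Bool) : Fin N₂ → Bool := fun b => ξ (Fin.natAdd N₁ b)

/-- The restriction of an LHV table to the qubits of `G₁`. [cite: GuhneTothHyllusBriegel2005, Appendix (“a given LHV
model” evaluated on the `a_i`)] -/
def leftTable (m : Fin (N₁ + N₂) → Pauli → ℤ) : Fin N₁ → Pauli → ℤ := fun a => m (Fin.castAdd N₂ a)

/-- The restriction of an LHV table to the qubits of `G₂`. [cite: GuhneTothHyllusBriegel2005, Appendix] -/
def rightTable (m : Fin (N₁ + N₂) → Pauli → ℤ) : Fin N₂ → Pauli → ℤ := fun b => m (Fin.natAdd N₁ b)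

/-- Unfolding `leftPat`. [cite: GuhneTothHyllusBriegel2005, Appendix] -/
@[simp] theorem leftPat_apply (ξ : Fin (N₁ + N₂) → Bool) (a : Fin N₁) : leftPat ξ a = ξ (Fin.castAdd N₂ a) := rfl

/-- Unfolding `rightPat`. [cite: GuhneTothHyllusBriegel2005, Appendix] -/
@[simp] theorem rightPat_apply (ξ : Fin (N₁ + N₂) → Bool) (b : Fin N₂) : rightPat ξ b = ξ (Fin.natAdd N₁ b) := rfl

/-- `(ξ₁ ++ ξ₂)₁ = ξ₁`. [cite: GuhneTothHyllusBriegel2005, Appendix] -/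
theorem leftPat_append (ξ₁ : Fin N₁ → Bool) (ξ₂ : Fin N₂ → Bool) : leftPat (Fin.append ξ₁ ξ₂) = ξ₁ := by
  funext a; exact Fin.append_left ξ₁ ξ₂ a

/-- `(ξ₁ ++ ξ₂)₂ = ξ₂`. [cite: GuhneTothHyllusBriegel2005, Appendix] -/
theorem rightPat_append (ξ₁ : Fin N₁ → Bool) (ξ₂ : Fin N₂ → Bool) : rightPat (Fin.append ξ₁ ξ₂) = ξ₂ := by
  funext b; exact Fin.append_right ξ₁ ξ₂ b

/-- Every pattern is `ξ₁ ++ ξ₂`. [cite: GuhneTothHyllusBriegel2005, Appendix (“We can write any stabilizing operator of `G`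
as `s_{ij}(G) = a_i b_j`”)] -/
theorem append_leftPat_rightPat (ξ : Fin (N₁ + N₂) → Bool) : Fin.append (leftPat ξ) (rightPat ξ) = ξ := by
  funext k
  refine Fin.addCases (fun a => ?_) (fun b => ?_) k
  · rw [Fin.append_left]; rfl
  · rw [Fin.append_right]; rfl

/-- Patterns on `G₁ — G₂` ↔ pairs `(ξ₁, ξ₂)` (the double index `ij` of `s_{ij}`). [cite: GuhneTothHyllusBriegel2005,
Appendix] -/
def patEquiv : (Fin (N₁ + N₂) → Bool) ≃ (Fin N₁ → Bool) × (Fin N₂ → Bool) where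
  toFun ξ := (leftPat ξ, rightPat ξ)
  invFun p := Fin.append p.1 p.2
  left_inv ξ := append_leftPat_rightPat ξ
  right_inv p := Prod.ext (leftPat_append p.1 p.2) (rightPat_append p.1 p.2)

/-- **`G = G₁ — G₂`**: the graph on `Fin (N₁ + N₂)` “which comprises `G_1` and `G_2` and one single connection between
one vertex of `G_1` and one of `G_2`” — `G₁` on the first block (`Fin.castAdd`), `G₂` on the second block
(`Fin.natAdd`), and exactly the edge `{i₀, j₀}` across. An interface (three adjacency conditions), so that concrete
graphs with their own decidability (e.g. `linearCluster (n + 4)`) can be used; `singleEdgeJoin` below constructs one.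
[cite: GuhneTothHyllusBriegel2005, Lemma 3 and Appendix (“assume that the connection is between the vertices
`i_0 ∈ G_1` and `j_0 ∈ G_2`”)] -/
structure IsSingleEdgeJoin (G : SimpleGraph (Fin (N₁ + N₂))) (G₁ : SimpleGraph (Fin N₁))
    (G₂ : SimpleGraph (Fin N₂)) (i₀ : Fin N₁) (j₀ : Fin N₂) : Prop where
  /-- Inside the first block, `G` is `G₁`. [cite: GuhneTothHyllusBriegel2005, Lemma 3] -/
  adj_inl : ∀ a b : Fin N₁, G.Adj (Fin.castAdd N₂ a) (Fin.castAdd N₂ b) ↔ G₁.Adj a b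
  /-- Inside the second block, `G` is `G₂`. [cite: GuhneTothHyllusBriegel2005, Lemma 3] -/
  adj_inr : ∀ a b : Fin N₂, G.Adj (Fin.natAdd N₁ a) (Fin.natAdd N₁ b) ↔ G₂.Adj a b
  /-- Across the blocks, the only edge is `{i₀, j₀}`. [cite: GuhneTothHyllusBriegel2005, Lemma 3] -/
  adj_inl_inr : ∀ (a : Fin N₁) (b : Fin N₂), G.Adj (Fin.castAdd N₂ a) (Fin.natAdd N₁ b) ↔ a = i₀ ∧ b = j₀

/-- Across the blocks, read from the second block. [cite: GuhneTothHyllusBriegel2005, Lemma 3] -/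
theorem IsSingleEdgeJoin.adj_inr_inl {G : SimpleGraph (Fin (N₁ + N₂))} {G₁ : SimpleGraph (Fin N₁)}
    {G₂ : SimpleGraph (Fin N₂)} {i₀ : Fin N₁} {j₀ : Fin N₂} (hJ : IsSingleEdgeJoin G G₁ G₂ i₀ j₀)
    (a : Fin N₁) (b : Fin N₂) : G.Adj (Fin.natAdd N₁ b) (Fin.castAdd N₂ a) ↔ a = i₀ ∧ b = j₀ := by
  rw [G.adj_comm]; exact hJ.adj_inl_inr a b

/-- First-block vertices precede second-block vertices. [folklore] -/
private theorem castAdd_lt_natAdd (a : Fin N₁) (b : Fin N₂) : Fin.castAdd N₂ a < Fin.natAdd N₁ b := by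
  rw [Fin.lt_def, Fin.val_castAdd, Fin.val_natAdd]; have := a.isLt; omega

/-- … so they are distinct. [folklore] -/
private theorem castAdd_ne_natAdd (a : Fin N₁) (b : Fin N₂) : Fin.castAdd N₂ a ≠ Fin.natAdd N₁ b :=
  ne_of_lt (castAdd_lt_natAdd a b)

section JoinGraph

variable (G₁ : SimpleGraph (Fin N₁)) (G₂ : SimpleGraph (Fin N₂)) [DecidableRel G₁.Adj] [DecidableRel G₂.Adj]
  (i₀ : Fin N₁) (j₀ : Fin N₂)

/-- The (oriented) adjacency test of `G₁ — G₂` as a Boolean: `G₁` inside block one, `G₂` inside block two, and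
`(i₀, j₀)` across. [cite: GuhneTothHyllusBriegel2005, Lemma 3 (“`G = G_1 — G_2`”)] -/
def joinAdjB (u v : Fin (N₁ + N₂)) : Bool :=
  Sum.elim
    (fun a => Sum.elim (fun b => decide (G₁.Adj a b)) (fun b => decide (a = i₀ ∧ b = j₀))
      (finSumFinEquiv.symm v))
    (fun a => Sum.elim (fun _ => false) (fun b => decide (G₂.Adj a b)) (finSumFinEquiv.symm v))
    (finSumFinEquiv.symm u)

/-- **The explicit graph `G₁ — G₂` on `Fin (N₁ + N₂)`** (a `SimpleGraph.fromRel`, decidable adjacency inherited, no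
instance declared). [cite: GuhneTothHyllusBriegel2005, Lemma 3] -/
abbrev singleEdgeJoin : SimpleGraph (Fin (N₁ + N₂)) :=
  SimpleGraph.fromRel fun u v => joinAdjB G₁ G₂ i₀ j₀ u v = true

/-- The test inside block one. [cite: GuhneTothHyllusBriegel2005, Lemma 3] -/
theorem joinAdjB_inl_inl (a b : Fin N₁) :
    joinAdjB G₁ G₂ i₀ j₀ (Fin.castAdd N₂ a) (Fin.castAdd N₂ b) = decide (G₁.Adj a b) := by
  simp [joinAdjB]

/-- The test inside block two. [cite: GuhneTothHyllusBriegel2005, Lemma 3] -/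
theorem joinAdjB_inr_inr (a b : Fin N₂) :
    joinAdjB G₁ G₂ i₀ j₀ (Fin.natAdd N₁ a) (Fin.natAdd N₁ b) = decide (G₂.Adj a b) := by
  simp [joinAdjB]

/-- The test across, from block one. [cite: GuhneTothHyllusBriegel2005, Lemma 3] -/
theorem joinAdjB_inl_inr (a : Fin N₁) (b : Fin N₂) :
    joinAdjB G₁ G₂ i₀ j₀ (Fin.castAdd N₂ a) (Fin.natAdd N₁ b) = decide (a = i₀ ∧ b = j₀) := by
  simp [joinAdjB]

/-- The test across, from block two (the relation is symmetrised by `fromRel`). [cite: GuhneTothHyllusBriegel2005,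
Lemma 3] -/
theorem joinAdjB_inr_inl (a : Fin N₁) (b : Fin N₂) :
    joinAdjB G₁ G₂ i₀ j₀ (Fin.natAdd N₁ b) (Fin.castAdd N₂ a) = false := by
  simp [joinAdjB]

/-- **`singleEdgeJoin G₁ G₂ i₀ j₀` is a single-edge join `G₁ — G₂`.** [cite: GuhneTothHyllusBriegel2005, Lemma 3] -/
theorem isSingleEdgeJoin_singleEdgeJoin : IsSingleEdgeJoin (singleEdgeJoin G₁ G₂ i₀ j₀) G₁ G₂ i₀ j₀ where
  adj_inl a b := by
    rw [SimpleGraph.fromRel_adj, joinAdjB_inl_inl, joinAdjB_inl_inl, decide_eq_true_iff, decide_eq_true_iff]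
    constructor
    · rintro ⟨-, h | h⟩
      · exact h
      · exact h.symm
    · intro h
      exact ⟨fun heq => G₁.ne_of_adj h (Fin.castAdd_inj.mp heq), Or.inl h⟩
  adj_inr a b := by
    rw [SimpleGraph.fromRel_adj, joinAdjB_inr_inr, joinAdjB_inr_inr, decide_eq_true_iff, decide_eq_true_iff]
    constructor
    · rintro ⟨-, h | h⟩
      · exact h
      · exact h.symm
    · intro h
      exact ⟨fun heq => G₂.ne_of_adj h ((Fin.natAdd_inj N₁).mp heq), Or.inl h⟩
  adj_inl_inr a b := by
    rw [SimpleGraph.fromRel_adj, joinAdjB_inl_inr, joinAdjB_inr_inl, decide_eq_true_iff]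
    constructor
    · rintro ⟨-, h | h⟩
      · exact h
      · exact absurd h Bool.false_ne_true
    · intro h
      exact ⟨castAdd_ne_natAdd a b, Or.inl h⟩

end JoinGraph

section Stabilizer

variable {G₁ : SimpleGraph (Fin N₁)} {G₂ : SimpleGraph (Fin N₂)} [DecidableRel G₁.Adj] [DecidableRel G₂.Adj]
  {i₀ : Fin N₁} {j₀ : Fin N₂} {G : SimpleGraph (Fin (N₁ + N₂))} [DecidableRel G.Adj]

/-- The neighbour finset as a filter. [folklore] -/
private theorem neighborFinset_eq_filter_univ {M : ℕ} (H : SimpleGraph (Fin M)) [DecidableRel H.Adj] (i : Fin M) :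
    H.neighborFinset i = Finset.univ.filter (fun j => H.Adj i j) := by
  ext j; simp [SimpleGraph.mem_neighborFinset]

omit [DecidableRel G₂.Adj] in
/-- **Neighbourhood parities in `G₁ — G₂`, first block**: `(Γ_Gξ)_a = (Γ_{G₁}ξ₁)_a + [a = i₀]·ξ_{j₀}` — only the
vertex `i₀` sees the extra connection. [cite: GuhneTothHyllusBriegel2005, Appendix (“What changes for the `s_{ij}` due
to the extra connection?”)] -/
theorem nbrParity_join_inl (hJ : IsSingleEdgeJoin G G₁ G₂ i₀ j₀) (ξ : Fin (N₁ + N₂) → Bool) (a : Fin N₁) :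
    nbrParity G ξ (Fin.castAdd N₂ a) =
      nbrParity G₁ (leftPat ξ) a + if a = i₀ then bitZ (rightPat ξ j₀) else 0 := by
  rw [nbrParity, nbrParity, neighborFinset_eq_filter_univ G, neighborFinset_eq_filter_univ G₁,
    Finset.sum_filter, Finset.sum_filter, Fin.sum_univ_add]
  congr 1
  · refine Finset.sum_congr rfl fun a' _ => ?_
    simp only [hJ.adj_inl, leftPat_apply]
  · by_cases ha : a = i₀
    · rw [if_pos ha]
      simp only [hJ.adj_inl_inr, ha, true_and]
      rw [Finset.sum_ite_eq' Finset.univ j₀, if_pos (Finset.mem_univ _), rightPat_apply]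
    · rw [if_neg ha]
      simp only [hJ.adj_inl_inr, ha, false_and, if_false, Finset.sum_const_zero]

omit [DecidableRel G₁.Adj] in
/-- **Neighbourhood parities in `G₁ — G₂`, second block**: `(Γ_Gξ)_b = (Γ_{G₂}ξ₂)_b + [b = j₀]·ξ_{i₀}`.
[cite: GuhneTothHyllusBriegel2005, Appendix] -/
theorem nbrParity_join_inr (hJ : IsSingleEdgeJoin G G₁ G₂ i₀ j₀) (ξ : Fin (N₁ + N₂) → Bool) (b : Fin N₂) :
    nbrParity G ξ (Fin.natAdd N₁ b) =
      nbrParity G₂ (rightPat ξ) b + if b = j₀ then bitZ (leftPat ξ i₀) else 0 := by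
  rw [nbrParity, nbrParity, neighborFinset_eq_filter_univ G, neighborFinset_eq_filter_univ G₂,
    Finset.sum_filter, Finset.sum_filter, Fin.sum_univ_add, add_comm]
  congr 1
  · refine Finset.sum_congr rfl fun b' _ => ?_
    simp only [hJ.adj_inr, rightPat_apply]
  · by_cases hb : b = j₀
    · rw [if_pos hb]
      simp only [hJ.adj_inr_inl, hb, and_true]
      rw [Finset.sum_ite_eq' Finset.univ i₀, if_pos (Finset.mem_univ _), leftPat_apply]
    · rw [if_neg hb]
      simp only [hJ.adj_inr_inl, hb, and_false, if_false, Finset.sum_const_zero]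

/-- The summand of the edge parity `q_H(x) = Σ_{i<j, i∼j} x_ix_j`. [cite: HeinEisertBriegel2004, §2] -/
private def eF {M : ℕ} (H : SimpleGraph (Fin M)) [DecidableRel H.Adj] (x : Fin M → Bool) (i j : Fin M) : ZMod 2 :=
  (if i < j ∧ H.Adj i j then (1 : ZMod 2) else 0) * (bitZ (x i) * bitZ (x j))

/-- `q_H(x) = Σ_i Σ_j eF`. [cite: HeinEisertBriegel2004, §2] -/
private theorem edgeParity_eq_sum_eF {M : ℕ} (H : SimpleGraph (Fin M)) [DecidableRel H.Adj] (x : Fin M → Bool) :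
    edgeParity H x = ∑ i, ∑ j, eF H x i j := rfl

omit [DecidableRel G₂.Adj] in
/-- Block one × block one of the edge sum of `G₁ — G₂` is that of `G₁`. [cite: GuhneTothHyllusBriegel2005, Appendix] -/
private theorem eF_inl_inl (hJ : IsSingleEdgeJoin G G₁ G₂ i₀ j₀) (ξ : Fin (N₁ + N₂) → Bool) (a a' : Fin N₁) :
    eF G ξ (Fin.castAdd N₂ a) (Fin.castAdd N₂ a') = eF G₁ (leftPat ξ) a a' := by
  unfold eF
  have h1 : (Fin.castAdd N₂ a < Fin.castAdd N₂ a') ↔ a < a' := by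
    rw [Fin.lt_def, Fin.lt_def, Fin.val_castAdd, Fin.val_castAdd]
  simp only [h1, hJ.adj_inl, leftPat_apply]

omit [DecidableRel G₁.Adj] [DecidableRel G₂.Adj] in
/-- Block one × block two contributes `ξ_{i₀}ξ_{j₀}` only. [cite: GuhneTothHyllusBriegel2005, Appendix] -/
private theorem eF_inl_inr (hJ : IsSingleEdgeJoin G G₁ G₂ i₀ j₀) (ξ : Fin (N₁ + N₂) → Bool) (a : Fin N₁)
    (b : Fin N₂) :
    eF G ξ (Fin.castAdd N₂ a) (Fin.natAdd N₁ b) =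
      if a = i₀ ∧ b = j₀ then bitZ (leftPat ξ i₀) * bitZ (rightPat ξ j₀) else 0 := by
  unfold eF
  simp only [castAdd_lt_natAdd a b, true_and, hJ.adj_inl_inr]
  split_ifs with h
  · obtain ⟨rfl, rfl⟩ := h
    rw [one_mul, leftPat_apply, rightPat_apply]
  · rw [zero_mul]

/-- Block two × block one contributes nothing (`i < j` fails). [cite: GuhneTothHyllusBriegel2005, Appendix] -/
private theorem eF_inr_inl (ξ : Fin (N₁ + N₂) → Bool) (a : Fin N₁) (b : Fin N₂) :
    eF G ξ (Fin.natAdd N₁ b) (Fin.castAdd N₂ a) = 0 := by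
  unfold eF
  rw [if_neg (fun h => lt_asymm (castAdd_lt_natAdd a b) h.1), zero_mul]

omit [DecidableRel G₁.Adj] in
/-- Block two × block two is that of `G₂`. [cite: GuhneTothHyllusBriegel2005, Appendix] -/
private theorem eF_inr_inr (hJ : IsSingleEdgeJoin G G₁ G₂ i₀ j₀) (ξ : Fin (N₁ + N₂) → Bool) (b b' : Fin N₂) :
    eF G ξ (Fin.natAdd N₁ b) (Fin.natAdd N₁ b') = eF G₂ (rightPat ξ) b b' := by
  unfold eF
  have h1 : (Fin.natAdd N₁ b < Fin.natAdd N₁ b') ↔ b < b' := by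
    rw [Fin.lt_def, Fin.lt_def, Fin.val_natAdd, Fin.val_natAdd]; omega
  simp only [h1, hJ.adj_inr, rightPat_apply]

/-- **Edge parity of `G₁ — G₂`**: `q_G(ξ) = q_{G₁}(ξ₁) + q_{G₂}(ξ₂) + ξ_{i₀}ξ_{j₀}` — the sign `(−1)^{q}` of a term changes
exactly when both `g_{i₀}` and `g_{j₀}` are present. [cite: GuhneTothHyllusBriegel2005, Appendix (the transformation
`{XX, XY, YX, YY} ↦ {YY, −YX, −XY, XX}` at `(i_0, j_0)`)] -/
theorem edgeParity_join (hJ : IsSingleEdgeJoin G G₁ G₂ i₀ j₀) (ξ : Fin (N₁ + N₂) → Bool) :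
    edgeParity G ξ =
      edgeParity G₁ (leftPat ξ) + edgeParity G₂ (rightPat ξ) + bitZ (leftPat ξ i₀) * bitZ (rightPat ξ j₀) := by
  rw [edgeParity_eq_sum_eF G, edgeParity_eq_sum_eF G₁, edgeParity_eq_sum_eF G₂, Fin.sum_univ_add]
  simp only [Fin.sum_univ_add, eF_inl_inl hJ, eF_inl_inr hJ, eF_inr_inl, eF_inr_inr hJ, Finset.sum_add_distrib,
    Finset.sum_const_zero, zero_add]
  have hc : ∑ a : Fin N₁, ∑ b : Fin N₂,
      (if a = i₀ ∧ b = j₀ then bitZ (leftPat ξ i₀) * bitZ (rightPat ξ j₀) else 0) =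
        bitZ (leftPat ξ i₀) * bitZ (rightPat ξ j₀) := by
    rw [Finset.sum_eq_single i₀ (fun a _ ha => Finset.sum_eq_zero fun b _ => by rw [if_neg (fun h => ha h.1)])
      (fun h => absurd (Finset.mem_univ _) h)]
    rw [Finset.sum_eq_single j₀ (fun b _ hb => by rw [if_neg (fun h => hb h.2)])
      (fun h => absurd (Finset.mem_univ _) h)]
    rw [if_pos ⟨rfl, rfl⟩]
  rw [hc]
  ring

omit [DecidableRel G₂.Adj] in
/-- Away from `i₀`, the `Z`-pattern of a term of `G₁ — G₂` on block one is that of `a_i`.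
[cite: GuhneTothHyllusBriegel2005, Appendix (“`s_{ij}(G) = a_i b_j`”)] -/
theorem stabZ_join_inl_of_ne (hJ : IsSingleEdgeJoin G G₁ G₂ i₀ j₀) (ξ : Fin (N₁ + N₂) → Bool) {a : Fin N₁}
    (ha : a ≠ i₀) : stabZ G ξ (Fin.castAdd N₂ a) = stabZ G₁ (leftPat ξ) a := by
  unfold stabZ
  rw [nbrParity_join_inl hJ, if_neg ha, add_zero]

omit [DecidableRel G₁.Adj] in
/-- Away from `j₀`, the `Z`-pattern on block two is that of `b_j`. [cite: GuhneTothHyllusBriegel2005, Appendix] -/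
theorem stabZ_join_inr_of_ne (hJ : IsSingleEdgeJoin G G₁ G₂ i₀ j₀) (ξ : Fin (N₁ + N₂) → Bool) {b : Fin N₂}
    (hb : b ≠ j₀) : stabZ G ξ (Fin.natAdd N₁ b) = stabZ G₂ (rightPat ξ) b := by
  unfold stabZ
  rw [nbrParity_join_inr hJ, if_neg hb, add_zero]

omit [DecidableRel G₂.Adj] in
/-- **`s_{ij}(G) = a_i b_j` letterwise away from `i₀`** (block one). [cite: GuhneTothHyllusBriegel2005, Appendix] -/
theorem stabWord_join_inl_of_ne (hJ : IsSingleEdgeJoin G G₁ G₂ i₀ j₀) (ξ : Fin (N₁ + N₂) → Bool) {a : Fin N₁}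
    (ha : a ≠ i₀) : stabWord G ξ (Fin.castAdd N₂ a) = stabWord G₁ (leftPat ξ) a := by
  rw [stabWord_eq_letter, stabWord_eq_letter, stabZ_join_inl_of_ne hJ ξ ha, leftPat_apply]

omit [DecidableRel G₁.Adj] in
/-- **`s_{ij}(G) = a_i b_j` letterwise away from `j₀`** (block two). [cite: GuhneTothHyllusBriegel2005, Appendix] -/
theorem stabWord_join_inr_of_ne (hJ : IsSingleEdgeJoin G G₁ G₂ i₀ j₀) (ξ : Fin (N₁ + N₂) → Bool) {b : Fin N₂}
    (hb : b ≠ j₀) : stabWord G ξ (Fin.natAdd N₁ b) = stabWord G₂ (rightPat ξ) b := by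
  rw [stabWord_eq_letter, stabWord_eq_letter, stabZ_join_inr_of_ne hJ ξ hb, rightPat_apply]

/-- In `𝔽₂`: adding a bit toggles the parity test. [folklore] -/
private theorem decide_add_bitZ (p : ZMod 2) (b : Bool) :
    decide (p + bitZ b = 1) = Bool.xor (decide (p = 1)) b := by
  revert p b
  decide

omit [DecidableRel G₂.Adj] in
/-- **The `Z`-bit at `i₀`** is toggled by the presence of `g_{j₀}`: `(Γ_Gξ)_{i₀} = (Γ_{G₁}ξ₁)_{i₀} ⊕ ξ_{j₀}`.
[cite: GuhneTothHyllusBriegel2005, Appendix (“transformations of the type `Z ↔ 𝟙` at `i_0` or `j_0`” and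
`{XX, XY, YX, YY} ↦ {YY, −YX, −XY, XX}`)] -/
theorem stabZ_join_i₀ (hJ : IsSingleEdgeJoin G G₁ G₂ i₀ j₀) (ξ : Fin (N₁ + N₂) → Bool) :
    stabZ G ξ (Fin.castAdd N₂ i₀) = Bool.xor (stabZ G₁ (leftPat ξ) i₀) (rightPat ξ j₀) := by
  unfold stabZ
  rw [nbrParity_join_inl hJ, if_pos rfl]
  exact decide_add_bitZ _ _

omit [DecidableRel G₁.Adj] in
/-- **The `Z`-bit at `j₀`**: `(Γ_Gξ)_{j₀} = (Γ_{G₂}ξ₂)_{j₀} ⊕ ξ_{i₀}`. [cite: GuhneTothHyllusBriegel2005, Appendix] -/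
theorem stabZ_join_j₀ (hJ : IsSingleEdgeJoin G G₁ G₂ i₀ j₀) (ξ : Fin (N₁ + N₂) → Bool) :
    stabZ G ξ (Fin.natAdd N₁ j₀) = Bool.xor (stabZ G₂ (rightPat ξ) j₀) (leftPat ξ i₀) := by
  unfold stabZ
  rw [nbrParity_join_inr hJ, if_pos rfl]
  exact decide_add_bitZ _ _

omit [DecidableRel G₂.Adj] in
/-- The letter of `s_{ij}(G)` at `i₀`. [cite: GuhneTothHyllusBriegel2005, Appendix] -/
theorem stabWord_join_i₀ (hJ : IsSingleEdgeJoin G G₁ G₂ i₀ j₀) (ξ : Fin (N₁ + N₂) → Bool) :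
    stabWord G ξ (Fin.castAdd N₂ i₀) = letter (leftPat ξ i₀) (Bool.xor (stabZ G₁ (leftPat ξ) i₀) (rightPat ξ j₀)) := by
  rw [stabWord_eq_letter, stabZ_join_i₀ hJ, leftPat_apply]

omit [DecidableRel G₁.Adj] in
/-- The letter of `s_{ij}(G)` at `j₀`. [cite: GuhneTothHyllusBriegel2005, Appendix] -/
theorem stabWord_join_j₀ (hJ : IsSingleEdgeJoin G G₁ G₂ i₀ j₀) (ξ : Fin (N₁ + N₂) → Bool) :
    stabWord G ξ (Fin.natAdd N₁ j₀) = letter (rightPat ξ j₀) (Bool.xor (stabZ G₂ (rightPat ξ) j₀) (leftPat ξ i₀)) := by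
  rw [stabWord_eq_letter, stabZ_join_j₀ hJ, rightPat_apply]

end Stabilizer

end LemmaThree
section LemmaThreeBound

variable {N₁ N₂ : ℕ}

/-- The values of a `Z`-normalised table at one site as a function of the letter (`𝟙, Z ↦ 1`, `X ↦ x`, `Y ↦ y`).
[cite: GuhneTothHyllusBriegel2005, Lemma 1 (“LHV models which assign `+1` to all `Z` measurements”) and Appendix] -/
def valXY (x y : ℤ) : Pauli → ℂ
  | Pauli.I => 1
  | Pauli.X => x
  | Pauli.Y => y
  | Pauli.Z => 1

/-- For a `Z`-normalised table the site value only depends on `m_j(X), m_j(Y)`. [cite: GuhneTothHyllusBriegel2005,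
Lemma 1 and Appendix] -/
theorem siteVal_eq_valXY {M : ℕ} (m : Fin M → Pauli → ℤ) (j : Fin M) (hI : m j Pauli.I = 1)
    (hZ : m j Pauli.Z = 1) (P : Pauli) : siteVal m j P = yphase P * valXY (m j Pauli.X) (m j Pauli.Y) P := by
  cases P <;> simp [siteVal, valXY, hI, hZ]

/-- **The “two possible changes of signs” at `(i₀, j₀)`** as a function of the two classes: `+p` on the blocks
`(X,X)` and `(Y,Y)`, `−p` on `(X,Y)` and `(Y,X)`, where `p = m_{i₀}(X)m_{i₀}(Y)m_{j₀}(X)m_{j₀}(Y) ∈ {±1}` decides which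
of the two printed sign patterns occurs; `+1` on every block involving `𝔄_{1,2}` or `𝔅_{1,2}` (there only `Z ↔ 𝟙`
happens). [cite: GuhneTothHyllusBriegel2005, Appendix (“So, depending on the LHV model, this results in this block
matrix in two possible changes of signs”)] -/
def joinSign (p : ℤ) : Option Bool → Option Bool → ℤ
  | some z₁, some z₂ => if z₁ = z₂ then p else -p
  | _, _ => 1

/-- `|J| ≤ 1`. [cite: GuhneTothHyllusBriegel2005, Appendix] -/
theorem abs_joinSign_le {p : ℤ} (hp : p = 1 ∨ p = -1) (κ₁ κ₂ : Option Bool) : |joinSign p κ₁ κ₂| ≤ 1 := by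
  rcases κ₁ with _ | z₁ <;> rcases κ₂ with _ | z₂ <;> simp only [joinSign] <;> try simp
  rcases hp with rfl | rfl <;> split_ifs <;> simp

/-- **The transformation at `(i₀, j₀)` in numbers.** With `a = ξ_{i₀}`, `b = ξ_{j₀}` and the `Z`-bits `z₁, z₂` of
`a_i`, `b_j` at `i₀`, `j₀`: the letters of `s_{ij}(G)` at `i₀, j₀` are `letter(a, z₁ ⊕ b)`, `letter(b, z₂ ⊕ a)`, its
edge sign picks up `(−1)^{ab}`, and the product of the two site values (phase included) equals `J` times that of
`a_i b_j` — this is `{XX, XY, YX, YY} ↦ {YY, −YX, −XY, XX}` evaluated under the table, and `Z ↔ 𝟙` otherwise.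
[cite: GuhneTothHyllusBriegel2005, Appendix] -/
theorem site_identity (x₁ y₁ x₂ y₂ : ℤ) (hx₁ : x₁ = 1 ∨ x₁ = -1) (hy₁ : y₁ = 1 ∨ y₁ = -1)
    (hx₂ : x₂ = 1 ∨ x₂ = -1) (hy₂ : y₂ = 1 ∨ y₂ = -1) (a z₁ b z₂ : Bool) :
    (chi (bitZ a * bitZ b) : ℂ) *
        (yphase (letter a (Bool.xor z₁ b)) * valXY x₁ y₁ (letter a (Bool.xor z₁ b))) *
        (yphase (letter b (Bool.xor z₂ a)) * valXY x₂ y₂ (letter b (Bool.xor z₂ a))) =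
      (joinSign (x₁ * y₁ * x₂ * y₂) (clsOf a z₁) (clsOf b z₂) : ℂ) *
        (yphase (letter a z₁) * valXY x₁ y₁ (letter a z₁)) *
        (yphase (letter b z₂) * valXY x₂ y₂ (letter b z₂)) := by
  have hchi1 : (chi (1 : ZMod 2) : ℂ) = -1 := chi_of_ne_zero (by decide)
  cases a <;> cases b <;> cases z₁ <;> cases z₂ <;>
    simp [letter, clsOf, joinSign, yphase, valXY, bitZ, hchi1] <;>
    rcases hx₁ with rfl | rfl <;> rcases hy₁ with rfl | rfl <;> rcases hx₂ with rfl | rfl <;>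
      rcases hy₂ with rfl | rfl <;> norm_num

variable {G₁ : SimpleGraph (Fin N₁)} {G₂ : SimpleGraph (Fin N₂)} [DecidableRel G₁.Adj] [DecidableRel G₂.Adj]
  {i₀ : Fin N₁} {j₀ : Fin N₂} {G : SimpleGraph (Fin (N₁ + N₂))} [DecidableRel G.Adj]

/-- Phase-product form of a term, casts pushed. [cite: GuhneTothHyllusBriegel2005, eqs. (5)–(7)] -/
theorem term_cast' {M : ℕ} (H : SimpleGraph (Fin M)) [DecidableRel H.Adj] (ξ : Fin M → Bool)
    (m : Fin M → Pauli → ℤ) :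
    (stabSign H ξ : ℂ) * (lhvValue m (stabWord H ξ) : ℂ) = chi (edgeParity H ξ) * ∏ j, siteVal m j (stabWord H ξ j) := by
  rw [← term_cast]; push_cast; rfl

/-- `p = m_{i₀}(X)m_{i₀}(Y)m_{j₀}(X)m_{j₀}(Y)`, the sign deciding between the two printed patterns.
[cite: GuhneTothHyllusBriegel2005, Appendix (“depending on the LHV model”)] -/
def pSign (i₀ : Fin N₁) (j₀ : Fin N₂) (m : Fin (N₁ + N₂) → Pauli → ℤ) : ℤ :=
  m (Fin.castAdd N₂ i₀) Pauli.X * m (Fin.castAdd N₂ i₀) Pauli.Y * m (Fin.natAdd N₁ j₀) Pauli.X *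
    m (Fin.natAdd N₁ j₀) Pauli.Y

/-- `p ∈ {±1}`. [cite: GuhneTothHyllusBriegel2005, Appendix] -/
theorem pSign_pm (i₀ : Fin N₁) (j₀ : Fin N₂) (m : Fin (N₁ + N₂) → Pauli → ℤ)
    (hm : ∀ j P, m j P = 1 ∨ m j P = -1) : pSign i₀ j₀ m = 1 ∨ pSign i₀ j₀ m = -1 := by
  unfold pSign
  rcases hm (Fin.castAdd N₂ i₀) Pauli.X with h1 | h1 <;> rcases hm (Fin.castAdd N₂ i₀) Pauli.Y with h2 | h2 <;>
    rcases hm (Fin.natAdd N₁ j₀) Pauli.X with h3 | h3 <;> rcases hm (Fin.natAdd N₁ j₀) Pauli.Y with h4 | h4 <;>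
    simp [h1, h2, h3, h4]

/-- **`⟨s_{ij}(G)⟩ = J_{κ(i)λ(j)}·⟨a_i⟩⟨b_j⟩` term by term** for a table with `m_{i₀}(Z) = m_{j₀}(Z) = +1` (Lemma 1):
the LHV value (sign included) of the term `ξ = ξ₁ ++ ξ₂` of `𝓑(G₁ — G₂)` is the product of the values of the
terms `ξ₁` of `𝓑(G₁)` and `ξ₂` of `𝓑(G₂)` times the block sign `J`. [cite: GuhneTothHyllusBriegel2005, Appendix
(“The mean values `⟨s_{ij}⟩ = ⟨a_i⟩⟨b_j⟩` would factorize if there were no connection … In the blocks `𝔄_i𝔅_j` with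
`i ≤ 2` or `j ≤ 2` the extra connection only introduces transformations of the type `Z ↔ 𝟙` … which can be
neglected due to Lemma 1 … `{XX, XY, YX, YY} ↦ {YY, −YX, −XY, XX}` … two possible changes of signs”)] -/
theorem term_join (hJ : IsSingleEdgeJoin G G₁ G₂ i₀ j₀) (m : Fin (N₁ + N₂) → Pauli → ℤ)
    (hm : ∀ j P, m j P = 1 ∨ m j P = -1) (hmI : ∀ j, m j Pauli.I = 1)
    (hZ₁ : m (Fin.castAdd N₂ i₀) Pauli.Z = 1) (hZ₂ : m (Fin.natAdd N₁ j₀) Pauli.Z = 1)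
    (ξ : Fin (N₁ + N₂) → Bool) :
    stabSign G ξ * lhvValue m (stabWord G ξ) =
      joinSign (pSign i₀ j₀ m) (cls G₁ i₀ (leftPat ξ)) (cls G₂ j₀ (rightPat ξ)) *
        (stabSign G₁ (leftPat ξ) * lhvValue (leftTable m) (stabWord G₁ (leftPat ξ))) *
        (stabSign G₂ (rightPat ξ) * lhvValue (rightTable m) (stabWord G₂ (rightPat ξ))) := by
  apply Int.cast_injective (α := ℂ)
  push_cast
  rw [term_cast' G ξ m, term_cast' G₁ (leftPat ξ) (leftTable m), term_cast' G₂ (rightPat ξ) (rightTable m),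
    edgeParity_join hJ, chi_add, chi_add, Fin.prod_univ_add]
  -- split off the sites `i₀` and `j₀`; away from them `s_{ij}(G) = a_i b_j` letterwise
  have hL : ∏ a : Fin N₁, siteVal m (Fin.castAdd N₂ a) (stabWord G ξ (Fin.castAdd N₂ a)) =
      siteVal m (Fin.castAdd N₂ i₀) (stabWord G ξ (Fin.castAdd N₂ i₀)) *
        ∏ a ∈ Finset.univ.erase i₀, siteVal (leftTable m) a (stabWord G₁ (leftPat ξ) a) := by
    rw [← Finset.mul_prod_erase Finset.univ _ (Finset.mem_univ i₀)]
    congr 1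
    exact Finset.prod_congr rfl fun a ha => by
      rw [stabWord_join_inl_of_ne hJ ξ (Finset.ne_of_mem_erase ha)]; rfl
  have hL₁ : ∏ a : Fin N₁, siteVal (leftTable m) a (stabWord G₁ (leftPat ξ) a) =
      siteVal (leftTable m) i₀ (stabWord G₁ (leftPat ξ) i₀) *
        ∏ a ∈ Finset.univ.erase i₀, siteVal (leftTable m) a (stabWord G₁ (leftPat ξ) a) :=
    (Finset.mul_prod_erase Finset.univ _ (Finset.mem_univ i₀)).symm
  have hR : ∏ b : Fin N₂, siteVal m (Fin.natAdd N₁ b) (stabWord G ξ (Fin.natAdd N₁ b)) =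
      siteVal m (Fin.natAdd N₁ j₀) (stabWord G ξ (Fin.natAdd N₁ j₀)) *
        ∏ b ∈ Finset.univ.erase j₀, siteVal (rightTable m) b (stabWord G₂ (rightPat ξ) b) := by
    rw [← Finset.mul_prod_erase Finset.univ _ (Finset.mem_univ j₀)]
    congr 1
    exact Finset.prod_congr rfl fun b hb => by
      rw [stabWord_join_inr_of_ne hJ ξ (Finset.ne_of_mem_erase hb)]; rfl
  have hR₂ : ∏ b : Fin N₂, siteVal (rightTable m) b (stabWord G₂ (rightPat ξ) b) =
      siteVal (rightTable m) j₀ (stabWord G₂ (rightPat ξ) j₀) *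
        ∏ b ∈ Finset.univ.erase j₀, siteVal (rightTable m) b (stabWord G₂ (rightPat ξ) b) :=
    (Finset.mul_prod_erase Finset.univ _ (Finset.mem_univ j₀)).symm
  rw [hL, hL₁, hR, hR₂, stabWord_join_i₀ hJ, stabWord_join_j₀ hJ, stabWord_eq_letter G₁ (leftPat ξ) i₀,
    stabWord_eq_letter G₂ (rightPat ξ) j₀, siteVal_eq_valXY m _ (hmI _) hZ₁, siteVal_eq_valXY m _ (hmI _) hZ₂,
    siteVal_eq_valXY (leftTable m) i₀ (hmI _) hZ₁, siteVal_eq_valXY (rightTable m) j₀ (hmI _) hZ₂]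
  simp only [leftTable, rightTable, pSign, cls]
  have key := site_identity (m (Fin.castAdd N₂ i₀) Pauli.X) (m (Fin.castAdd N₂ i₀) Pauli.Y)
    (m (Fin.natAdd N₁ j₀) Pauli.X) (m (Fin.natAdd N₁ j₀) Pauli.Y) (hm _ _) (hm _ _) (hm _ _) (hm _ _)
    (leftPat ξ i₀) (stabZ G₁ (leftPat ξ) i₀) (rightPat ξ j₀) (stabZ G₂ (rightPat ξ) j₀)
  linear_combination (chi (K := ℂ) (edgeParity G₁ (leftPat ξ)) * chi (K := ℂ) (edgeParity G₂ (rightPat ξ)) *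
    (∏ a ∈ Finset.univ.erase i₀, siteVal (leftTable m) a (stabWord G₁ (leftPat ξ) a)) *
    (∏ b ∈ Finset.univ.erase j₀, siteVal (rightTable m) b (stabWord G₂ (rightPat ξ) b))) * key

omit [DecidableRel G₁.Adj] [DecidableRel G₂.Adj] in
/-- `Σ_ξ = Σ_{ξ₁} Σ_{ξ₂}` over `ξ = ξ₁ ++ ξ₂` (the double index of `s_{ij}`). [cite: GuhneTothHyllusBriegel2005, Appendix] -/
theorem lhvBell_eq_sum_append (m : Fin (N₁ + N₂) → Pauli → ℤ) :
    lhvBell G m = ∑ ξ₁ : Fin N₁ → Bool, ∑ ξ₂ : Fin N₂ → Bool,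
      stabSign G (Fin.append ξ₁ ξ₂) * lhvValue m (stabWord G (Fin.append ξ₁ ξ₂)) := by
  unfold lhvBell
  rw [← Fintype.sum_prod_type' (fun ξ₁ ξ₂ =>
    stabSign G (Fin.append ξ₁ ξ₂) * lhvValue m (stabWord G (Fin.append ξ₁ ξ₂)))]
  refine Fintype.sum_equiv patEquiv _ _ fun ξ => ?_
  simp only [patEquiv, Equiv.coe_fn_mk, append_leftPat_rightPat]

/-- **`⟨𝓑(G)⟩_{LHV} = Σ_{κλ} J_{κλ}·A_κ·B_λ`**: the value of `𝓑(G₁ — G₂)` under a (`Z`-normalised at `i₀, j₀`) table is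
the signed bilinear combination of the class sums `(γ_a, δ_a, ε_a)` of `𝓑(G₁)` and `(γ_b, δ_b, ε_b)` of `𝓑(G₂)` under
the restricted tables — the source's `Σ_{ij}⟨s_{ij}⟩ = γ_a(γ_b + δ_b + ε_b) + δ_a(γ_b ± δ_b ∓ ε_b) + ε_a(γ_b ∓ δ_b ± ε_b)`.
[cite: GuhneTothHyllusBriegel2005, Appendix] -/
theorem lhvBell_join_eq (hJ : IsSingleEdgeJoin G G₁ G₂ i₀ j₀) (m : Fin (N₁ + N₂) → Pauli → ℤ)
    (hm : ∀ j P, m j P = 1 ∨ m j P = -1) (hmI : ∀ j, m j Pauli.I = 1)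
    (hZ₁ : m (Fin.castAdd N₂ i₀) Pauli.Z = 1) (hZ₂ : m (Fin.natAdd N₁ j₀) Pauli.Z = 1) :
    lhvBell G m = ∑ κ₁ : Option Bool, ∑ κ₂ : Option Bool, joinSign (pSign i₀ j₀ m) κ₁ κ₂ *
      (classSum G₁ i₀ (leftTable m) κ₁ * classSum G₂ j₀ (rightTable m) κ₂) := by
  rw [lhvBell_eq_sum_append]
  unfold classSum
  rw [← sum_sum_eq_sum_fiber (cls G₁ i₀) (cls G₂ j₀) (joinSign (pSign i₀ j₀ m))
    (fun ξ₁ => stabSign G₁ ξ₁ * lhvValue (leftTable m) (stabWord G₁ ξ₁))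
    (fun ξ₂ => stabSign G₂ ξ₂ * lhvValue (rightTable m) (stabWord G₂ ξ₂))]
  refine Finset.sum_congr rfl fun ξ₁ _ => Finset.sum_congr rfl fun ξ₂ _ => ?_
  rw [term_join hJ m hm hmI hZ₁ hZ₂ (Fin.append ξ₁ ξ₂), leftPat_append, rightPat_append]
  ring

/-- **`|⟨𝓑(G)⟩| ≤ (|γ_a| + |δ_a| + |ε_a|)(|γ_b| + |δ_b| + |ε_b|)`** since every `|J_{κλ}| ≤ 1` (this replaces the
source's 64-case analysis; see the module docstring). [cite: GuhneTothHyllusBriegel2005, Appendix (“we have to show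
that `|Σ_{ij}⟨s_{ij}⟩| … ≤ 𝒞(G_1)𝒞(G_2)`”)] -/
theorem abs_lhvBell_join_le_prod (hJ : IsSingleEdgeJoin G G₁ G₂ i₀ j₀) (m : Fin (N₁ + N₂) → Pauli → ℤ)
    (hm : ∀ j P, m j P = 1 ∨ m j P = -1) (hmI : ∀ j, m j Pauli.I = 1)
    (hZ₁ : m (Fin.castAdd N₂ i₀) Pauli.Z = 1) (hZ₂ : m (Fin.natAdd N₁ j₀) Pauli.Z = 1) :
    |lhvBell G m| ≤ (∑ κ, |classSum G₁ i₀ (leftTable m) κ|) * (∑ κ, |classSum G₂ j₀ (rightTable m) κ|) := by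
  rw [lhvBell_join_eq hJ m hm hmI hZ₁ hZ₂, Finset.sum_mul_sum]
  refine (Finset.abs_sum_le_sum_abs _ _).trans (Finset.sum_le_sum fun κ₁ _ =>
    (Finset.abs_sum_le_sum_abs _ _).trans (Finset.sum_le_sum fun κ₂ _ => ?_))
  rw [abs_mul, abs_mul]
  have hJ1 := abs_joinSign_le (pSign_pm i₀ j₀ m hm) κ₁ κ₂
  have h0 : 0 ≤ |classSum G₁ i₀ (leftTable m) κ₁| * |classSum G₂ j₀ (rightTable m) κ₂| := by positivity
  calc |joinSign (pSign i₀ j₀ m) κ₁ κ₂| * (|classSum G₁ i₀ (leftTable m) κ₁| * |classSum G₂ j₀ (rightTable m) κ₂|)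
      ≤ 1 * (|classSum G₁ i₀ (leftTable m) κ₁| * |classSum G₂ j₀ (rightTable m) κ₂|) :=
        mul_le_mul_of_nonneg_right hJ1 h0
    _ = |classSum G₁ i₀ (leftTable m) κ₁| * |classSum G₂ j₀ (rightTable m) κ₂| := one_mul _

/-- **Lemma 3 of Gühne–Tóth–Hyllus–Briegel: `𝒞(G₁ — G₂) ≤ 𝒞(G₁)·𝒞(G₂)`.** If `|⟨𝓑(G₁)⟩_{LHV}| ≤ C₁` for every `±1`
table and `|⟨𝓑(G₂)⟩_{LHV}| ≤ C₂` for every `±1` table, then `|⟨𝓑(G)⟩_{LHV}| ≤ C₁C₂` for every `±1` table of the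
single-edge join `G = G₁ — G₂` (tables assign `1` to `𝟙`). Proof: Lemma 1 normalises the `Z`-values; then
`⟨𝓑(G)⟩ = Σ J_{κλ}A_κB_λ` with `|J| ≤ 1`, and `Σ_κ|A_κ| ≤ C₁`, `Σ_λ|B_λ| ≤ C₂` by the flipped tables.
[cite: GuhneTothHyllusBriegel2005, Lemma 3 (“Then `𝒟(G) ≤ 𝒟(G_1)𝒟(G_2)`”) and Appendix] -/
theorem abs_lhvBell_le_mul_of_isSingleEdgeJoin (hJ : IsSingleEdgeJoin G G₁ G₂ i₀ j₀) (C₁ C₂ : ℤ)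
    (hC₁ : ∀ m₁ : Fin N₁ → Pauli → ℤ, (∀ j P, m₁ j P = 1 ∨ m₁ j P = -1) → (∀ j, m₁ j Pauli.I = 1) →
      |lhvBell G₁ m₁| ≤ C₁)
    (hC₂ : ∀ m₂ : Fin N₂ → Pauli → ℤ, (∀ j P, m₂ j P = 1 ∨ m₂ j P = -1) → (∀ j, m₂ j Pauli.I = 1) →
      |lhvBell G₂ m₂| ≤ C₂)
    (m : Fin (N₁ + N₂) → Pauli → ℤ) (hm : ∀ j P, m j P = 1 ∨ m j P = -1) (hmI : ∀ j, m j Pauli.I = 1) :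
    |lhvBell G m| ≤ C₁ * C₂ := by
  -- Lemma 1: normalise the `Z`-values
  obtain ⟨m', hm', hm'I, hm'Z, -, hbell⟩ := exists_table_Z_one G m hm hmI
  rw [← hbell]
  have h1 := sum_abs_classSum_le G₁ i₀ C₁ hC₁ (leftTable m') (fun a P => hm' _ _) (fun a => hm'I _)
  have h2 := sum_abs_classSum_le G₂ j₀ C₂ hC₂ (rightTable m') (fun b P => hm' _ _) (fun b => hm'I _)
  have h0 : (0 : ℤ) ≤ ∑ κ, |classSum G₁ i₀ (leftTable m') κ| := Finset.sum_nonneg fun _ _ => abs_nonneg _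
  calc |lhvBell G m'| ≤ (∑ κ, |classSum G₁ i₀ (leftTable m') κ|) * (∑ κ, |classSum G₂ j₀ (rightTable m') κ|) :=
        abs_lhvBell_join_le_prod hJ m' hm' hm'I (hm'Z _) (hm'Z _)
    _ ≤ C₁ * C₂ := mul_le_mul h1 h2 (Finset.sum_nonneg fun _ _ => abs_nonneg _) (h0.trans h1)

/-- **`𝒟(G) ≤ 𝒟(G₁)𝒟(G₂)`** — the same in the normalised parameter `𝒟 = 𝒞/2^n` (`2^{N₁+N₂} = 2^{N₁}2^{N₂}`).
[cite: GuhneTothHyllusBriegel2005, Lemma 3] -/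
theorem dd_le_mul_of_isSingleEdgeJoin (hJ : IsSingleEdgeJoin G G₁ G₂ i₀ j₀) (C₁ C₂ : ℤ)
    (hC₁ : ∀ m₁ : Fin N₁ → Pauli → ℤ, (∀ j P, m₁ j P = 1 ∨ m₁ j P = -1) → (∀ j, m₁ j Pauli.I = 1) →
      |lhvBell G₁ m₁| ≤ C₁)
    (hC₂ : ∀ m₂ : Fin N₂ → Pauli → ℤ, (∀ j P, m₂ j P = 1 ∨ m₂ j P = -1) → (∀ j, m₂ j Pauli.I = 1) →
      |lhvBell G₂ m₂| ≤ C₂)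
    (m : Fin (N₁ + N₂) → Pauli → ℤ) (hm : ∀ j P, m j P = 1 ∨ m j P = -1) (hmI : ∀ j, m j Pauli.I = 1) :
    (|lhvBell G m| : ℝ) / 2 ^ (N₁ + N₂) ≤ (C₁ / 2 ^ N₁) * (C₂ / 2 ^ N₂) := by
  rw [div_mul_div_comm, ← pow_add]
  refine div_le_div_of_nonneg_right ?_ (by positivity)
  exact_mod_cast abs_lhvBell_le_mul_of_isSingleEdgeJoin hJ C₁ C₂ hC₁ hC₂ m hm hmI

/-- **Attaching any graph by a single edge does not increase `𝒟`**: `𝒞(G₁ — G₂) ≤ 𝒞(G₁)·2^{N₂}` (Lemma 3 with the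
trivial bound `𝒟(G₂) ≤ 1`) — the step applied “again” along a tree. [cite: GuhneTothHyllusBriegel2005, Theorem 2
(proof: “For tree graphs Lemma 3 can be applied again to show that `𝒟(G_i)` is smaller than the `𝒟` from the longest
linear cluster in `G_i`”)] -/
theorem abs_lhvBell_le_mul_two_pow_of_isSingleEdgeJoin (hJ : IsSingleEdgeJoin G G₁ G₂ i₀ j₀) (C₁ : ℤ)
    (hC₁ : ∀ m₁ : Fin N₁ → Pauli → ℤ, (∀ j P, m₁ j P = 1 ∨ m₁ j P = -1) → (∀ j, m₁ j Pauli.I = 1) →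
      |lhvBell G₁ m₁| ≤ C₁)
    (m : Fin (N₁ + N₂) → Pauli → ℤ) (hm : ∀ j P, m j P = 1 ∨ m j P = -1) (hmI : ∀ j, m j Pauli.I = 1) :
    |lhvBell G m| ≤ C₁ * 2 ^ N₂ :=
  abs_lhvBell_le_mul_of_isSingleEdgeJoin hJ C₁ (2 ^ N₂) hC₁ (fun m₂ hm₂ _ => abs_lhvBell_le_two_pow G₂ m₂ hm₂)
    m hm hmI

/-- **Lemma 3 for the explicit join `singleEdgeJoin G₁ G₂ i₀ j₀`.** [cite: GuhneTothHyllusBriegel2005, Lemma 3] -/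
theorem abs_lhvBell_singleEdgeJoin_le (G₁ : SimpleGraph (Fin N₁)) (G₂ : SimpleGraph (Fin N₂))
    [DecidableRel G₁.Adj] [DecidableRel G₂.Adj] (i₀ : Fin N₁) (j₀ : Fin N₂) (C₁ C₂ : ℤ)
    (hC₁ : ∀ m₁ : Fin N₁ → Pauli → ℤ, (∀ j P, m₁ j P = 1 ∨ m₁ j P = -1) → (∀ j, m₁ j Pauli.I = 1) →
      |lhvBell G₁ m₁| ≤ C₁)
    (hC₂ : ∀ m₂ : Fin N₂ → Pauli → ℤ, (∀ j P, m₂ j P = 1 ∨ m₂ j P = -1) → (∀ j, m₂ j Pauli.I = 1) →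
      |lhvBell G₂ m₂| ≤ C₂)
    (m : Fin (N₁ + N₂) → Pauli → ℤ) (hm : ∀ j P, m j P = 1 ∨ m j P = -1) (hmI : ∀ j, m j Pauli.I = 1) :
    |lhvBell (singleEdgeJoin G₁ G₂ i₀ j₀) m| ≤ C₁ * C₂ :=
  abs_lhvBell_le_mul_of_isSingleEdgeJoin (isSingleEdgeJoin_singleEdgeJoin G₁ G₂ i₀ j₀) C₁ C₂ hC₁ hC₂ m hm hmI

end LemmaThreeBound
/-! ### Theorem 2: the violation grows exponentially along linear clusters -/

section TheoremTwo

/-- **`LC_{n+k} = LC_n — LC_k`**: the path on `Fin (n + k)` is the single-edge join of the paths on the two blocks,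
connected at the last vertex `n − 1` of the first and the first vertex `0` of the second.
[cite: GuhneTothHyllusBriegel2005, Theorem 2 (proof: “From Lemma 3 and Table I it follows that for linear cluster
graphs `LC_i` the value `1/𝒟(LC_i)` increases exponentially”), Fig. 1 (`LC_n`)] -/
theorem isSingleEdgeJoin_linearCluster (n k : ℕ) (hn : 1 ≤ n) (hk : 1 ≤ k) :
    IsSingleEdgeJoin (linearCluster (n + k)) (linearCluster n) (linearCluster k) ⟨n - 1, by omega⟩
      ⟨0, by omega⟩ where
  adj_inl a b := by
    simp only [linearCluster_adj, Fin.val_castAdd]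
  adj_inr a b := by
    simp only [linearCluster_adj, Fin.val_natAdd]
    omega
  adj_inl_inr a b := by
    simp only [linearCluster_adj, Fin.val_castAdd, Fin.val_natAdd, Fin.ext_iff]
    have ha := a.isLt
    have hb := b.isLt
    omega

/-- **`𝒞(LC_{4k}) ≤ 12^k`**: for the `4k`-qubit linear cluster state every `±1` table has `|⟨𝓑(LC_{4k})⟩_{LHV}| ≤ 12^k`
— by induction, `LC_{4(k+1)} = LC_{4k} — LC_4`, Lemma 3 and `𝒞(LC_4) = 12` (Table I, `abs_lhvBell_lc4_le`).
[cite: GuhneTothHyllusBriegel2005, Theorem 2 (proof) and Table I] -/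
theorem abs_lhvBell_linearCluster_mul_four_le :
    ∀ (k : ℕ) (m : Fin (4 * k) → Pauli → ℤ), (∀ j P, m j P = 1 ∨ m j P = -1) → (∀ j, m j Pauli.I = 1) →
      |lhvBell (linearCluster (4 * k)) m| ≤ 12 ^ k := by
  intro k
  induction k with
  | zero =>
    intro m hm _
    calc |lhvBell (linearCluster (4 * 0)) m| ≤ 2 ^ (4 * 0) := abs_lhvBell_le_two_pow _ m hm
      _ = 12 ^ 0 := by norm_num
  | succ k ih =>
    intro m hm hmI
    rcases Nat.eq_zero_or_pos k with rfl | hk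
    · -- `LC_4`: Table I
      show |lhvBell (linearCluster 4) m| ≤ 12 ^ 1
      rw [pow_one]
      exact abs_lhvBell_lc4_le m hm hmI
    · -- `LC_{4k+4} = LC_{4k} — LC_4`
      have hJ := isSingleEdgeJoin_linearCluster (4 * k) 4 (by omega) (by omega)
      show |lhvBell (linearCluster (4 * k + 4)) m| ≤ 12 ^ (k + 1)
      calc |lhvBell (linearCluster (4 * k + 4)) m| ≤ 12 ^ k * 12 :=
            abs_lhvBell_le_mul_of_isSingleEdgeJoin hJ (12 ^ k) 12 (fun m₁ hm₁ hm₁I => ih m₁ hm₁ hm₁I)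
              (fun m₂ hm₂ hm₂I => abs_lhvBell_lc4_le m₂ hm₂ hm₂I) m hm hmI
        _ = 12 ^ (k + 1) := by ring

/-- **`𝒞(LC_{4k+r}) ≤ 12^k·2^r` for `r < 4`** (all lengths `n = 4k + r`): `LC_{4k+r} = LC_{4k} — LC_r` with the trivial
bound on the short tail. [cite: GuhneTothHyllusBriegel2005, Theorem 2 (proof) and Lemma 3] -/
theorem abs_lhvBell_linearCluster_le (k r : ℕ) (hr : r < 4) (m : Fin (4 * k + r) → Pauli → ℤ)
    (hm : ∀ j P, m j P = 1 ∨ m j P = -1) (hmI : ∀ j, m j Pauli.I = 1) :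
    |lhvBell (linearCluster (4 * k + r)) m| ≤ 12 ^ k * 2 ^ r := by
  rcases Nat.eq_zero_or_pos r with rfl | hr0
  · show |lhvBell (linearCluster (4 * k)) m| ≤ 12 ^ k * 2 ^ 0
    rw [pow_zero, mul_one]
    exact abs_lhvBell_linearCluster_mul_four_le k m hm hmI
  · rcases Nat.eq_zero_or_pos k with rfl | hk
    · calc |lhvBell (linearCluster (4 * 0 + r)) m| ≤ 2 ^ (4 * 0 + r) := abs_lhvBell_le_two_pow _ m hm
        _ = 12 ^ 0 * 2 ^ r := by rw [Nat.mul_zero, Nat.zero_add, pow_zero, one_mul]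
    · have hJ := isSingleEdgeJoin_linearCluster (4 * k) r (by omega) hr0
      exact abs_lhvBell_le_mul_of_isSingleEdgeJoin hJ (12 ^ k) (2 ^ r)
        (fun m₁ hm₁ hm₁I => abs_lhvBell_linearCluster_mul_four_le k m₁ hm₁ hm₁I)
        (fun m₂ hm₂ _ => abs_lhvBell_le_two_pow _ m₂ hm₂) m hm hmI

/-- **Theorem 2 of Gühne–Tóth–Hyllus–Briegel for linear clusters: `𝒟(LC_{4k}) ≤ (3/4)^k`** — the normalised LHV bound
decays (so `1/𝒟(LC_i)`, the factor by which the `4k`-qubit linear cluster state exceeds every LHV model, “increases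
exponentially”), while `⟨LC_{4k}|𝓑|LC_{4k}⟩ = 2^{4k}` (`expect_bellOperator`). [cite: GuhneTothHyllusBriegel2005,
Theorem 2 (“violation of a Bell inequality for `|G_i⟩` increases exponentially with `i`. Proof. From Lemma 3 and
Table I it follows that for linear cluster graphs `LC_i` the value `1/𝒟(LC_i)` increases exponentially”)] -/
theorem dd_linearCluster_le (k : ℕ) (m : Fin (4 * k) → Pauli → ℤ) (hm : ∀ j P, m j P = 1 ∨ m j P = -1)
    (hmI : ∀ j, m j Pauli.I = 1) :
    (|lhvBell (linearCluster (4 * k)) m| : ℝ) / 2 ^ (4 * k) ≤ (3 / 4 : ℝ) ^ k := by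
  have h' : (|lhvBell (linearCluster (4 * k)) m| : ℝ) ≤ 12 ^ k := by
    exact_mod_cast abs_lhvBell_linearCluster_mul_four_le k m hm hmI
  calc (|lhvBell (linearCluster (4 * k)) m| : ℝ) / 2 ^ (4 * k) ≤ 12 ^ k / 2 ^ (4 * k) :=
        div_le_div_of_nonneg_right h' (by positivity)
    _ = (3 / 4 : ℝ) ^ k := by
        rw [pow_mul, ← div_pow]
        norm_num

end TheoremTwo

/-! ### Lemma 4: `𝒟` is invariant under local complementation -/

section LemmaFour

variable {N : ℕ} (G : SimpleGraph (Fin N)) [DecidableRel G.Adj] (a : Fin N)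

omit G [DecidableRel G.Adj] a in
/-- The letter permutation of conjugation by `e^{−iπ/4σ_x}`: `Y ↔ Z`. [cite: HeinEtAl2006GraphStates, Proposition 2
(`e^{−i(π/4)σ_x^a}`); GuhneTothHyllusBriegel2005, Lemma 4 (proof)] -/
def xConjPerm : Pauli → Pauli
  | Pauli.Y => Pauli.Z
  | Pauli.Z => Pauli.Y
  | P => P

omit G [DecidableRel G.Adj] a in
/-- The letter sign of conjugation by `e^{−iπ/4σ_x}`: `Z ↦ −Y`. [cite: HeinEtAl2006GraphStates, Proposition 2;
GuhneTothHyllusBriegel2005, Lemma 4 (proof)] -/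
def xConjSgn : Pauli → ℤ
  | Pauli.Z => -1
  | _ => 1

omit G [DecidableRel G.Adj] a in
/-- The letter permutation of conjugation by `e^{iπ/4σ_z}`: `X ↔ Y`. [cite: HeinEtAl2006GraphStates, Proposition 2
(`e^{i(π/4)σ_z^{N_a}}`); GuhneTothHyllusBriegel2005, Lemma 4 (proof)] -/
def zConjPerm : Pauli → Pauli
  | Pauli.X => Pauli.Y
  | Pauli.Y => Pauli.X
  | P => P

omit G [DecidableRel G.Adj] a in
/-- The letter sign of conjugation by `e^{iπ/4σ_z}`: `X ↦ −Y`. [cite: HeinEtAl2006GraphStates, Proposition 2;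
GuhneTothHyllusBriegel2005, Lemma 4 (proof)] -/
def zConjSgn : Pauli → ℤ
  | Pauli.X => -1
  | _ => 1

/-- **The letter permutation of the LC-unitary `U_a^τ(G) = e^{−iπ/4σ_x^{(a)}} e^{iπ/4σ_z^{N_a}}` at site
`j`**: conjugation by `e^{−iπ/4σ_x}` at `a` exchanges `Y ↔ Z`, conjugation by `e^{iπ/4σ_z}` at the
neighbours of `a` exchanges `X ↔ Y`, all other sites are untouched (“the local complementation maps
Pauli matrices to Pauli matrices on each qubit”). [cite: GuhneTothHyllusBriegel2005, Lemma 4 (proof);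
HeinEtAl2006GraphStates, Proposition 2 (`U_a^τ(G)`)] -/
def lcPerm (j : Fin N) (P : Pauli) : Pauli :=
  if j = a then xConjPerm P else if G.Adj a j then zConjPerm P else P

/-- **The letter signs of the same conjugation**: `e^{−iπ/4σ_x} σ_z e^{iπ/4σ_x} = −σ_y` at `a`,
`e^{iπ/4σ_z} σ_x e^{−iπ/4σ_z} = −σ_y` at the neighbours; all other letters keep their sign.
[cite: GuhneTothHyllusBriegel2005, Lemma 4 (proof, via Lemma 2: signed permutations of the
observables); HeinEtAl2006GraphStates, Proposition 2] -/
def lcSgn (j : Fin N) (P : Pauli) : ℤ :=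
  if j = a then xConjSgn P else if G.Adj a j then zConjSgn P else 1

/-- The letter permutation is an involution at every site. [cite: GuhneTothHyllusBriegel2005, Lemma 4] -/
theorem lcPerm_lcPerm (j : Fin N) (P : Pauli) : lcPerm G a j (lcPerm G a j P) = P := by
  unfold lcPerm
  by_cases hj : j = a
  · simp only [hj, if_true]; cases P <;> rfl
  · simp only [hj, if_false]
    by_cases hadj : G.Adj a j
    · simp only [hadj, if_true]; cases P <;> rfl
    · simp only [hadj, if_false]

/-- `𝟙` is fixed. [cite: GuhneTothHyllusBriegel2005, Lemma 4] -/
theorem lcPerm_I (j : Fin N) : lcPerm G a j Pauli.I = Pauli.I := by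
  unfold lcPerm; split_ifs <;> rfl

/-- `𝟙` carries no sign. [cite: GuhneTothHyllusBriegel2005, Lemma 4] -/
theorem lcSgn_I (j : Fin N) : lcSgn G a j Pauli.I = 1 := by
  unfold lcSgn; split_ifs <;> rfl

/-- The signs are `±1`. [cite: GuhneTothHyllusBriegel2005, Lemma 4] -/
theorem lcSgn_pm (j : Fin N) (P : Pauli) : lcSgn G a j P = 1 ∨ lcSgn G a j P = -1 := by
  unfold lcSgn; split_ifs <;> cases P <;> simp [xConjSgn, zConjSgn]

omit G [DecidableRel G.Adj] a in
/-- `e^{−iπ/4σ_x} = (𝟙 − iσ_x)/√2` as a scalar multiple of the Gaussian-integer matrix `𝟙 − iσ_x`. [cite: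
HeinEtAl2006GraphStates, Proposition 2 (`e^{−i(π/4)σ_x^a}`)] -/
private theorem xRoot_eq_smul :
    xRoot = (Tsirelson.CHSHOpt.invSqrtTwo : ℂ) • (Matrix.of fun b b' : Bool => if b = b' then (1 : ℂ) else -Complex.I) := by
  ext b b'
  rw [xRoot_apply, Matrix.smul_apply, Matrix.of_apply, smul_eq_mul]
  split_ifs <;> ring

omit G [DecidableRel G.Adj] a in
/-- `e^{iπ/4σ_z} = diag(1 + i, 1 − i)/√2`. [cite: HeinEtAl2006GraphStates, Proposition 2 (`e^{i(π/4)σ_z}`)] -/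
private theorem zRoot_eq_smul :
    zRoot = (Tsirelson.CHSHOpt.invSqrtTwo : ℂ) •
      (Matrix.of fun b b' : Bool => if b = b' then (if b then 1 - Complex.I else 1 + Complex.I) else 0) := by
  ext b b'
  rw [zRoot_apply, Matrix.smul_apply, Matrix.of_apply, smul_eq_mul, star_omega, omega]
  split_ifs <;> ring

omit G [DecidableRel G.Adj] a in
/-- `(cM) P (cM)† = c² · M P M†` for a real scalar `c`. [folklore] -/
private theorem smul_conj (c : ℝ) (M P : Matrix Bool Bool ℂ) :
    ((c : ℂ) • M) * P * ((c : ℂ) • M)ᴴ = ((c : ℂ) * c) • (M * P * Mᴴ) := by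
  rw [Matrix.conjTranspose_smul, Complex.star_def, Complex.conj_ofReal, Matrix.smul_mul, Matrix.smul_mul,
    Matrix.mul_smul, smul_smul]

omit G [DecidableRel G.Adj] a in
/-- `c² = 1/2` for `c = 1/√2`, in `ℂ`. [folklore] -/
private theorem c_mul_c_lc : (Tsirelson.CHSHOpt.invSqrtTwo : ℂ) * (Tsirelson.CHSHOpt.invSqrtTwo : ℂ) = 1 / 2 := by
  rw [← Complex.ofReal_mul, Tsirelson.CHSHOpt.invSqrtTwo_mul_self]; push_cast; ring

omit G [DecidableRel G.Adj] a in
/-- **Conjugation table of `e^{−iπ/4σ_x}`**: `X ↦ X`, `Y ↦ Z`, `Z ↦ −Y`, `𝟙 ↦ 𝟙`. [cite: HeinEtAl2006GraphStates,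
Proposition 2 (the local Clifford unitary of the LC-rule); GuhneTothHyllusBriegel2005, Lemma 4 (proof)] -/
theorem xRoot_conj (P : Pauli) : xRoot * P.mat * xRootᴴ = (xConjSgn P : ℂ) • (xConjPerm P).mat := by
  rw [xRoot_eq_smul, smul_conj, c_mul_c_lc]
  ext b b'
  cases P <;> cases b <;> cases b' <;>
    norm_num [xConjSgn, xConjPerm, Matrix.mul_apply, Fintype.sum_bool, Matrix.conjTranspose_apply, Complex.ext_iff]

omit G [DecidableRel G.Adj] a in
/-- **Conjugation table of `e^{iπ/4σ_z}`**: `X ↦ −Y`, `Y ↦ X`, `Z ↦ Z`, `𝟙 ↦ 𝟙`. [cite: HeinEtAl2006GraphStates,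
Proposition 2; GuhneTothHyllusBriegel2005, Lemma 4 (proof)] -/
theorem zRoot_conj (P : Pauli) : zRoot * P.mat * zRootᴴ = (zConjSgn P : ℂ) • (zConjPerm P).mat := by
  rw [zRoot_eq_smul, smul_conj, c_mul_c_lc]
  ext b b'
  cases P <;> cases b <;> cases b' <;>
    norm_num [zConjSgn, zConjPerm, Matrix.mul_apply, Fintype.sum_bool, Matrix.conjTranspose_apply, Complex.ext_iff]

/-- **The letters of `U_a^τ(G)` conjugate Pauli letters into signed Pauli letters**:
`L_j σ L_j† = lcSgn_j(σ)·lcPerm_j(σ)`. [cite: GuhneTothHyllusBriegel2005, Lemma 4 (proof: “the local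
complementation maps Pauli matrices to Pauli matrices on each qubit”); HeinEtAl2006GraphStates, Proposition 2] -/
theorem lcLetter_conj (j : Fin N) (P : Pauli) :
    lcLetter G a j * P.mat * (lcLetter G a j)ᴴ = (lcSgn G a j P : ℂ) • (lcPerm G a j P).mat := by
  unfold lcLetter lcSgn lcPerm
  by_cases hj : j = a
  · simp only [hj, if_true]
    exact xRoot_conj P
  · simp only [hj, if_false]
    by_cases hadj : G.Adj a j
    · simp only [hadj, if_true]
      exact zRoot_conj P
    · simp only [hadj, if_false, Matrix.one_mul, Matrix.conjTranspose_one, Matrix.mul_one, Int.cast_one, one_smul]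

omit G [DecidableRel G.Adj] a in
/-- Slotwise scalars come out of a tensor product: `⊗_j (s_j A_j) = (Π_j s_j)·⊗_j A_j`. [folklore] -/
private theorem tensorAll_smul_each' (s : Fin N → ℂ) (A : Fin N → Matrix Bool Bool ℂ) :
    tensorAll (fun j => s j • A j) = (∏ j, s j) • tensorAll A := by
  ext x y
  simp only [tensorAll_apply, Matrix.smul_apply, smul_eq_mul]
  exact Finset.prod_mul_distrib

omit G [DecidableRel G.Adj] a in
/-- A Pauli word is the `tensorAll` of its letters. [folklore] -/
private theorem pauliWord_eq_tensorAll' (w : Fin N → Pauli) : pauliWord w = tensorAll fun j => (w j).mat := rfl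

/-- **`U_a^τ(G) (⊗_jσ_j) U_a^τ(G)† = (Π_j lcSgn_j(σ_j)) · ⊗_j lcPerm_j(σ_j)`**: the LC-unitary maps every
Pauli word to a signed Pauli word, letter by letter. [cite: GuhneTothHyllusBriegel2005, Lemma 4 (proof);
HeinEtAl2006GraphStates, Proposition 2] -/
theorem lcUnitary_conj_pauliWord (w : Fin N → Pauli) :
    lcUnitary G a * pauliWord w * (lcUnitary G a)ᴴ =
      (∏ j, (lcSgn G a j (w j) : ℂ)) • pauliWord (fun j => lcPerm G a j (w j)) := by
  rw [pauliWord_eq_tensorAll', pauliWord_eq_tensorAll', lcUnitary, conjTranspose_tensorAll, tensorAll_mul,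
    tensorAll_mul, ← tensorAll_smul_each']
  congr 1
  funext j
  exact lcLetter_conj G a j (w j)

/-- **The pattern map `ξ ↦ ξ'` of the local complementation**: the stabilizer element `Π_{k∈ξ}K_k(G)` is
carried by `U_a^τ(G)` to the element of `𝒮(τ_a G)` with `X`-support `ξ'`, where `ξ'_a = ξ_a ⊕ (Γξ)_a` and
`ξ'_j = ξ_j` for `j ≠ a` (at `a` the letters `Y ↔ Z` are exchanged, so the `X`-support changes exactly when
the letter at `a` is `Y` or `Z`). [cite: GuhneTothHyllusBriegel2005, Lemma 4 (proof); HeinEtAl2006GraphStates,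
Proposition 2] -/
def lcPat (ξ : Fin N → Bool) : Fin N → Bool := fun j => if j = a then Bool.xor (ξ a) (stabZ G ξ a) else ξ j

/-- Off the centre `ξ' = ξ`. [cite: GuhneTothHyllusBriegel2005, Lemma 4] -/
theorem lcPat_of_ne (ξ : Fin N → Bool) {j : Fin N} (hj : j ≠ a) : lcPat G a ξ j = ξ j := by
  simp [lcPat, hj]

/-- At the centre `ξ'_a = ξ_a ⊕ (Γξ)_a`. [cite: GuhneTothHyllusBriegel2005, Lemma 4] -/
theorem lcPat_center (ξ : Fin N → Bool) : lcPat G a ξ a = Bool.xor (ξ a) (stabZ G ξ a) := by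
  simp [lcPat]

/-- `(Γξ')_a = (Γξ)_a` (the neighbourhood of `a` avoids `a`). [cite: GuhneTothHyllusBriegel2005, Lemma 4] -/
theorem nbrParity_lcPat_center (ξ : Fin N → Bool) : nbrParity G (lcPat G a ξ) a = nbrParity G ξ a := by
  unfold nbrParity
  refine Finset.sum_congr rfl fun l hl => ?_
  rw [SimpleGraph.mem_neighborFinset] at hl
  rw [lcPat_of_ne G a ξ (G.ne_of_adj hl).symm]

/-- `stabZ` at the centre is unchanged by `ξ ↦ ξ'`. [cite: GuhneTothHyllusBriegel2005, Lemma 4] -/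
theorem stabZ_lcPat_center (ξ : Fin N → Bool) : stabZ G (lcPat G a ξ) a = stabZ G ξ a := by
  unfold stabZ
  rw [nbrParity_lcPat_center]

/-- **`ξ ↦ ξ'` is an involution** (hence a bijection of the `2^N` terms). [cite: GuhneTothHyllusBriegel2005,
Lemma 4] -/
theorem lcPat_lcPat (ξ : Fin N → Bool) : lcPat G a (lcPat G a ξ) = ξ := by
  funext j
  by_cases hj : j = a
  · subst hj
    rw [lcPat_center, stabZ_lcPat_center, lcPat_center]
    cases ξ j <;> cases stabZ G ξ j <;> rfl
  · rw [lcPat_of_ne G a _ hj, lcPat_of_ne G a _ hj]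

/-- The `X`-support of the permuted word `(lcPerm_j(σ^{(j)}_ξ))_j` is `ξ'`. [cite: GuhneTothHyllusBriegel2005,
Lemma 4 (proof)] -/
theorem xPart_lcPermWord (ξ : Fin N → Bool) :
    xPart (fun j => lcPerm G a j (stabWord G ξ j)) = lcPat G a ξ := by
  funext j
  simp only [xPart, lcPerm, lcPat, stabWord_eq_letter]
  by_cases hj : j = a
  · subst hj
    simp only [if_true]
    unfold letter xConjPerm
    cases ξ j <;> cases stabZ G ξ j <;> decide
  · simp only [hj, if_false]
    by_cases hadj : G.Adj a j
    · simp only [hadj, if_true]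
      unfold letter zConjPerm
      cases ξ j <;> cases stabZ G ξ j <;> decide
    · simp only [hadj, if_false]
      unfold letter
      cases ξ j <;> cases stabZ G ξ j <;> decide

/-- **`U s_ξ U† = (c(ξ)·Π_j lcSgn_j) · ⊗_j lcPerm_j(σ^{(j)}_ξ)`**. [cite: GuhneTothHyllusBriegel2005, Lemma 4 (proof:
“it transforms on each qubit Pauli matrices into Pauli matrices”)] -/
theorem conj_bellTerm_eq (ξ : Fin N → Bool) :
    lcUnitary G a * bellTerm G ξ * (lcUnitary G a)ᴴ =
      ((stabSign G ξ : ℂ) * ∏ j, (lcSgn G a j (stabWord G ξ j) : ℂ)) •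
        pauliWord (fun j => lcPerm G a j (stabWord G ξ j)) := by
  rw [bellTerm, Matrix.mul_smul, Matrix.smul_mul, lcUnitary_conj_pauliWord, smul_smul]

/-- **`U s_ξ U†` stabilises `|τ_a(G)⟩`** (because `s_ξ|G⟩ = |G⟩` and `|τ_a(G)⟩ ∝ U|G⟩`).
[cite: GuhneTothHyllusBriegel2005, Lemma 4 (proof); HeinEtAl2006GraphStates, Proposition 2
(`|τ_a(G)⟩ = U_a^τ(G)|G⟩`)] -/
theorem conj_bellTerm_mulVec (ξ : Fin N → Bool) :
    (lcUnitary G a * bellTerm G ξ * (lcUnitary G a)ᴴ) *ᵥ graphStateVec (localComplement G a) =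
      graphStateVec (localComplement G a) := by
  rw [graphStateVec_localComplement_eq G a, Matrix.mulVec_smul, Matrix.mulVec_mulVec, Matrix.mul_assoc,
    lcUnitary_conjTranspose_mul, Matrix.mul_one, ← Matrix.mulVec_mulVec, bellTerm_mulVec_graphStateVec]

omit G [DecidableRel G.Adj] a in
/-- A bit equals the parity test of the `𝔽₂` element it encodes. [folklore] -/
private theorem eq_decide_of_bitZ_eq {b : Bool} {p : ZMod 2} (h : bitZ b = p) : b = decide (p = 1) := by
  revert b p
  decide

omit G [DecidableRel G.Adj] a in
/-- A Pauli letter is determined by its `X`-bit and `Z`-bit. [cite: HeinEisertBriegel2004, §2 (binary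
representation)] -/
private theorem eq_letter_parts (P : Pauli) :
    P = letter (decide (P = Pauli.X ∨ P = Pauli.Y)) (decide (P = Pauli.Y ∨ P = Pauli.Z)) := by
  cases P <;> decide

/-- **The conjugated term is the term `ξ'` of `𝓑(τ_a G)`, word and sign**: `⊗_j lcPerm_j(σ^{(j)}_ξ)` is
the stabilizer word of `τ_a(G)` with `X`-support `ξ'`, and `c_{τ_aG}(ξ') = c_G(ξ)·Π_j lcSgn_j(σ^{(j)}_ξ)`.
Proof: `U s_ξ U†` is `±` a Pauli word and stabilises `|τ_a G⟩`; a Pauli word with non-zero graph-state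
expectation is a stabilizer word (`expect_pauliWord`), and the sign of a stabilizing signed word is unique.
[cite: GuhneTothHyllusBriegel2005, Lemma 4 (proof); HeinEtAl2006GraphStates, Proposition 2] -/
theorem stabWord_stabSign_localComplement (ξ : Fin N → Bool) :
    stabWord (localComplement G a) (lcPat G a ξ) = (fun j => lcPerm G a j (stabWord G ξ j)) ∧
      stabSign (localComplement G a) (lcPat G a ξ) = stabSign G ξ * ∏ j, lcSgn G a j (stabWord G ξ j) := by
  set w'' : Fin N → Pauli := fun j => lcPerm G a j (stabWord G ξ j) with hw''
  set σ : ℂ := (stabSign G ξ : ℂ) * ∏ j, (lcSgn G a j (stabWord G ξ j) : ℂ) with hσ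
  set g' := graphStateVec (localComplement G a) with hg'
  -- `(σ • P) g' = g'`, hence `σ·⟨g'|P|g'⟩ = 1`
  have h1 : (σ • pauliWord w'') *ᵥ g' = g' := by
    rw [hσ, hw'', ← conj_bellTerm_eq]; exact conj_bellTerm_mulVec G a ξ
  have h2 : σ * (star g' ⬝ᵥ (pauliWord w'' *ᵥ g')) = 1 := by
    have := congrArg (fun v => star g' ⬝ᵥ v) h1
    simp only [Matrix.smul_mulVec, dotProduct_smul, smul_eq_mul] at this
    rw [this, hg', graphStateVec_norm]
  have h3 : star g' ⬝ᵥ (pauliWord w'' *ᵥ g') ≠ 0 := by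
    intro h0; rw [h0, mul_zero] at h2; exact zero_ne_one h2
  -- so `w''` is a stabilizer word of `τ_a(G)`: its `Z`-part is `Γ'` of its `X`-part `ξ'`
  have h4 : ∀ j, bitZ (zPart w'' j) = nbrParity (localComplement G a) (xPart w'') j := by
    by_contra hne
    rw [hg', expect_pauliWord, if_neg hne] at h3
    exact h3 rfl
  have hx : xPart w'' = lcPat G a ξ := xPart_lcPermWord G a ξ
  have h5 : stabWord (localComplement G a) (lcPat G a ξ) = w'' := by
    funext j
    rw [stabWord_eq_letter, eq_letter_parts (w'' j)]
    have hxj : decide (w'' j = Pauli.X ∨ w'' j = Pauli.Y) = lcPat G a ξ j := by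
      rw [← hx]; rfl
    have hzj : decide (w'' j = Pauli.Y ∨ w'' j = Pauli.Z) = stabZ (localComplement G a) (lcPat G a ξ) j := by
      have := eq_decide_of_bitZ_eq (h4 j)
      rw [hx] at this
      exact this
    rw [hxj, hzj]
  refine ⟨h5, ?_⟩
  -- uniqueness of the sign: `c'·⟨g'|P|g'⟩ = 1 = σ·⟨g'|P|g'⟩`
  have h6 : (stabSign (localComplement G a) (lcPat G a ξ) : ℂ) * (star g' ⬝ᵥ (pauliWord w'' *ᵥ g')) = 1 := by
    have hb := bellTerm_mulVec_graphStateVec (localComplement G a) (lcPat G a ξ)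
    rw [bellTerm, h5] at hb
    have := congrArg (fun v => star g' ⬝ᵥ v) hb
    simp only [Matrix.smul_mulVec, dotProduct_smul, smul_eq_mul] at this
    rw [hg']
    rw [hg'] at this
    rw [this, graphStateVec_norm]
  have h7 : (stabSign (localComplement G a) (lcPat G a ξ) : ℂ) = σ :=
    mul_right_cancel₀ h3 (h6.trans h2.symm)
  apply Int.cast_injective (α := ℂ)
  rw [h7, hσ]
  push_cast
  rfl

/-- **The table transformation**: `m'_j(σ) := lcSgn_j(σ)·m_j(lcPerm_j(σ))` — the “renaming of variables”
plus sign flips of Lemma 2 induced at every site by `U_a^τ(G)`. [cite: GuhneTothHyllusBriegel2005, Lemma 4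
(proof: “`𝒟` is not changed due to Lemma 2”)] -/
def lcTable (m : Fin N → Pauli → ℤ) : Fin N → Pauli → ℤ := fun j P => lcSgn G a j P * m j (lcPerm G a j P)

/-- The inverse transformation (`lcPerm_j` is an involution; the sign is read after permuting).
[cite: GuhneTothHyllusBriegel2005, Lemma 4 (proof)] -/
def lcTableInv (m : Fin N → Pauli → ℤ) : Fin N → Pauli → ℤ :=
  fun j P => lcSgn G a j (lcPerm G a j P) * m j (lcPerm G a j P)

/-- `m' ` is `±1`-valued. [cite: GuhneTothHyllusBriegel2005, Lemma 4] -/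
theorem lcTable_pm (m : Fin N → Pauli → ℤ) (hm : ∀ j P, m j P = 1 ∨ m j P = -1) (j : Fin N) (P : Pauli) :
    lcTable G a m j P = 1 ∨ lcTable G a m j P = -1 := by
  unfold lcTable
  rcases lcSgn_pm G a j P with h | h <;> rcases hm j (lcPerm G a j P) with h' | h' <;> simp [h, h']

/-- `m'(𝟙) = 1`. [cite: GuhneTothHyllusBriegel2005, Lemma 4] -/
theorem lcTable_I (m : Fin N → Pauli → ℤ) (hmI : ∀ j, m j Pauli.I = 1) (j : Fin N) :
    lcTable G a m j Pauli.I = 1 := by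
  unfold lcTable
  rw [lcSgn_I, lcPerm_I, hmI, one_mul]

/-- The inverse table is `±1`-valued. [cite: GuhneTothHyllusBriegel2005, Lemma 4] -/
theorem lcTableInv_pm (m : Fin N → Pauli → ℤ) (hm : ∀ j P, m j P = 1 ∨ m j P = -1) (j : Fin N) (P : Pauli) :
    lcTableInv G a m j P = 1 ∨ lcTableInv G a m j P = -1 := by
  unfold lcTableInv
  rcases lcSgn_pm G a j (lcPerm G a j P) with h | h <;> rcases hm j (lcPerm G a j P) with h' | h' <;> simp [h, h']

/-- The inverse table assigns `1` to `𝟙`. [cite: GuhneTothHyllusBriegel2005, Lemma 4] -/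
theorem lcTableInv_I (m : Fin N → Pauli → ℤ) (hmI : ∀ j, m j Pauli.I = 1) (j : Fin N) :
    lcTableInv G a m j Pauli.I = 1 := by
  unfold lcTableInv
  rw [lcPerm_I, lcSgn_I, hmI, one_mul]

/-- `(m⁻¹)' = m`. [cite: GuhneTothHyllusBriegel2005, Lemma 4] -/
theorem lcTable_lcTableInv (m : Fin N → Pauli → ℤ) : lcTable G a (lcTableInv G a m) = m := by
  funext j P
  unfold lcTable lcTableInv
  rw [lcPerm_lcPerm, ← mul_assoc, mul_self_of_pm (lcSgn_pm G a j P), one_mul]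

/-- Term by term: `lhv_{m'}(s_ξ(G)) = (Π_j lcSgn_j)·lhv_m(s_{ξ'}(τ_a G))`. [cite: GuhneTothHyllusBriegel2005,
Lemma 4 (proof)] -/
theorem lhvValue_lcTable (m : Fin N → Pauli → ℤ) (ξ : Fin N → Bool) :
    lhvValue (lcTable G a m) (stabWord G ξ) =
      (∏ j, lcSgn G a j (stabWord G ξ j)) * lhvValue m (stabWord (localComplement G a) (lcPat G a ξ)) := by
  rw [(stabWord_stabSign_localComplement G a ξ).1]
  unfold lhvValue lcTable
  rw [← Finset.prod_mul_distrib]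

/-- **`⟨𝓑(τ_a G)⟩_m = ⟨𝓑(G)⟩_{m'}` for every table `m`** (reindex the `2^N` terms by the involution `ξ ↦ ξ'`
and compare term by term). [cite: GuhneTothHyllusBriegel2005, Lemma 4 (proof)] -/
theorem lhvBell_localComplement (m : Fin N → Pauli → ℤ) :
    lhvBell (localComplement G a) m = lhvBell G (lcTable G a m) := by
  unfold lhvBell
  -- reindex the left-hand sum along the involution `ξ ↦ ξ'`
  have hinv : Function.Involutive (lcPat G a) := lcPat_lcPat G a
  rw [← Equiv.sum_comp hinv.toPerm]
  refine Finset.sum_congr rfl fun ξ _ => ?_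
  rw [Function.Involutive.coe_toPerm, (stabWord_stabSign_localComplement G a ξ).2, lhvValue_lcTable,
    (stabWord_stabSign_localComplement G a ξ).1]
  ring

/-- **Lemma 4 of Gühne–Tóth–Hyllus–Briegel: `𝒟(G₁) = 𝒟(G₂)` for graphs related by a local
complementation.** For every bound `C`: `|⟨𝓑(G)⟩| ≤ C` for all `±1` tables iff `|⟨𝓑(τ_a G)⟩| ≤ C` for all
`±1` tables (so `𝒞(G) = 𝒞(τ_a G)`). [cite: GuhneTothHyllusBriegel2005, Lemma 4 (“Let `G_1` be a graph and
`G_2` be a graph which arises from `G_1` by local complementation. Then `𝒟(G_1) = 𝒟(G_2)`.”)] -/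
theorem forall_abs_lhvBell_localComplement_le_iff (C : ℤ) :
    (∀ m : Fin N → Pauli → ℤ, (∀ j P, m j P = 1 ∨ m j P = -1) → (∀ j, m j Pauli.I = 1) → |lhvBell G m| ≤ C) ↔
      (∀ m : Fin N → Pauli → ℤ, (∀ j P, m j P = 1 ∨ m j P = -1) → (∀ j, m j Pauli.I = 1) →
        |lhvBell (localComplement G a) m| ≤ C) := by
  constructor
  · intro h m hm hmI
    rw [lhvBell_localComplement]
    exact h _ (lcTable_pm G a m hm) (lcTable_I G a m hmI)
  · intro h m hm hmI
    have key := h (lcTableInv G a m) (lcTableInv_pm G a m hm) (lcTableInv_I G a m hmI)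
    rwa [lhvBell_localComplement, lcTable_lcTableInv] at key

end LemmaFour
section LemmaFourStar

variable {N : ℕ}

/-- Transport of `⟨𝓑(G)⟩_{LHV}` along an equality of graphs (the decidability instances are subsingletons).
[folklore] -/
private theorem lhvBell_congr {H₁ H₂ : SimpleGraph (Fin N)} (i₁ : DecidableRel H₁.Adj) (i₂ : DecidableRel H₂.Adj)
    (h : H₁ = H₂) (m : Fin N → Pauli → ℤ) : @lhvBell N H₁ i₁ m = @lhvBell N H₂ i₂ m := by
  subst h
  have hi : i₁ = i₂ := Subsingleton.elim _ _
  subst hi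
  rfl

/-- **“Due to Lemma 4, the values `𝒟(ST_n)` and `𝒟(FC_n)` always coincide”**: the star graph (GHZ state)
and the complete graph have the same LHV bound for every `n`, since `τ_a(ST_n) = FC_n` for the centre `a`
(`localComplement_starGraph`). [cite: GuhneTothHyllusBriegel2005, Lemma 4 and p. 4 (“Due to Lemma 4, the
values `𝒟(ST_n)` and `𝒟(FC_n)` always coincide”); p. 3 (“the graph `ST_n` can be transformed by a local
complementation on the central qubit into the graph `FC_n`”)] -/
theorem forall_abs_lhvBell_starGraph_le_iff_top (v : Fin N) (C : ℤ) :
    (∀ m : Fin N → Pauli → ℤ, (∀ j P, m j P = 1 ∨ m j P = -1) → (∀ j, m j Pauli.I = 1) →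
        |lhvBell (SimpleGraph.starGraph v) m| ≤ C) ↔
      (∀ m : Fin N → Pauli → ℤ, (∀ j P, m j P = 1 ∨ m j P = -1) → (∀ j, m j Pauli.I = 1) →
        |lhvBell (⊤ : SimpleGraph (Fin N)) m| ≤ C) := by
  rw [forall_abs_lhvBell_localComplement_le_iff (SimpleGraph.starGraph v) v C]
  have key : ∀ m : Fin N → Pauli → ℤ,
      lhvBell (localComplement (SimpleGraph.starGraph v) v) m = lhvBell (⊤ : SimpleGraph (Fin N)) m :=
    fun m => lhvBell_congr _ _ (localComplement_starGraph v) m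
  constructor
  · intro h m hm hmI
    rw [← key m]
    exact h m hm hmI
  · intro h m hm hmI
    rw [key m]
    exact h m hm hmI

end LemmaFourStar

/-! ### Fully separable states obey the Bell inequality: `𝒟(G) ≥ max_{|a⟩|b⟩…|n⟩} |⟨a,b,…,n|G⟩|²` -/

section GeometricMeasure

variable {N : ℕ} (G : SimpleGraph (Fin N)) [DecidableRel G.Adj]

open SpinSqueezing

/-- **The value of `𝓑(G)` under a REAL-valued table** `r_j(σ) ∈ [−1, 1]` (a stochastic LHV model given by its
single-site means, or a product state given by its Bloch components): `Σ_ξ c(ξ)·Π_j r_j(σ^{(j)}_ξ)`.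
[cite: GuhneTothHyllusBriegel2005, eq. (7) and the remark after it (“nondeterministic LHV models can be viewed as
deterministic LHV models where the hidden variables are not known”); p. 4 (“all fully separable states … admit a
LHV description”)] -/
def lhvBellR (r : Fin N → Pauli → ℝ) : ℝ := ∑ ξ : Fin N → Bool, (stabSign G ξ : ℝ) * ∏ j, r j (stabWord G ξ j)

/-- On `±1` tables the real value is the integer value. [cite: GuhneTothHyllusBriegel2005, eq. (7)] -/
theorem lhvBellR_intCast (m : Fin N → Pauli → ℤ) : lhvBellR G (fun j P => (m j P : ℝ)) = (lhvBell G m : ℝ) := by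
  unfold lhvBellR lhvBell lhvValue
  push_cast
  rfl

/-- The coefficient of `r_v(P)`: the terms whose letter at `v` is `P`, evaluated off `v`.
[cite: GuhneTothHyllusBriegel2005, eq. (7) (the mean value is linear in each single observable's value)] -/
def coeffAt (r : Fin N → Pauli → ℝ) (v : Fin N) (P : Pauli) : ℝ :=
  ∑ ξ ∈ Finset.univ.filter (fun ξ => stabWord G ξ v = P), (stabSign G ξ : ℝ) * ∏ j ∈ Finset.univ.erase v, r j (stabWord G ξ j)

/-- **`⟨𝓑⟩_r` is affine in the values at one site**: `⟨𝓑⟩_r = Σ_P A_P · r_v(P)`. [cite: GuhneTothHyllusBriegel2005,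
eq. (7)] -/
theorem lhvBellR_eq_sum_coeffAt (r : Fin N → Pauli → ℝ) (v : Fin N) :
    lhvBellR G r = ∑ P : Pauli, coeffAt G r v P * r v P := by
  unfold lhvBellR coeffAt
  rw [← Finset.sum_fiberwise Finset.univ (fun ξ => stabWord G ξ v) _]
  refine Finset.sum_congr rfl fun P _ => ?_
  rw [Finset.sum_mul]
  refine Finset.sum_congr rfl fun ξ hξ => ?_
  rw [← (Finset.mem_filter.mp hξ).2, ← Finset.mul_prod_erase Finset.univ (fun j => r j (stabWord G ξ j))
    (Finset.mem_univ v)]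
  ring

/-- The coefficients do not see the values at `v`. [cite: GuhneTothHyllusBriegel2005, eq. (7)] -/
theorem coeffAt_update (r : Fin N → Pauli → ℝ) (v : Fin N) (s : Pauli → ℝ) (P : Pauli) :
    coeffAt G (Function.update r v s) v P = coeffAt G r v P := by
  unfold coeffAt
  refine Finset.sum_congr rfl fun ξ _ => ?_
  congr 1
  exact Finset.prod_congr rfl fun j hj => by rw [Function.update_of_ne (Finset.ne_of_mem_erase hj)]

omit G [DecidableRel G.Adj] in
/-- A sign function with `σ(w)·w = |w|` and `σ(w) ∈ {±1}`. [folklore] -/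
private theorem sgn_aux (w : ℝ) :
    (if 0 ≤ w then (1 : ℝ) else -1) * w = |w| ∧
      ((if 0 ≤ w then (1 : ℝ) else -1) = 1 ∨ (if 0 ≤ w then (1 : ℝ) else -1) = -1) := by
  by_cases h : 0 ≤ w
  · rw [if_pos h, abs_of_nonneg h, one_mul]; exact ⟨rfl, Or.inl rfl⟩
  · rw [if_neg h, abs_of_neg (lt_of_not_ge h)]; exact ⟨by ring, Or.inr rfl⟩

omit G [DecidableRel G.Adj] in
/-- **Vertices of the cube suffice**: for `|x|, |y|, |z| ≤ 1` there are signs `s, t, u ∈ {±1}` with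
`|a + bx + cy + dz| ≤ |a + bs + ct + du|` (an affine function on `[−1,1]³` is maximised in absolute value at a
vertex). [cite: GuhneTothHyllusBriegel2005, after eq. (7) (“it suffices to look at deterministic LHV models which
have to assign definite values `{+1,−1}` … nondeterministic LHV models can be viewed as deterministic LHV
models where the hidden variables are not known”)] -/
theorem exists_vertex_ge (a b c d x y z : ℝ) (hx : |x| ≤ 1) (hy : |y| ≤ 1) (hz : |z| ≤ 1) :
    ∃ s t u : ℝ, (s = 1 ∨ s = -1) ∧ (t = 1 ∨ t = -1) ∧ (u = 1 ∨ u = -1) ∧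
      |a + b * x + c * y + d * z| ≤ |a + b * s + c * t + d * u| := by
  set σ : ℝ → ℝ := fun w => if 0 ≤ w then 1 else -1 with hσ
  obtain ⟨ha, ha'⟩ := sgn_aux a
  obtain ⟨hb, hb'⟩ := sgn_aux b
  obtain ⟨hc, hc'⟩ := sgn_aux c
  obtain ⟨hd, hd'⟩ := sgn_aux d
  have haa : σ a * σ a = 1 := by rcases ha' with h | h <;> simp only [hσ] at h ⊢ <;> rw [h] <;> norm_num
  refine ⟨σ a * σ b, σ a * σ c, σ a * σ d, ?_, ?_, ?_, ?_⟩
  · rcases ha' with h1 | h1 <;> rcases hb' with h2 | h2 <;> simp only [hσ] at h1 h2 ⊢ <;> rw [h1, h2] <;> norm_num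
  · rcases ha' with h1 | h1 <;> rcases hc' with h2 | h2 <;> simp only [hσ] at h1 h2 ⊢ <;> rw [h1, h2] <;> norm_num
  · rcases ha' with h1 | h1 <;> rcases hd' with h2 | h2 <;> simp only [hσ] at h1 h2 ⊢ <;> rw [h1, h2] <;> norm_num
  · -- the vertex value is `σ(a)·(|a| + |b| + |c| + |d|)`
    have hval : a + b * (σ a * σ b) + c * (σ a * σ c) + d * (σ a * σ d) = σ a * (|a| + |b| + |c| + |d|) := by
      have e1 : a = σ a * (σ a * a) := by rw [← mul_assoc, haa, one_mul]
      rw [← ha, ← hb, ← hc, ← hd]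
      simp only [hσ] at e1 ⊢
      linear_combination e1
    have habs : |σ a| = 1 := by rcases ha' with h | h <;> simp only [hσ] at h ⊢ <;> rw [h] <;> norm_num
    rw [hval, abs_mul, habs, one_mul]
    have h0 : 0 ≤ |a| + |b| + |c| + |d| := by positivity
    rw [abs_of_nonneg h0]
    calc |a + b * x + c * y + d * z| ≤ |a| + |b * x| + |c * y| + |d * z| := by
          have := abs_add_le (a + b * x + c * y) (d * z)
          have := abs_add_le (a + b * x) (c * y)
          have := abs_add_le a (b * x)
          linarith
      _ ≤ |a| + |b| + |c| + |d| := by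
          rw [abs_mul, abs_mul, abs_mul]
          have := mul_le_of_le_one_right (abs_nonneg b) hx
          have := mul_le_of_le_one_right (abs_nonneg c) hy
          have := mul_le_of_le_one_right (abs_nonneg d) hz
          linarith

/-- **One site at a time**: the values at a site `v` can be replaced by signs `±1` (keeping `𝟙 ↦ 1`) without
decreasing `|⟨𝓑⟩|`. [cite: GuhneTothHyllusBriegel2005, after eq. (7)] -/
theorem exists_update_signs (r : Fin N → Pauli → ℝ) (hr : ∀ j P, |r j P| ≤ 1) (hrI : ∀ j, r j Pauli.I = 1)
    (v : Fin N) :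
    ∃ s : Pauli → ℝ, s Pauli.I = 1 ∧ (∀ P, s P = 1 ∨ s P = -1) ∧
      |lhvBellR G r| ≤ |lhvBellR G (Function.update r v s)| := by
  obtain ⟨sx, sy, sz, hsx, hsy, hsz, hle⟩ := exists_vertex_ge (coeffAt G r v Pauli.I) (coeffAt G r v Pauli.X)
    (coeffAt G r v Pauli.Y) (coeffAt G r v Pauli.Z) (r v Pauli.X) (r v Pauli.Y) (r v Pauli.Z)
    (hr v _) (hr v _) (hr v _)
  let s : Pauli → ℝ := fun P => match P with
    | Pauli.I => 1 | Pauli.X => sx | Pauli.Y => sy | Pauli.Z => sz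
  refine ⟨s, rfl, fun P => by cases P <;> simp [s, hsx, hsy, hsz], ?_⟩
  rw [lhvBellR_eq_sum_coeffAt G r v, lhvBellR_eq_sum_coeffAt G (Function.update r v s) v, Pauli.sum_univ,
    Pauli.sum_univ]
  simp only [coeffAt_update, Function.update_self, hrI v]
  simpa [s] using hle

/-- **Every `[−1,1]`-valued table is dominated by a `±1` table**: `|⟨𝓑(G)⟩_r| ≤ |⟨𝓑(G)⟩_m|` for some
deterministic `m` (site-by-site replacement along the register). [cite: GuhneTothHyllusBriegel2005, after eq. (7)
(“nondeterministic LHV models can be viewed as deterministic LHV models where the hidden variables are not known”)] -/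
theorem exists_pm_table_ge (r : Fin N → Pauli → ℝ) (hr : ∀ j P, |r j P| ≤ 1) (hrI : ∀ j, r j Pauli.I = 1) :
    ∃ m : Fin N → Pauli → ℤ, (∀ j P, m j P = 1 ∨ m j P = -1) ∧ (∀ j, m j Pauli.I = 1) ∧
      |lhvBellR G r| ≤ |(lhvBell G m : ℝ)| := by
  -- replace the sites along a list
  have aux : ∀ L : List (Fin N), ∀ r : Fin N → Pauli → ℝ, (∀ j P, |r j P| ≤ 1) → (∀ j, r j Pauli.I = 1) →
      ∃ r' : Fin N → Pauli → ℝ, (∀ j P, |r' j P| ≤ 1) ∧ (∀ j, r' j Pauli.I = 1) ∧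
        (∀ v ∈ L, ∀ P, r' v P = 1 ∨ r' v P = -1) ∧ |lhvBellR G r| ≤ |lhvBellR G r'| := by
    intro L
    induction L with
    | nil => intro r hr hrI; exact ⟨r, hr, hrI, fun v hv => absurd hv List.not_mem_nil, le_rfl⟩
    | cons v L ih =>
      intro r hr hrI
      obtain ⟨r₁, hr₁, hr₁I, hr₁L, hle₁⟩ := ih r hr hrI
      obtain ⟨s, hsI, hs, hle₂⟩ := exists_update_signs G r₁ hr₁ hr₁I v
      refine ⟨Function.update r₁ v s, fun j P => ?_, fun j => ?_, fun w hw P => ?_, hle₁.trans hle₂⟩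
      · by_cases hj : j = v
        · subst hj; rw [Function.update_self]; rcases hs P with h | h <;> rw [h] <;> norm_num
        · rw [Function.update_of_ne hj]; exact hr₁ j P
      · by_cases hj : j = v
        · subst hj; rw [Function.update_self]; exact hsI
        · rw [Function.update_of_ne hj]; exact hr₁I j
      · rcases List.mem_cons.mp hw with rfl | hw'
        · rw [Function.update_self]; exact hs P
        · by_cases hj : w = v
          · subst hj; rw [Function.update_self]; exact hs P
          · rw [Function.update_of_ne hj]; exact hr₁L w hw' P
  obtain ⟨r', -, hr'I, hr'pm, hle⟩ := aux (List.finRange N) r hr hrI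
  let m : Fin N → Pauli → ℤ := fun j P => if r' j P = 1 then 1 else -1
  have hm : ∀ j P, (m j P : ℝ) = r' j P := by
    intro j P
    rcases hr'pm j (List.mem_finRange j) P with h | h
    · simp [m, h]
    · simp only [m, h]; norm_num
  refine ⟨m, fun j P => by simp only [m]; split_ifs <;> simp, fun j => by simp [m, hr'I j], ?_⟩
  rw [← lhvBellR_intCast]
  have hfun : (fun j P => (m j P : ℝ)) = r' := funext fun j => funext fun P => hm j P
  rw [hfun]
  exact hle

/-- For a unit qubit vector every Bloch component is at most `1` in absolute value (`x² + y² + z² = 1`) and the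
`𝟙`-component is `⟨φ|φ⟩ = 1`. [cite: GuhneToth2009, §8.1.1] -/
theorem abs_bloch_le_one (φ : Bool → ℂ) (hφ : star φ ⬝ᵥ φ = 1) (P : Pauli) : |bloch P φ| ≤ 1 := by
  have hs := bloch_sq_sum φ hφ
  cases P with
  | I =>
    have : bloch Pauli.I φ = 1 := by
      rw [bloch, Pauli.mat, Matrix.one_mulVec, hφ, Complex.one_re]
    rw [this, abs_one]
  | X => exact abs_le_one_iff_mul_self_le_one.mpr (by nlinarith [sq_nonneg (bloch Pauli.Y φ), sq_nonneg (bloch Pauli.Z φ)])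
  | Y => exact abs_le_one_iff_mul_self_le_one.mpr (by nlinarith [sq_nonneg (bloch Pauli.X φ), sq_nonneg (bloch Pauli.Z φ)])
  | Z => exact abs_le_one_iff_mul_self_le_one.mpr (by nlinarith [sq_nonneg (bloch Pauli.X φ), sq_nonneg (bloch Pauli.Y φ)])

/-- `⟨φ|𝟙|φ⟩ = 1` as a Bloch component. [cite: GuhneToth2009, §8.1.1] -/
theorem bloch_I (φ : Bool → ℂ) (hφ : star φ ⬝ᵥ φ = 1) : bloch Pauli.I φ = 1 := by
  rw [bloch, Pauli.mat, Matrix.one_mulVec, hφ, Complex.one_re]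

/-- **A product state evaluates `s_ξ` like an LHV table with real entries**: `⟨⊗φ|s_ξ|⊗φ⟩ = c(ξ)·Π_j ⟨φ_j|σ^{(j)}_ξ|φ_j⟩`.
[cite: GuhneTothHyllusBriegel2005, p. 4 (“all fully separable states `|ψ⟩ = |a⟩|b⟩…|n⟩` admit a LHV description”)] -/
theorem expect_bellTerm_productVec (φ : Fin N → Bool → ℂ) (ξ : Fin N → Bool) :
    star (productVec φ) ⬝ᵥ (bellTerm G ξ *ᵥ productVec φ) =
      (((stabSign G ξ : ℝ) * ∏ j, bloch (stabWord G ξ j) (φ j) : ℝ) : ℂ) := by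
  rw [bellTerm, Matrix.smul_mulVec, dotProduct_smul, smul_eq_mul]
  have h : star (productVec φ) ⬝ᵥ (pauliWord (stabWord G ξ) *ᵥ productVec φ) =
      ∏ j, (bloch (stabWord G ξ j) (φ j) : ℂ) := by
    have := ProductState.expect_tensorAll_productState (fun j => (stabWord G ξ j).mat) φ
    simp only [star_dotProduct_pauli_mulVec] at this
    exact this
  rw [h]
  push_cast
  rfl

/-- **`⟨⊗φ|𝓑(G)|⊗φ⟩ = ⟨𝓑(G)⟩_r` with `r_j(σ) = ⟨φ_j|σ|φ_j⟩`** (the Bloch components as a real table).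
[cite: GuhneTothHyllusBriegel2005, p. 4] -/
theorem expect_bellOperator_productVec (φ : Fin N → Bool → ℂ) :
    star (productVec φ) ⬝ᵥ ((∑ ξ : Fin N → Bool, bellTerm G ξ) *ᵥ productVec φ) =
      (lhvBellR G (fun j P => bloch P (φ j)) : ℂ) := by
  rw [Matrix.sum_mulVec, dotProduct_sum, lhvBellR]
  push_cast
  exact Finset.sum_congr rfl fun ξ _ => by rw [expect_bellTerm_productVec]; push_cast; rfl

/-- **“Since all fully separable states admit a LHV description, `𝒟(G) ≥ max_{|a⟩|b⟩…|n⟩} |⟨a,b,…,n|G⟩|²` has to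
hold”**: if `|⟨𝓑(G)⟩_{LHV}| ≤ C` for every `±1` table, then every product of unit qubit vectors `⊗_jφ_j` has
`2^N·|⟨G|⊗φ⟩|² ≤ C`, because `⟨⊗φ|𝓑(G)|⊗φ⟩ = 2^N|⟨G|⊗φ⟩|²` (`expect_bellOperator_vec`) is the value of `𝓑` under
the `[−1,1]`-valued table of Bloch components, which is dominated by a `±1` table. Hence the bounds on `𝒞` are
lower bounds `1 − 𝒟(G)` for the geometric measure `1 − max|⟨a,b,…,n|G⟩|²`. [cite: GuhneTothHyllusBriegel2005, p. 4] -/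
theorem two_pow_mul_normSq_productVec_le (C : ℤ)
    (hC : ∀ m : Fin N → Pauli → ℤ, (∀ j P, m j P = 1 ∨ m j P = -1) → (∀ j, m j Pauli.I = 1) → |lhvBell G m| ≤ C)
    (φ : Fin N → Bool → ℂ) (hφ : ∀ j, star (φ j) ⬝ᵥ φ j = 1) :
    2 ^ N * Complex.normSq (star (graphStateVec G) ⬝ᵥ productVec φ) ≤ C := by
  set r : Fin N → Pauli → ℝ := fun j P => bloch P (φ j) with hr
  have hval : (2 : ℝ) ^ N * Complex.normSq (star (graphStateVec G) ⬝ᵥ productVec φ) = lhvBellR G r := by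
    have h1 := expect_bellOperator_vec G (productVec φ)
    rw [expect_bellOperator_productVec] at h1
    have h2 : ((lhvBellR G r : ℝ) : ℂ) = (((2 : ℝ) ^ N * Complex.normSq (star (graphStateVec G) ⬝ᵥ productVec φ) : ℝ) : ℂ) := by
      rw [hr, h1]; push_cast; rfl
    exact (Complex.ofReal_injective h2).symm
  obtain ⟨m, hm, hmI, hle⟩ := exists_pm_table_ge G r (fun j P => abs_bloch_le_one (φ j) (hφ j) P)
    (fun j => bloch_I (φ j) (hφ j))
  have hCm : |(lhvBell G m : ℝ)| ≤ C := by exact_mod_cast hC m hm hmI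
  calc (2 : ℝ) ^ N * Complex.normSq (star (graphStateVec G) ⬝ᵥ productVec φ) = lhvBellR G r := hval
    _ ≤ |lhvBellR G r| := le_abs_self _
    _ ≤ |(lhvBell G m : ℝ)| := hle
    _ ≤ C := hCm

/-- The same in the normalised form `|⟨a,b,…,n|G⟩|² ≤ 𝒟(G) = C/2^N`. [cite: GuhneTothHyllusBriegel2005, p. 4] -/
theorem normSq_productVec_le_dd (C : ℤ)
    (hC : ∀ m : Fin N → Pauli → ℤ, (∀ j P, m j P = 1 ∨ m j P = -1) → (∀ j, m j Pauli.I = 1) → |lhvBell G m| ≤ C)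
    (φ : Fin N → Bool → ℂ) (hφ : ∀ j, star (φ j) ⬝ᵥ φ j = 1) :
    Complex.normSq (star (graphStateVec G) ⬝ᵥ productVec φ) ≤ C / 2 ^ N := by
  rw [le_div_iff₀ (by positivity), mul_comm]
  exact two_pow_mul_normSq_productVec_le G C hC φ hφ

omit G [DecidableRel G.Adj] in
/-- **Linear clusters**: every product of unit qubit vectors has `|⟨⊗φ|LC_{4k}⟩|² ≤ (3/4)^k`, so the geometric
measure of the `4k`-qubit linear cluster state is at least `1 − (3/4)^k` (Theorem 2's bound `𝒟(LC_{4k}) ≤ (3/4)^k`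
fed into the separable-state bound). [cite: GuhneTothHyllusBriegel2005, p. 4 (“our bounds on `𝒞` also deliver lower
bounds for this measure of entanglement for graph states”) and Theorem 2] -/
theorem normSq_productVec_linearCluster_le (k : ℕ) (φ : Fin (4 * k) → Bool → ℂ) (hφ : ∀ j, star (φ j) ⬝ᵥ φ j = 1) :
    Complex.normSq (star (graphStateVec (linearCluster (4 * k))) ⬝ᵥ productVec φ) ≤ (3 / 4 : ℝ) ^ k := by
  have h := normSq_productVec_le_dd (linearCluster (4 * k)) (12 ^ k)
    (fun m hm hmI => abs_lhvBell_linearCluster_mul_four_le k m hm hmI) φ hφ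
  calc Complex.normSq (star (graphStateVec (linearCluster (4 * k))) ⬝ᵥ productVec φ)
      ≤ ((12 ^ k : ℤ) : ℝ) / 2 ^ (4 * k) := h
    _ = (3 / 4 : ℝ) ^ k := by
        push_cast
        rw [pow_mul, ← div_pow]
        norm_num

end GeometricMeasure

/-! ### Stochastic LHV models and `𝒟(ST_n) ≥ 1/2` -/

section StarGraphGeometric

variable {N : ℕ} (G : SimpleGraph (Fin N)) [DecidableRel G.Adj]

open SpinSqueezing
open Literature.Computability.QuantumComplexity.ProductState

/-- **The LHV bound holds for stochastic models as well**: if `|⟨𝓑(G)⟩| ≤ C` for every deterministic `±1`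
table, then `|⟨𝓑(G)⟩_r| ≤ C` for every `[−1,1]`-valued table `r` with `r(𝟙) = 1` (single-site means of a
nondeterministic model). [cite: GuhneTothHyllusBriegel2005, after eq. (7) (“It suffices to look at deterministic
LHV models … nondeterministic LHV models can be viewed as deterministic LHV models where the hidden variables are
not known”)] -/
theorem abs_lhvBellR_le (C : ℤ)
    (hC : ∀ m : Fin N → Pauli → ℤ, (∀ j P, m j P = 1 ∨ m j P = -1) → (∀ j, m j Pauli.I = 1) → |lhvBell G m| ≤ C)
    (r : Fin N → Pauli → ℝ) (hr : ∀ j P, |r j P| ≤ 1) (hrI : ∀ j, r j Pauli.I = 1) :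
    |lhvBellR G r| ≤ C := by
  obtain ⟨m, hm, hmI, hle⟩ := exists_pm_table_ge G r hr hrI
  refine hle.trans ?_
  rw [← Int.cast_abs]
  exact_mod_cast hC m hm hmI

omit G [DecidableRel G.Adj] in
/-- `SpinSqueezing.productVec` and `ProductState.productState` are the same product vector `⊗_j φ_j`.
[folklore] -/
private theorem productVec_eq_productState (φ : Fin N → Bool → ℂ) : productVec φ = productState φ := rfl

omit G [DecidableRel G.Adj] in
/-- The slots of the product branches `|s⟩_a ⊗ |x,(−1)^s⟩^{⊗(V∖a)}` of the star-graph state are unit vectors.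
[cite: HeinEtAl2006GraphStates, §8 (Examples: the GHZ ∕ star-graph state)] -/
theorem star_starBranch_dotProduct_self (a : Fin N) (s : Bool) (j : Fin N) :
    star (starBranch a s j) ⬝ᵥ starBranch a s j = 1 := by
  by_cases hj : j = a
  · subst hj
    cases s <;> simp [dotProduct]
  · cases s <;> simp [hj, dotProduct, xKet_eq] <;> rw [c_mul_c_lc] <;> norm_num

omit G [DecidableRel G.Adj] in
/-- **`⟨ST_a | 0⟩_a|+⟩^{⊗(V∖a)} = 1/√2`**: the product state `|0⟩_a ⊗ |+⟩^{⊗(V∖a)}` has fidelity `1/2` with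
the star-graph (GHZ) state `|ST_a⟩ = (|0⟩_a|+…+⟩ + |1⟩_a|−…−⟩)/√2`. [cite: GuhneTothHyllusBriegel2005, p. 4
(“the geometric measure equals `1/2` for all GHZ states”); HeinEtAl2006GraphStates, §8 (Examples)] -/
theorem star_graphStateVec_starGraph_dotProduct_productState (a : Fin N) :
    star (graphStateVec (SimpleGraph.starGraph a)) ⬝ᵥ productState (starBranch a false) =
      (Tsirelson.CHSHOpt.invSqrtTwo : ℂ) := by
  have hcross : star (productState (starBranch a true)) ⬝ᵥ productState (starBranch a false) = 0 := by
    rw [star_productState_dotProduct_productState]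
    exact Finset.prod_eq_zero (Finset.mem_univ a) (by simp [dotProduct])
  rw [graphStateVec_starGraph_eq_sum_productState, star_smul, star_add, smul_dotProduct, add_dotProduct,
    star_productState_starBranch_dotProduct_self, hcross, add_zero, smul_eq_mul, mul_one, Complex.star_def,
    Complex.conj_ofReal]

omit G [DecidableRel G.Adj] in
/-- **`𝒟(ST_n) ≥ 1/2`**: every LHV bound `C` of the star-graph (GHZ) Bell operator satisfies `2^N/2 ≤ C`, since
the product state `|0⟩_a|+⟩^{⊗(V∖a)}` has fidelity `1/2` and fully separable states admit a LHV description
(`two_pow_mul_normSq_productVec_le`). [cite: GuhneTothHyllusBriegel2005, p. 4 (“the fact that the geometric measure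
equals `1/2` for all GHZ states implies that always `𝒟(ST_n) ≥ 1/2`”)] -/
theorem two_pow_le_two_mul_of_forall_abs_lhvBell_starGraph_le (a : Fin N) (C : ℤ)
    (hC : ∀ m : Fin N → Pauli → ℤ, (∀ j P, m j P = 1 ∨ m j P = -1) → (∀ j, m j Pauli.I = 1) →
      |lhvBell (SimpleGraph.starGraph a) m| ≤ C) :
    (2 : ℤ) ^ N ≤ 2 * C := by
  have h := two_pow_mul_normSq_productVec_le (SimpleGraph.starGraph a) C hC (starBranch a false)
    (fun j => star_starBranch_dotProduct_self a false j)
  rw [productVec_eq_productState, star_graphStateVec_starGraph_dotProduct_productState, Complex.normSq_ofReal,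
    Tsirelson.CHSHOpt.invSqrtTwo_mul_self] at h
  have h' : ((2 : ℤ) ^ N : ℝ) ≤ ((2 * C : ℤ) : ℝ) := by push_cast; linarith
  exact_mod_cast h'

omit G [DecidableRel G.Adj] in
/-- The same in `𝒟`-form: `1/2 ≤ C/2^N` for every LHV bound `C` of `𝓑(ST_n)`. [cite: GuhneTothHyllusBriegel2005,
p. 4 (“always `𝒟(ST_n) ≥ 1/2`”)] -/
theorem half_le_dd_starGraph (a : Fin N) (C : ℤ)
    (hC : ∀ m : Fin N → Pauli → ℤ, (∀ j P, m j P = 1 ∨ m j P = -1) → (∀ j, m j Pauli.I = 1) →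
      |lhvBell (SimpleGraph.starGraph a) m| ≤ C) :
    (1 / 2 : ℝ) ≤ C / 2 ^ N := by
  have h := two_pow_le_two_mul_of_forall_abs_lhvBell_starGraph_le a C hC
  have h' : ((2 : ℤ) ^ N : ℝ) ≤ ((2 * C : ℤ) : ℝ) := by exact_mod_cast h
  push_cast at h'
  rw [le_div_iff₀ (by positivity)]
  linarith

omit G [DecidableRel G.Adj] in
/-- **`𝒟(FC_n) ≥ 1/2`** as well (`𝒟(ST_n) = 𝒟(FC_n)` by Lemma 4, `forall_abs_lhvBell_starGraph_le_iff_top`):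
every LHV bound `C` of the complete-graph Bell operator on `N ≥ 1` qubits satisfies `2^N ≤ 2C`.
[cite: GuhneTothHyllusBriegel2005, p. 4 (“Due to Lemma 4, the values `𝒟(ST_n)` and `𝒟(FC_n)` always coincide”
and “always `𝒟(ST_n) ≥ 1/2`”)] -/
theorem two_pow_le_two_mul_of_forall_abs_lhvBell_top_le (v : Fin N) (C : ℤ)
    (hC : ∀ m : Fin N → Pauli → ℤ, (∀ j P, m j P = 1 ∨ m j P = -1) → (∀ j, m j Pauli.I = 1) →
      |lhvBell (⊤ : SimpleGraph (Fin N)) m| ≤ C) :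
    (2 : ℤ) ^ N ≤ 2 * C :=
  two_pow_le_two_mul_of_forall_abs_lhvBell_starGraph_le v C
    ((forall_abs_lhvBell_starGraph_le_iff_top v C).mpr hC)

end StarGraphGeometric

/-! ### `𝒞(G)` is a graph invariant: relabelling the qubits along a bijection -/

section Relabel

variable {N M : ℕ} (G : SimpleGraph (Fin M)) [DecidableRel G.Adj] (H : SimpleGraph (Fin N)) [DecidableRel H.Adj]
  (e : Fin N ≃ Fin M)

/-- Under a relabelling `e` of the qubits (`H ≅ G`, `H.Adj i j ↔ G.Adj (e i) (e j)`) the neighbourhood parities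
correspond: `(Γ_H ξ)_i = (Γ_G (ξ∘e⁻¹))_{e i}`. [cite: GuhneTothHyllusBriegel2005, eqs. (1)–(4) (the stabilizing
operators and `𝒞(G)` are attached to the graph `G`; the numbering of the vertices is immaterial)] -/
theorem nbrParity_relabel (hH : ∀ i j, H.Adj i j ↔ G.Adj (e i) (e j)) (ξ : Fin N → Bool) (i : Fin N) :
    nbrParity H ξ i = nbrParity G (ξ ∘ ⇑e.symm) (e i) := by
  unfold nbrParity
  have hnb : H.neighborFinset i = (G.neighborFinset (e i)).map e.symm.toEmbedding := by
    ext l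
    rw [SimpleGraph.mem_neighborFinset, Finset.mem_map_equiv, Equiv.symm_symm, SimpleGraph.mem_neighborFinset, hH]
  rw [hnb, Finset.sum_map]
  rfl

/-- The `Z`-patterns correspond. [cite: GuhneTothHyllusBriegel2005, eqs. (1)–(4)] -/
theorem stabZ_relabel (hH : ∀ i j, H.Adj i j ↔ G.Adj (e i) (e j)) (ξ : Fin N → Bool) (i : Fin N) :
    stabZ H ξ i = stabZ G (ξ ∘ ⇑e.symm) (e i) := by
  unfold stabZ
  rw [nbrParity_relabel G H e hH]

/-- **The words correspond letter by letter**: `σ^{(i)}_ξ(H) = σ^{(e i)}_{ξ∘e⁻¹}(G)`.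
[cite: GuhneTothHyllusBriegel2005, eqs. (1)–(5)] -/
theorem stabWord_relabel (hH : ∀ i j, H.Adj i j ↔ G.Adj (e i) (e j)) (ξ : Fin N → Bool) (i : Fin N) :
    stabWord H ξ i = stabWord G (ξ ∘ ⇑e.symm) (e i) := by
  unfold stabWord
  rw [stabZ_relabel G H e hH, Function.comp_apply, e.symm_apply_apply]

omit G [DecidableRel G.Adj] H [DecidableRel H.Adj] in
/-- The number of `Y` letters is invariant under relabelling. [cite: GuhneTothHyllusBriegel2005, eq. (5)] -/
theorem countY_comp_equiv (w : Fin M → Pauli) : countY (w ∘ ⇑e) = countY w := by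
  unfold countY
  rw [← Finset.card_map e.toEmbedding]
  congr 1
  ext v
  rw [Finset.mem_map_equiv, Finset.mem_filter, Finset.mem_filter, Function.comp_apply, e.apply_symm_apply]
  simp

/-- The lit-edge counts correspond (a graph isomorphism of the lit-edge graphs).
[cite: HeinEisertBriegel2004, §2 (`⟨x|G⟩ ∝ Π_{{a,b}∈E}(−1)^{x_ax_b}`)] -/
theorem litEdgeCount_relabel (hH : ∀ i j, H.Adj i j ↔ G.Adj (e i) (e j)) (x : Fin N → ZMod 2) :
    litEdgeCount H x = litEdgeCount G (x ∘ ⇑e.symm) := by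
  unfold litEdgeCount
  let f : litEdges H x ≃g litEdges G (x ∘ ⇑e.symm) :=
    { toEquiv := e
      map_rel_iff' := fun {a b} => by
        change G.Adj (e a) (e b) ∧ (x ∘ ⇑e.symm) (e a) = 1 ∧ (x ∘ ⇑e.symm) (e b) = 1 ↔
          H.Adj a b ∧ x a = 1 ∧ x b = 1
        rw [Function.comp_apply, Function.comp_apply, e.symm_apply_apply, e.symm_apply_apply, hH] }
  exact f.card_edgeFinset_eq

/-- The quadratic forms correspond: `q_H(ξ) = q_G(ξ∘e⁻¹)`. [cite: HeinEisertBriegel2004, §2] -/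
theorem edgeParity_relabel (hH : ∀ i j, H.Adj i j ↔ G.Adj (e i) (e j)) (ξ : Fin N → Bool) :
    edgeParity H ξ = edgeParity G (ξ ∘ ⇑e.symm) := by
  rw [edgeParity_eq_litEdgeCount, edgeParity_eq_litEdgeCount, litEdgeCount_relabel G H e hH]
  rfl

/-- **The signs correspond**: `c_H(ξ) = c_G(ξ∘e⁻¹)`. [cite: GuhneTothHyllusBriegel2005, eq. (5)] -/
theorem stabSign_relabel (hH : ∀ i j, H.Adj i j ↔ G.Adj (e i) (e j)) (ξ : Fin N → Bool) :
    stabSign H ξ = stabSign G (ξ ∘ ⇑e.symm) := by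
  have hw : stabWord H ξ = stabWord G (ξ ∘ ⇑e.symm) ∘ ⇑e := funext fun i => stabWord_relabel G H e hH ξ i
  unfold stabSign
  rw [hw, countY_comp_equiv, edgeParity_relabel G H e hH]

/-- The LHV values of corresponding terms agree when the table is transported along `e`.
[cite: GuhneTothHyllusBriegel2005, eq. (7)] -/
theorem lhvValue_relabel (hH : ∀ i j, H.Adj i j ↔ G.Adj (e i) (e j)) (m : Fin N → Pauli → ℤ) (ξ : Fin N → Bool) :
    lhvValue m (stabWord H ξ) = lhvValue (fun v => m (e.symm v)) (stabWord G (ξ ∘ ⇑e.symm)) := by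
  unfold lhvValue
  exact Fintype.prod_equiv e _ _ fun j => by simp only [stabWord_relabel G H e hH, e.symm_apply_apply]

/-- **`𝒞` is a graph invariant**: `⟨𝓑(H)⟩_m = ⟨𝓑(G)⟩_{m∘e⁻¹}` for isomorphic graphs `H ≅ G` along `e` and every
table `m` — the `2^N` terms and their LHV values correspond one to one. [cite: GuhneTothHyllusBriegel2005, eq. (7)
(`𝒞(G) = max_{LHV}|⟨𝓑(G)⟩|` depends only on the graph)] -/
theorem lhvBell_relabel (hH : ∀ i j, H.Adj i j ↔ G.Adj (e i) (e j)) (m : Fin N → Pauli → ℤ) :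
    lhvBell H m = lhvBell G (fun v => m (e.symm v)) := by
  unfold lhvBell
  refine Fintype.sum_equiv (e.arrowCongr (Equiv.refl Bool)) _ _ fun ξ => ?_
  have hξ : (e.arrowCongr (Equiv.refl Bool)) ξ = ξ ∘ ⇑e.symm :=
    funext fun a => by rw [Equiv.arrowCongr_apply]; rfl
  rw [hξ, stabSign_relabel G H e hH, lhvValue_relabel G H e hH]

/-- Hence `𝒞(H) ≤ C ↔ 𝒞(G) ≤ C` for every `C`: `𝒟(H) = 𝒟(G)` for isomorphic graphs.
[cite: GuhneTothHyllusBriegel2005, eq. (7)] -/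
theorem forall_abs_lhvBell_relabel_le_iff (hH : ∀ i j, H.Adj i j ↔ G.Adj (e i) (e j)) (C : ℤ) :
    (∀ m : Fin N → Pauli → ℤ, (∀ j P, m j P = 1 ∨ m j P = -1) → (∀ j, m j Pauli.I = 1) → |lhvBell H m| ≤ C) ↔
      (∀ m : Fin M → Pauli → ℤ, (∀ j P, m j P = 1 ∨ m j P = -1) → (∀ j, m j Pauli.I = 1) → |lhvBell G m| ≤ C) := by
  constructor
  · intro h m hm hmI
    have h' := h (fun i => m (e i)) (fun i P => hm (e i) P) (fun i => hmI (e i))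
    rw [lhvBell_relabel G H e hH] at h'
    have hfun : (fun v => m (e (e.symm v))) = m := funext fun v => by rw [e.apply_symm_apply]
    rwa [hfun] at h'
  · intro h m hm hmI
    rw [lhvBell_relabel G H e hH]
    exact h _ (fun v P => hm (e.symm v) P) (fun v => hmI (e.symm v))

/-- **Lemma 3 for an arbitrary labelling**: if `H` is isomorphic to a single-edge join `G = G₁ — G₂`, then
`𝒞(H) ≤ 𝒞(G₁)·𝒞(G₂)`. [cite: GuhneTothHyllusBriegel2005, Lemma 3] -/
theorem abs_lhvBell_le_mul_of_relabel_isSingleEdgeJoin {N₁ N₂ : ℕ} (H : SimpleGraph (Fin N)) [DecidableRel H.Adj]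
    (G : SimpleGraph (Fin (N₁ + N₂))) [DecidableRel G.Adj] (G₁ : SimpleGraph (Fin N₁)) [DecidableRel G₁.Adj]
    (G₂ : SimpleGraph (Fin N₂)) [DecidableRel G₂.Adj] (i₀ : Fin N₁) (j₀ : Fin N₂)
    (hJ : IsSingleEdgeJoin G G₁ G₂ i₀ j₀) (e : Fin N ≃ Fin (N₁ + N₂)) (hH : ∀ i j, H.Adj i j ↔ G.Adj (e i) (e j))
    (C₁ C₂ : ℤ)
    (hC₁ : ∀ m₁ : Fin N₁ → Pauli → ℤ, (∀ j P, m₁ j P = 1 ∨ m₁ j P = -1) → (∀ j, m₁ j Pauli.I = 1) →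
      |lhvBell G₁ m₁| ≤ C₁)
    (hC₂ : ∀ m₂ : Fin N₂ → Pauli → ℤ, (∀ j P, m₂ j P = 1 ∨ m₂ j P = -1) → (∀ j, m₂ j Pauli.I = 1) →
      |lhvBell G₂ m₂| ≤ C₂)
    (m : Fin N → Pauli → ℤ) (hm : ∀ j P, m j P = 1 ∨ m j P = -1) (hmI : ∀ j, m j Pauli.I = 1) :
    |lhvBell H m| ≤ C₁ * C₂ :=
  (forall_abs_lhvBell_relabel_le_iff G H e hH (C₁ * C₂)).mpr
    (abs_lhvBell_le_mul_of_isSingleEdgeJoin hJ C₁ C₂ hC₁ hC₂) m hm hmI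

/-- **Theorem 2 for any labelling of the linear cluster**: if `H ≅ LC_{4k+r}` (`r < 4`) along a bijection of the
qubits, then `|⟨𝓑(H)⟩| ≤ 12^k·2^r` for every `±1` table — `𝒟(H) ≤ (3/4)^k`. [cite: GuhneTothHyllusBriegel2005,
Theorem 2 (proof: “for linear cluster graphs `LC_i` the value `1/𝒟(LC_i)` increases exponentially”)] -/
theorem abs_lhvBell_le_of_relabel_linearCluster (k r : ℕ) (hr : r < 4) (H : SimpleGraph (Fin N)) [DecidableRel H.Adj]
    (e : Fin N ≃ Fin (4 * k + r)) (hH : ∀ i j, H.Adj i j ↔ (linearCluster (4 * k + r)).Adj (e i) (e j))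
    (m : Fin N → Pauli → ℤ) (hm : ∀ j P, m j P = 1 ∨ m j P = -1) (hmI : ∀ j, m j Pauli.I = 1) :
    |lhvBell H m| ≤ 12 ^ k * 2 ^ r :=
  (forall_abs_lhvBell_relabel_le_iff (linearCluster (4 * k + r)) H e hH (12 ^ k * 2 ^ r)).mpr
    (fun m' hm' hm'I => abs_lhvBell_linearCluster_le k r hr m' hm' hm'I) m hm hmI

end Relabel

/-! ### Stochastic local models for an arbitrary family of signed Pauli words -/

section StochasticFamilies

variable {N : ℕ} {ι : Type*} [Fintype ι] (c : ι → ℤ) (w : ι → Fin N → Pauli)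

/-- **The value of a family `(c_i, w_i)` of signed Pauli words under a REAL-valued table** `r_j(σ) ∈ [−1,1]`
(a stochastic local model given by its single-site conditional means): `Σ_i c_i Π_j r_j(w_i(j))`; on `±1` tables it is
`lhvSum`. [cite: GuhneTothHyllusBriegel2005, eq. (7) and the remark after it (“nondeterministic LHV models can be viewed
as deterministic LHV models where the hidden variables are not known”)] -/
def lhvSumR (r : Fin N → Pauli → ℝ) : ℝ := ∑ i, (c i : ℝ) * ∏ j, r j (w i j)

/-- On `±1` tables the real value is `lhvSum`. [cite: GuhneTothHyllusBriegel2005, eq. (7)] -/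
theorem lhvSumR_intCast (m : Fin N → Pauli → ℤ) : lhvSumR c w (fun j P => (m j P : ℝ)) = (lhvSum c w m : ℝ) := by
  unfold lhvSumR lhvSum lhvValue
  push_cast
  rfl

/-- The coefficient of `r_v(P)` in `lhvSumR`: the words whose letter at `v` is `P`, evaluated off `v`.
[cite: GuhneTothHyllusBriegel2005, eq. (7)] -/
def coeffAtF (r : Fin N → Pauli → ℝ) (v : Fin N) (P : Pauli) : ℝ :=
  ∑ i ∈ Finset.univ.filter (fun i => w i v = P), (c i : ℝ) * ∏ j ∈ Finset.univ.erase v, r j (w i j)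

/-- `lhvSumR` is affine in the values at one site: `= Σ_P A_P · r_v(P)`. [cite: GuhneTothHyllusBriegel2005, eq. (7)] -/
theorem lhvSumR_eq_sum_coeffAtF (r : Fin N → Pauli → ℝ) (v : Fin N) :
    lhvSumR c w r = ∑ P : Pauli, coeffAtF c w r v P * r v P := by
  unfold lhvSumR coeffAtF
  rw [← Finset.sum_fiberwise Finset.univ (fun i => w i v) _]
  refine Finset.sum_congr rfl fun P _ => ?_
  rw [Finset.sum_mul]
  refine Finset.sum_congr rfl fun i hi => ?_
  rw [← (Finset.mem_filter.mp hi).2, ← Finset.mul_prod_erase Finset.univ (fun j => r j (w i j)) (Finset.mem_univ v)]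
  ring

/-- The coefficients do not see the values at `v`. [cite: GuhneTothHyllusBriegel2005, eq. (7)] -/
theorem coeffAtF_update (r : Fin N → Pauli → ℝ) (v : Fin N) (s : Pauli → ℝ) (P : Pauli) :
    coeffAtF c w (Function.update r v s) v P = coeffAtF c w r v P := by
  unfold coeffAtF
  refine Finset.sum_congr rfl fun i _ => ?_
  congr 1
  exact Finset.prod_congr rfl fun j hj => by rw [Function.update_of_ne (Finset.ne_of_mem_erase hj)]

/-- One site at a time the `[−1,1]` values can be replaced by signs without decreasing `|lhvSumR|`.
[cite: GuhneTothHyllusBriegel2005, after eq. (7)] -/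
theorem exists_update_signsF (r : Fin N → Pauli → ℝ) (hr : ∀ j P, |r j P| ≤ 1) (hrI : ∀ j, r j Pauli.I = 1)
    (v : Fin N) :
    ∃ s : Pauli → ℝ, s Pauli.I = 1 ∧ (∀ P, s P = 1 ∨ s P = -1) ∧
      |lhvSumR c w r| ≤ |lhvSumR c w (Function.update r v s)| := by
  obtain ⟨sx, sy, sz, hsx, hsy, hsz, hle⟩ := exists_vertex_ge (coeffAtF c w r v Pauli.I) (coeffAtF c w r v Pauli.X)
    (coeffAtF c w r v Pauli.Y) (coeffAtF c w r v Pauli.Z) (r v Pauli.X) (r v Pauli.Y) (r v Pauli.Z)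
    (hr v _) (hr v _) (hr v _)
  let s : Pauli → ℝ := fun P => match P with
    | Pauli.I => 1 | Pauli.X => sx | Pauli.Y => sy | Pauli.Z => sz
  refine ⟨s, rfl, fun P => by cases P <;> simp [s, hsx, hsy, hsz], ?_⟩
  rw [lhvSumR_eq_sum_coeffAtF c w r v, lhvSumR_eq_sum_coeffAtF c w (Function.update r v s) v, Pauli.sum_univ,
    Pauli.sum_univ]
  simp only [coeffAtF_update, Function.update_self, hrI v]
  simpa [s] using hle

/-- **Every `[−1,1]`-valued table is dominated by a `±1` table** for an arbitrary family of signed words.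
[cite: GuhneTothHyllusBriegel2005, after eq. (7)] -/
theorem exists_pm_table_geF (r : Fin N → Pauli → ℝ) (hr : ∀ j P, |r j P| ≤ 1) (hrI : ∀ j, r j Pauli.I = 1) :
    ∃ m : Fin N → Pauli → ℤ, (∀ j P, m j P = 1 ∨ m j P = -1) ∧ (∀ j, m j Pauli.I = 1) ∧
      |lhvSumR c w r| ≤ |(lhvSum c w m : ℝ)| := by
  have aux : ∀ L : List (Fin N), ∀ r : Fin N → Pauli → ℝ, (∀ j P, |r j P| ≤ 1) → (∀ j, r j Pauli.I = 1) →
      ∃ r' : Fin N → Pauli → ℝ, (∀ j P, |r' j P| ≤ 1) ∧ (∀ j, r' j Pauli.I = 1) ∧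
        (∀ v ∈ L, ∀ P, r' v P = 1 ∨ r' v P = -1) ∧ |lhvSumR c w r| ≤ |lhvSumR c w r'| := by
    intro L
    induction L with
    | nil => intro r hr hrI; exact ⟨r, hr, hrI, fun v hv => absurd hv List.not_mem_nil, le_rfl⟩
    | cons v L ih =>
      intro r hr hrI
      obtain ⟨r₁, hr₁, hr₁I, hr₁L, hle₁⟩ := ih r hr hrI
      obtain ⟨s, hsI, hs, hle₂⟩ := exists_update_signsF c w r₁ hr₁ hr₁I v
      refine ⟨Function.update r₁ v s, fun j P => ?_, fun j => ?_, fun u hu P => ?_, hle₁.trans hle₂⟩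
      · by_cases hj : j = v
        · subst hj; rw [Function.update_self]; rcases hs P with h | h <;> rw [h] <;> norm_num
        · rw [Function.update_of_ne hj]; exact hr₁ j P
      · by_cases hj : j = v
        · subst hj; rw [Function.update_self]; exact hsI
        · rw [Function.update_of_ne hj]; exact hr₁I j
      · rcases List.mem_cons.mp hu with rfl | hu'
        · rw [Function.update_self]; exact hs P
        · by_cases hj : u = v
          · subst hj; rw [Function.update_self]; exact hs P
          · rw [Function.update_of_ne hj]; exact hr₁L u hu' P
  obtain ⟨r', -, hr'I, hr'pm, hle⟩ := aux (List.finRange N) r hr hrI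
  let m : Fin N → Pauli → ℤ := fun j P => if r' j P = 1 then 1 else -1
  have hm : ∀ j P, (m j P : ℝ) = r' j P := by
    intro j P
    rcases hr'pm j (List.mem_finRange j) P with h | h
    · simp [m, h]
    · simp only [m, h]; norm_num
  refine ⟨m, fun j P => by simp only [m]; split_ifs <;> simp, fun j => by simp [m, hr'I j], ?_⟩
  rw [← lhvSumR_intCast]
  have hfun : (fun j P => (m j P : ℝ)) = r' := funext fun j => funext fun P => hm j P
  rw [hfun]
  exact hle

/-- **A bound valid for all deterministic local models is valid for all stochastic local models**: if `|Σ_i c_i·lhv_m(w_i)| ≤ C`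
for every `±1` table `m` with `m(𝟙) = 1`, then `|Σ_i c_i Π_j r_j(w_i(j))| ≤ C` for every `[−1,1]`-valued table `r` with
`r(𝟙) = 1` — this applies to every Bell expression of this file and of `ClusterStateBellInequality.lean` (“it suffices to look
at deterministic LHV models”). [cite: GuhneTothHyllusBriegel2005, after eq. (7)] -/
theorem abs_lhvSumR_le (C : ℤ)
    (hC : ∀ m : Fin N → Pauli → ℤ, (∀ j P, m j P = 1 ∨ m j P = -1) → (∀ j, m j Pauli.I = 1) → |lhvSum c w m| ≤ C)
    (r : Fin N → Pauli → ℝ) (hr : ∀ j P, |r j P| ≤ 1) (hrI : ∀ j, r j Pauli.I = 1) :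
    |lhvSumR c w r| ≤ C := by
  obtain ⟨m, hm, hmI, hle⟩ := exists_pm_table_geF c w r hr hrI
  refine hle.trans ?_
  rw [← Int.cast_abs]
  exact_mod_cast hC m hm hmI

end StochasticFamilies

/-! ### Theorem 1, the two-vertex case: `|G_{K₂}⟩` violates the CHSH inequality maximally (`2√2 > 2`) -/

section TwoVertices

/-- The one-edge graph on two qubits (`LC₂ = K₂`). [cite: GuhneTothHyllusBriegel2005, proof of Theorem 1 (“If the graph
consists only of two connected vertices”)] -/
abbrev lc2 : SimpleGraph (Fin 2) := linearCluster 2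

/-- The stabilizer words of `|G_{K₂}⟩`: `XZ`, `ZX`, `YY` with signs `+1` (kernel computation). [cite: GuhneTothHyllusBriegel2005,
eq. (3) and proof of Theorem 1] -/
theorem stabWord_lc2 :
    stabWord lc2 (singleInd 0) = ![Pauli.X, Pauli.Z] ∧ stabWord lc2 (singleInd 1) = ![Pauli.Z, Pauli.X] ∧
      stabWord lc2 (pairInd 0 1) = ![Pauli.Y, Pauli.Y] ∧
      stabSign lc2 (singleInd 0) = 1 ∧ stabSign lc2 (pairInd 0 1) = 1 := by
  decide

/-- `⟨G_{K₂}|X⊗Z|G_{K₂}⟩ = 1`. [cite: GuhneTothHyllusBriegel2005, eq. (3)] -/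
theorem expect_XZ_lc2 : star (graphStateVec lc2) ⬝ᵥ (pauliWord ![Pauli.X, Pauli.Z] *ᵥ graphStateVec lc2) = 1 := by
  obtain ⟨h1, -, -, h4, -⟩ := stabWord_lc2
  have h := bellTerm_mulVec_graphStateVec lc2 (singleInd 0)
  rw [bellTerm, h1, h4, Int.cast_one, one_smul] at h
  rw [h, graphStateVec_norm]

/-- `⟨G_{K₂}|Y⊗Y|G_{K₂}⟩ = 1` (`K₀K₁ = (XZ)(ZX) = YY`). [cite: GuhneTothHyllusBriegel2005, eq. (3)] -/
theorem expect_YY_lc2 : star (graphStateVec lc2) ⬝ᵥ (pauliWord ![Pauli.Y, Pauli.Y] *ᵥ graphStateVec lc2) = 1 := by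
  obtain ⟨-, -, h3, -, h5⟩ := stabWord_lc2
  have h := bellTerm_mulVec_graphStateVec lc2 (pairInd 0 1)
  rw [bellTerm, h3, h5, Int.cast_one, one_smul] at h
  rw [h, graphStateVec_norm]

/-- Bob's two settings `B_± = (Z ± Y)/√2` (dichotomic: `B_±² = 𝟙`, Hermitian). [cite: GuhneTothHyllusBriegel2005, proof of
Theorem 1 (“equivalent to a two qubit singlet state, which violates the original Bell inequality”)] -/
noncomputable def bobSetting (s : ℤ) : Matrix Bool Bool ℂ :=
  (Tsirelson.CHSHOpt.invSqrtTwo : ℂ) • (Pauli.Z.mat + (s : ℂ) • Pauli.Y.mat)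

/-- `B_±² = 𝟙` for `s = ±1` (`ZY = −YZ`). [cite: GuhneTothHyllusBriegel2005, proof of Theorem 1] -/
theorem bobSetting_mul_self (s : ℤ) (hs : s = 1 ∨ s = -1) : bobSetting s * bobSetting s = 1 := by
  have hc : (Tsirelson.CHSHOpt.invSqrtTwo : ℂ) * Tsirelson.CHSHOpt.invSqrtTwo = 1 / 2 := c_mul_c_lc
  unfold bobSetting
  rw [Matrix.smul_mul, Matrix.mul_smul, smul_smul, hc]
  ext a b
  rcases hs with rfl | rfl <;> cases a <;> cases b <;>
    norm_num [Matrix.mul_apply, Fintype.sum_bool, Matrix.add_apply, Matrix.smul_apply, Complex.ext_iff]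

/-- `B_±` is Hermitian. [cite: GuhneTothHyllusBriegel2005, proof of Theorem 1] -/
theorem bobSetting_conjTranspose (s : ℤ) : (bobSetting s)ᴴ = bobSetting s := by
  unfold bobSetting
  rw [Matrix.conjTranspose_smul, Matrix.conjTranspose_add, Matrix.conjTranspose_smul, Pauli.conjTranspose_mat,
    Pauli.conjTranspose_mat]
  have h1 : star (Tsirelson.CHSHOpt.invSqrtTwo : ℂ) = Tsirelson.CHSHOpt.invSqrtTwo := by
    rw [Complex.star_def, Complex.conj_ofReal]
  have h2 : star ((s : ℤ) : ℂ) = s := by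
    rw [Complex.star_def, ← Complex.ofReal_intCast, Complex.conj_ofReal]
  rw [h1, h2]

/-- **The CHSH operator for `|G_{K₂}⟩`**: `A = X`, `A′ = Y` on the first qubit, `B = (Z+Y)/√2`, `B′ = (Z−Y)/√2` on the second;
`𝒪 = A⊗B + A⊗B′ + A′⊗B − A′⊗B′`. [cite: GuhneTothHyllusBriegel2005, proof of Theorem 1 (“the original Bell inequality
[bell64]”)] -/
noncomputable def chshGraphOp : Matrix (Fin 2 → Bool) (Fin 2 → Bool) ℂ :=
  tensorAll ![Pauli.X.mat, bobSetting 1] + tensorAll ![Pauli.X.mat, bobSetting (-1)] +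
    tensorAll ![Pauli.Y.mat, bobSetting 1] - tensorAll ![Pauli.Y.mat, bobSetting (-1)]

/-- Linearity of `tensorAll ![A, ·]` in the second slot. [folklore] -/
private theorem tensorAll_two_slot (A B C : Matrix Bool Bool ℂ) (β γ : ℂ) :
    tensorAll ![A, β • B + γ • C] = β • tensorAll ![A, B] + γ • tensorAll ![A, C] := by
  ext x y
  simp only [tensorAll_apply, Fin.prod_univ_two, Matrix.cons_val_zero, Matrix.cons_val_one, Matrix.add_apply,
    Matrix.smul_apply, smul_eq_mul]
  ring

/-- **`𝒪 = √2·(X⊗Z + Y⊗Y)`**: `B + B′ = √2 Z`, `B − B′ = √2 Y`. [cite: GuhneTothHyllusBriegel2005, proof of Theorem 1] -/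
theorem chshGraphOp_eq :
    chshGraphOp = ((2 : ℝ) * Tsirelson.CHSHOpt.invSqrtTwo : ℂ) • (pauliWord ![Pauli.X, Pauli.Z] + pauliWord ![Pauli.Y, Pauli.Y]) := by
  have hXZ : pauliWord ![Pauli.X, Pauli.Z] = tensorAll ![Pauli.X.mat, Pauli.Z.mat] := by
    ext x y; simp [pauliWord_apply, tensorAll_apply, Fin.prod_univ_two]
  have hYY : pauliWord ![Pauli.Y, Pauli.Y] = tensorAll ![Pauli.Y.mat, Pauli.Y.mat] := by
    ext x y; simp [pauliWord_apply, tensorAll_apply, Fin.prod_univ_two]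
  have hB : ∀ s : ℤ, bobSetting s = (Tsirelson.CHSHOpt.invSqrtTwo : ℂ) • Pauli.Z.mat +
      ((Tsirelson.CHSHOpt.invSqrtTwo : ℂ) * s) • Pauli.Y.mat := by
    intro s; unfold bobSetting; rw [smul_add, smul_smul]
  unfold chshGraphOp
  simp only [hB, tensorAll_two_slot]
  rw [hXZ, hYY]
  push_cast
  ext x y
  simp only [Matrix.add_apply, Matrix.sub_apply, Matrix.smul_apply, smul_eq_mul]
  ring

/-- **`⟨G_{K₂}|𝒪|G_{K₂}⟩ = 2√2`**: the two-vertex graph state attains the Tsirelson bound. [cite: GuhneTothHyllusBriegel2005,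
proof of Theorem 1 (“the graph state is equivalent to a two qubit singlet state, which violates the original Bell
inequality”)] -/
theorem expect_chshGraphOp :
    star (graphStateVec lc2) ⬝ᵥ (chshGraphOp *ᵥ graphStateVec lc2) = ((2 : ℝ) * Tsirelson.CHSHOpt.invSqrtTwo * 2 : ℂ) := by
  rw [chshGraphOp_eq, Matrix.smul_mulVec, dotProduct_smul, Matrix.add_mulVec, dotProduct_add, expect_XZ_lc2, expect_YY_lc2,
    smul_eq_mul]
  push_cast
  ring

/-- `2·(1/√2)·2 = 2√2 > 2`: the value exceeds the local bound. [cite: GuhneTothHyllusBriegel2005, proof of Theorem 1] -/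
theorem two_lt_chsh_value : (2 : ℝ) < 2 * Tsirelson.CHSHOpt.invSqrtTwo * 2 := by
  have hc := Tsirelson.CHSHOpt.invSqrtTwo_mul_self
  have hpos : 0 < Tsirelson.CHSHOpt.invSqrtTwo := by
    unfold Tsirelson.CHSHOpt.invSqrtTwo; positivity
  nlinarith [hc, hpos]

/-- **The CHSH inequality for local models**: `|ab + ab′ + a′b − a′b′| ≤ 2` for pre-established values `±1` (the two
settings of each party are `A = X, A′ = Y` and `B, B′`; a deterministic model assigns them `a, a′, b, b′`).
[cite: GuhneTothHyllusBriegel2005, proof of Theorem 1 (“the original Bell inequality [bell64]”)] -/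
theorem chsh_lhv (a a' b b' : ℤ) (ha : a = 1 ∨ a = -1) (ha' : a' = 1 ∨ a' = -1) (hb : b = 1 ∨ b = -1)
    (hb' : b' = 1 ∨ b' = -1) : |a * b + a * b' + a' * b - a' * b'| ≤ 2 := by
  rcases ha with rfl | rfl <;> rcases ha' with rfl | rfl <;> rcases hb with rfl | rfl <;> rcases hb' with rfl | rfl <;>
    norm_num

end TwoVertices

end GraphStateLC

end Literature.InformationTheory.Entanglement
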